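import Literature.Combinatorics.Additive.HamidouneRodsethAbelianGroups

/-!
# The Hamidoune–Rødseth theorem for abelian groups, pair form (Hamidoune–Serra–Zémor 2008, §8,
# Theorem 29): both items

Topic `Literature/Combinatorics/Additive`.  Cell `mm-stpp` (D-0046), seat `mm-stpp-lit` (gens 16–17);
continuation of `HamidouneRodsethAbelianGroups.lean` (imported: Theorem 28
`exists_subset_apFinset_or_periodic_of_conn_three_eq_card`, the progression transfer
`subset_apFinset_of_isAP_of_card_add_le_of_zmultiples`, Lemma 25
`subset_apFinset_of_card_add_le_of_subset_apFinset`) and of `TwoAtomsOfSmallSumsets.lean`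
(Theorem 14 `isAP_or_vadd_erase_eq_of_forall_card_le_addOrderOf`, Corollary 8
`min_le_card_add_of_forall_le_addOrderOf`, Proposition 15 in the aperiodic case
`eq_singleton_or_isAP_of_card_add_le_of_forall_card_le_addOrderOf`, the decomposition modulo a
subgroup `card_add_eq_card_image_mul`).  That file has reached the size cap of the tree, hence this
sibling.  Everything here is PROVED (0 `sorry`, 0 named facts).

## Source (read at the page this session)

Y. O. Hamidoune, O. Serra, G. Zémor, *On the critical pair theory in abelian groups: beyond
Chowla's theorem*, Combinatorica 28 (2008) 441–467 = arXiv:math/0603478 [HamidouneSerraZemor2008],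
§8, **Theorem 29** (p0014–p0015 of the held text `paper:arxiv-math_0603478`): "Let `G` be a finite
abelian group with `gcd(|G|, 6) = 1`.  Let `0 ∈ S` be a generating subset of `G` such that
`|S| ≥ 4` and every element in `S*` has order at least `|S| + 1`.  Let `Q` be a maximal subgroup
such that `|S* + Q| − |S*| ≤ 1` and let `σ : G → G/Q` denote the canonical projection.  Let `T` be
a subset of `G` such that `|T| ≥ 3` and suppose that `|S + T| = |S| + |T| ≤ |G| − 4`.  Then the
following holds: • If `Q = {0}` then `S` and `T` are progressions or quasi-progressions with the
same difference. • If `Q ≠ {0}`, `|σ(T)| ≥ 2`, and `|σ(S + T)| < |G|/|Q| − 1` then `σ(S)` and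
`σ(T)` are arithmetic progressions with the same difference.  Moreover we have
`|(T ∖ T₁) + Q| ≤ |T ∖ T₁| + 1` where `T₁` is a subset of `T` such that `σ(T₁)` is a single,
extremal element of the progression `σ(T)`.  Furthermore if `0` is not an extremal element of the
progression `σ(S)`, then `|T + Q| ≤ |T| + 1`."

FIRST ITEM (gen 16): `exists_subset_apFinset_of_card_add_eq_of_aperiodic`, with the prime-order
theorem it generalizes ("Our result is also a generalization to abelian groups of Theorem (th:HR),
i.e. the main result of [HR]"): [HamidouneRodseth2000, Theorem 3] `hamidouneRodseth_inverse_theorem`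
(`|A|, |B| ≥ 3`, `7 ≤ |A + B| = |A| + |B| ≤ p − 4` in `ℤ/pℤ` ⇒ almost progressions with a common
difference; the tree's `HamidouneRodseth.hamidouneRodseth_of_card_three` assumes the `|A| = 3`
layer, this corollary does not).  Printed proof (Case 1): "`S` is `3`-separable and `κ₃(S) ≤ |S|`.
By Theorems 14 and 28, `S` is an arithmetic progression or quasi-progression.  By Lemma 25 it
follows that `T` is an arithmetic progression or quasi-progression with the same difference."

SECOND ITEM (gen 17): `exists_apFinset_image_of_card_add_eq` (all three conclusions), assembled
from `exists_isAP_image_of_card_add_eq` (the progressions),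
`card_filter_add_le_of_image_eq_apFinset_of_card_add_eq` ("Moreover") and
`card_add_le_card_succ_of_image_eq_apFinset` ("Furthermore").  Printed proof (Case 2), followed
step by step: `S ∩ Q = {0}` (`eq_zero_of_mem_addSubgroup`); the orders in `σ(S)*` are
`≥ (|S| + 1)/q`, hence `≥ |σ(S)|` (`card_image_le_addOrderOf`); display (eq:withcor8) = Corollary 8
in `G ⧸ Q`; display (eq:Qperiodic) "`Σ = (S* + T) ∖ (T + Q)` is `Q`-periodic" (`sdiff_add_eq_sdiff`);
display (eq:noname) `|σ(S) + σ(T)| = |σ(S)| + |σ(T)| − 1` (`card_image_add_succ_eq`); "`Q` maximal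
⇒ `σ(S*)` is not periodic" (`vadd_image_erase_ne`); Proposition 15 in `G ⧸ Q`, where the
stabilizer of `σ(S)*` is trivial — i.e. its aperiodic case, the tree's
`eq_singleton_or_isAP_of_card_add_le_of_forall_card_le_addOrderOf`, applied to `σ(S)` and the
translate of `σ(T)` through `0`; **Claim 3** by induction on `|σ(B)|`
(`card_filter_add_le_of_image_eq_apFinset`); the final paragraph ("Furthermore").

PROPOSITION 15 WITH ITS STABILIZER (gen 17; §3, p0007 of the held text): "Let `0 ∈ S` be a
generating subset of a finite abelian group `G` and let `0 ∈ T` be a subset of `G`.  Let `Q` denote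
the stabilizer of `S ∖ {0}`.  Suppose that `|T + S| ≤ |T| + |S| − 1 < |G| − |Q|`.  Also assume that
every element of `S* = S ∖ {0}` has order `≥ |S|`.  Let `σ : G → G/Q` denote the canonical
projection.  One of the following holds: (i) either `T ⊂ Q`, (ii) or `σ(S)` and `σ(T)` are
arithmetic progressions with the same difference.  Moreover, at most one member of the
decomposition of `T` modulo `Q` is not a complete coset modulo `Q`." —
`subset_or_exists_isAP_image_of_card_add_le` with `exists_forall_card_filter_eq_of_image_eq_apFinset`
("Moreover"); the case `Q = {0}` is `eq_singleton_or_isAP_of_card_add_le_of_forall_card_le_addOrderOf`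
of `TwoAtomsOfSmallSumsets.lean`, which the general case invokes in `G ⧸ Q`.  COROLLARY 16 (§3,
p0007; `S` generating a subgroup `H`, decomposition of `T` modulo `H`):
`exists_traces_eq_and_isAP_of_card_add_le`, via Corollary 8 inside `H`
(`min_le_card_add_of_subset_vadd`) and Proposition 15 inside the group `↥H`, transported back to
`G ⧸ Q` along `H/Q ↪ G/Q`.  With this file §3 of the paper (Theorem 14, Proposition 15,
Corollary 16) is complete in the tree.  CONSUMABLE FORM for groups whose prime factors are large
(`≥ |S| + 2`: then "`Q = {0}`" and the order condition of Theorem 29 are automatic):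
`exists_subset_apFinset_of_card_add_eq_of_prime_factors`, `exists_subset_apFinset_pair_of_prime_factors`;
and, one below (critical pairs, prime factors `≥ |A|`), the Vosper alternative
`exists_isAP_pair_of_card_add_le_of_prime_factors` (Proposition 15 with `Q = {0}`).

## Deviations from print

First item: "`Q = {0}`" (no non-zero subgroup `Q` has `|S* + Q| ≤ |S*| + 1`) is the hypothesis
`∀ H ≠ ⊥, |S* + H| ≥ |S| + 1` of `exists_subset_apFinset_of_card_add_eq_of_aperiodic`; the proof
runs through the elementwise form "every set `P ⊇ S*` invariant under a non-zero translation has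
`|P| ≥ |S| + 1`" (`exists_subset_apFinset_of_card_add_le_of_forall_vadd`,
`card_succ_le_of_forall_addSubgroup_card_add`), which is the form in which Theorem 14 (`S*`
periodic) and Theorem 28 (`S*` quasi-periodic) deliver the excluded alternatives.  "Progressions or
quasi-progressions with the same difference" is rendered as `S ⊆ {a, …, a + |S| r}`,
`T ⊆ {b, …, b + |T| r}` for one generator `r` of `G` (as in Theorem 28); `|S + T| = |S| + |T|` is
only used as `≤`.

Second item: the subgroup `Q` comes with its finset `Qf` (`∀ g, g ∈ Qf ↔ g ∈ Q`); "`Q` maximal" is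
maximality under inclusion among the subgroups `H` with `|S* + H| ≤ |S*| + 1 = |S|` (which is what
the printed step "`Q` maximal ⇒ `σ(S*)` not periodic" uses); "`|σ(S + T)| < |G|/|Q| − 1`" is
`|σ(S + T)| + 2 ≤ |G ⧸ Q|` (`Nat.card`); "arithmetic progressions with the same difference" is
`IsAP (σ S) d ∧ IsAP (σ T) d`, resp. `σ(S) = {a, …, a + (m−1)d}`, `σ(T) = {b, …, b + (k−1)d}`
(`apFinset`, `m = |σ(S)|`, `k = |σ(T)|`).  In (eq:Qperiodic) we do not name the decomposition
`S* = S₀ ∪ S₁`: the printed trace argument is run on the trace of `S*` through the summand `s` of a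
point `s + t ∈ Σ` whose `Q`-translate would leave `S* + T` (pigeonhole in a coset forces that trace
to be the short one and `T ∩ (t + Q) = {t}`, all other traces of `S*` being full cosets), reaching
the printed contradiction `|S + (T ∖ T')| < |S| + |T ∖ T'| − 1` with Corollary 8.  Claim 3 carries,
instead of "`|σ(B)| ≤ |σ(T)|`", the inequality `m + t − 2 < o(d)` which that hypothesis serves (the
top coset `u + (t−1)d` of `σ(S) + σ(B)` is met only by `S' + B'`), and `κ₁(S) = |S| − 1` in the form
of Corollary 8.  "Moreover" is proved for EVERY common difference `d` and orientation in which the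
terminal element of `σ(S)` is non-zero ("we may assume without loss of generality that the terminal
element `u` of `σ(S)` is not `0`"), with `T₁ = σ⁻¹(b) ∩ T` the trace over the initial element of
`σ(T)`; "Furthermore" ("`0` not extremal": `a ≠ 0` and `a + (m−1)d ≠ 0`) is obtained by applying
"Moreover" in both directions `d` and `−d` (the printed "claim applied … by permuting initial and
terminal elements … gives `|T₁| ≥ |Q| − 1`"), then `S* + T` `Q`-periodic, `σ(S*) + σ(T) =
σ(S) + σ(T)`, and (eq:noname).  The hypothesis `|S| ≥ 4` is not used by the second item, and the
maximality of `Q` and `|σ(T)| ≥ 2` only by the progression part.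

Proposition 15 (general `Q`): `Q` is given with its finset `Qf` as the stabilizer (`S* + Q = S*`
and `g + S* = S* ⇒ g ∈ Q`); "`|T| + |S| − 1 < |G| − |Q|`" is `|T| + |S| + |Q| ≤ |G|`.  The printed
proof ends with "Theorem 14 in `G/Q` implies that `σ(S)` is an arithmetic progression"; Theorem 14
needs `σ(S)` to be `2`-separable in `G/Q` with `κ₂ ≤ |σ(S)| − 1`, and the natural witness `σ(T)`
only works when `|σ(T) + σ(S)| ≤ |G/Q| − 2` (then we call Proposition 15's own case `Q = {0}` in
`G ⧸ Q`).  The boundary case `|σ(T) + σ(S)| = |G/Q| − 1` does occur (`G/Q = ℤ/7`, `σ(S) =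
{0, 1, 2}`, `σ(T) = {0, 1, 2, 3}` with full traces) and is settled here by a SUPPLEMENT not in print:
`σ(T)` is then the complement of `c − σ(S)` for the missing class `c`, the hypothesis
`|T + S| < |G| − |Q|` yields `t̄ ∈ σ(T)` with `t̄ − σ(S*)` disjoint from `σ(T)`, so
`(c − t̄) + σ(S*) ⊆ σ(S)`, and `eq_apFinset_of_vadd_erase_subset` (a set absorbing a translate of
its non-zero part, under aperiodicity and the order condition, is a progression) finishes; the case
`σ(T) + σ(S) = G/Q` is excluded by counting full cosets of `T + S`.  "Moreover" is proved for any
presentation of the two progressions by the printed unique-expressibility count.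
Corollary 16: `H` and `Q` come with finsets `Hf`, `Qf`; "`|S| + |T| − 1 < |H + T| − |Q|`" is
`|S| + |T| + |Q| ≤ |H + T|`; the ordering "`|T₁ + S| ≤ |T₂ + S| ≤ ⋯`" is replaced by naming the
exceptional coset `c₁` (the one with `|T₁ + S| < |H|`; all other traces are full cosets, for which
`|T_i + S| = |H|`); alternative (i) "`T₁ − T₁ ⊂ Q`" is `T₁ − T₁ ⊆ Qf`.
Census-silent Literature shelf: no row, bracket, threshold or verdict word of the cell moves; no `ω`.
-/

namespace Literature.Combinatorics.Additive

open Finset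
open scoped Pointwise

namespace Isoperimetric

variable {G : Type*} [AddCommGroup G] [Fintype G] [DecidableEq G]

/-- **[HamidouneSerraZemor2008, §8, Theorem 29, first item (`Q = {0}`)], elementwise form of the
hypothesis.**  Let `G` be a finite abelian group with `gcd(|G|, 6) = 1`, `0 ∈ S` a generating subset
with `|S| ≥ 4` whose non-zero elements have order `≥ |S| + 1`, such that `S* = S ∖ {0}` lies in no
set with at most `|S|` elements invariant under a non-zero translation, and let `|T| ≥ 3` with
`|S + T| ≤ |S| + |T| ≤ |G| − 4`.  Then `S` and `T` are progressions or quasi-progressions with the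
same difference: for a generator `r` of `G`, `S ⊆ {a, …, a + |S| r}` and `T ⊆ {b, …, b + |T| r}`.
Proof as printed: `T` is `3`-admissible, so `S` is `3`-separable with `κ₃(S) ≤ |S|`; if
`κ₃(S) < |S|` then `κ₂(S) < |S|` and Theorem 14 makes `S` a progression (its periodic alternative
is excluded), and `T` follows by the progression transfer; if `κ₃(S) = |S|` then Theorem 28 makes
`S` a quasi-progression (its quasi-periodic alternative is excluded), and `T` follows by Lemma 25.
[cite: HamidouneSerraZemor2008, §8, Theorem 29 (first item) and its proof, Case 1] -/
theorem exists_subset_apFinset_of_card_add_le_of_forall_vadd {S T : Finset G}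
    (hcop : (Fintype.card G).Coprime 6) (h0 : (0 : G) ∈ S)
    (hgen : AddSubgroup.closure (S : Set G) = ⊤) (hS4 : 4 ≤ #S)
    (hord : ∀ s ∈ S, s ≠ 0 → #S + 1 ≤ addOrderOf s)
    (hQ : ∀ q : G, q ≠ 0 → ∀ P : Finset G, S.erase 0 ⊆ P → q +ᵥ P = P → #S + 1 ≤ #P)
    (hT3 : 3 ≤ #T) (hST : #(S + T) ≤ #S + #T) (hSTn : #S + #T + 4 ≤ Fintype.card G) :
    ∃ r a b : G, AddSubgroup.zmultiples r = ⊤ ∧ S ⊆ apFinset a r (#S + 1) ∧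
      T ⊆ apFinset b r (#T + 1) := by
  classical
  have h2n : ¬ 2 ∣ Fintype.card G := fun h => by
    have := (Nat.Coprime.coprime_dvd_left h hcop).eq_one_of_dvd (by norm_num); omega
  have hn12 : Fintype.card G ≠ 12 := by omega
  have hTS : #(T + S) ≤ #T + #S := by rw [add_comm, Nat.add_comm #T]; exact hST
  have hTne : T.Nonempty := card_pos.1 (by omega)
  -- `T` is `3`-admissible: `S` is `3`-separable with `κ₃(S) ≤ |S|`
  have hTadm : IsAdm 3 S T := ⟨hT3, by omega⟩
  have hsep : IsSeparable 3 S := ⟨T, hTadm⟩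
  have hκ3 : conn 3 S ≤ #S := by have := conn_le hTadm; omega
  rcases Nat.lt_or_ge (conn 3 S) #S with hlt | hge
  · -- `κ₃(S) < |S|`: Theorem 14
    obtain ⟨X, hX⟩ := exists_isFragment hsep
    have hXadm2 : IsAdm 2 S X := ⟨le_trans (by norm_num) hX.1.1, by have := hX.1.2; omega⟩
    have hκ2 : conn 2 S + 1 ≤ #S := by
      have h1 := conn_le hXadm2
      have h2 := hX.2
      omega
    rcases isAP_or_vadd_erase_eq_of_forall_card_le_addOrderOf h0 hgen ⟨X, hXadm2⟩ hκ2
      (fun s hs hs0 => Nat.le_of_succ_le (hord s hs hs0)) with ⟨d, hd0, a, hSeq⟩ | ⟨d, hd0, hper⟩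
    · have hr : AddSubgroup.zmultiples d = ⊤ :=
        zmultiples_eq_top_of_zero_mem_subset_apFinset h0 hgen hSeq.subset
      obtain ⟨b, hb⟩ := subset_apFinset_of_isAP_of_card_add_le_of_zmultiples hr ⟨a, hSeq⟩
        (by omega) hTne hTS (by omega)
      exact ⟨d, a, b, hr, (subset_of_eq hSeq).trans (apFinset_mono a d (by omega)), hb⟩
    · exact absurd (hQ d hd0 (S.erase 0) Subset.rfl hper) (by rw [card_erase_of_mem h0]; omega)
  · -- `κ₃(S) = |S|`: Theorem 28
    have hκ : conn 3 S = #S := le_antisymm hκ3 hge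
    rcases exists_subset_apFinset_or_periodic_of_conn_three_eq_card h0 hgen hcop hS4 (by omega)
      hsep hκ hord with ⟨r, a, hr, hSsub⟩ | ⟨P, hSP, hPc, q, hq0, hqP⟩
    · obtain ⟨b, hb⟩ := subset_apFinset_of_card_add_le_of_subset_apFinset hr hn12 (by omega) hSsub
        hT3 hTS (by omega)
      exact ⟨r, a, b, hr, hSsub, hb⟩
    · exact absurd (hQ q hq0 P hSP hqP) (by omega)


omit [Fintype G] in
/-- A set invariant under `q` is invariant under every element of `⟨q⟩`. [folklore] -/
private theorem vadd_eq_of_mem_zmultiples {P : Finset G} {q : G} (hqP : q +ᵥ P = P)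
    {g : G} (hg : g ∈ AddSubgroup.zmultiples q) : g +ᵥ P = P := by
  have hqP' : -q +ᵥ P = P := by
    have := congrArg (fun X : Finset G => -q +ᵥ X) hqP
    simp only [vadd_vadd, neg_add_cancel, zero_vadd] at this
    exact this.symm
  have key : ∀ k : ℤ, k • q +ᵥ P = P := by
    intro k
    induction k using Int.induction_on with
    | zero => rw [zero_zsmul, zero_vadd]
    | succ i ih => rw [add_zsmul, one_zsmul, ← vadd_vadd, hqP, ih]
    | pred i ih =>
      rw [sub_eq_add_neg, add_zsmul, neg_one_zsmul, ← vadd_vadd, hqP', ih]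
  obtain ⟨k, rfl⟩ := AddSubgroup.mem_zmultiples_iff.1 hg
  exact key k

omit [Fintype G] in
/-- **The alternative "`S*` is quasi-periodic" of Theorem 28 in subgroup language:** a set
`P ⊇ S*` with `|P| = |S|` invariant under a translation `q ≠ 0` yields the non-zero subgroup
`H = ⟨q⟩` with `|S* + H| ≤ |S| = |S*| + 1` (as `S* + H ⊆ P`). [cite: HamidouneSerraZemor2008, §8
(before Theorem 28: "a set quasi-periodic if it can be obtained by deleting one element from a
periodic set"; Theorem 29: "`|S* + Q| − |S*| ≤ 1`")] -/
theorem card_add_le_of_periodic_superset {S P : Finset G} {q : G} (hq : q ≠ 0)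
    (hSP : S.erase 0 ⊆ P) (hPS : #P = #S) (hqP : q +ᵥ P = P) (Hf : Finset G)
    (hHf : ∀ g, g ∈ Hf ↔ g ∈ AddSubgroup.zmultiples q) :
    AddSubgroup.zmultiples q ≠ ⊥ ∧ #(S.erase 0 + Hf) ≤ #S := by
  refine ⟨fun h => hq ?_, hPS ▸ card_le_card fun x hx => ?_⟩
  · have : q ∈ AddSubgroup.zmultiples q := AddSubgroup.mem_zmultiples q
    rwa [h, AddSubgroup.mem_bot] at this
  · obtain ⟨s, hs, h, hh, rfl⟩ := mem_add.1 hx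
    rw [← vadd_eq_of_mem_zmultiples hqP ((hHf h).1 hh), add_comm]
    exact mem_vadd_finset.2 ⟨s, hSP hs, rfl⟩

/-- **"`Q = {0}`" in the two forms:** if no non-zero subgroup `Q` satisfies `|S* + Q| ≤ |S*| + 1`
(i.e. `|S* + Q| ≥ |S| + 1` for every `Q ≠ {0}`), then every set `P ⊇ S*` invariant under a
non-zero translation `q` has `|P| ≥ |S| + 1` (as `P ⊇ S* + ⟨q⟩`).
[cite: HamidouneSerraZemor2008, §8, Theorem 29 (the maximal subgroup `Q` with
`|S* + Q| − |S*| ≤ 1`)] -/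
theorem card_succ_le_of_forall_addSubgroup_card_add {S : Finset G}
    (hQ : ∀ (H : AddSubgroup G) (Hf : Finset G), (∀ g, g ∈ Hf ↔ g ∈ H) → H ≠ ⊥ →
      #S + 1 ≤ #(S.erase 0 + Hf))
    {q : G} (hq : q ≠ 0) {P : Finset G} (hSP : S.erase 0 ⊆ P) (hqP : q +ᵥ P = P) :
    #S + 1 ≤ #P := by
  classical
  set H := AddSubgroup.zmultiples q with hH
  have hHb : H ≠ ⊥ := by
    intro h
    have : q ∈ H := AddSubgroup.mem_zmultiples q
    rw [h, AddSubgroup.mem_bot] at this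
    exact hq this
  refine (hQ H (univ.filter fun g => g ∈ H) (fun g => by simp) hHb).trans (card_le_card ?_)
  intro x hx
  obtain ⟨s, hs, h, hh, rfl⟩ := mem_add.1 hx
  rw [mem_filter] at hh
  rw [← vadd_eq_of_mem_zmultiples hqP hh.2, add_comm]
  exact mem_vadd_finset.2 ⟨s, hSP hs, rfl⟩

/-- **[HamidouneSerraZemor2008, §8, Theorem 29, first item (`Q = {0}`)].**  "Let `G` be a finite
abelian group with `gcd(|G|, 6) = 1`.  Let `0 ∈ S` be a generating subset of `G` such that
`|S| ≥ 4` and every element in `S*` has order at least `|S| + 1`.  Let `Q` be a maximal subgroup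
such that `|S* + Q| − |S*| ≤ 1` …  Let `T` be a subset of `G` such that `|T| ≥ 3` and suppose that
`|S + T| = |S| + |T| ≤ |G| − 4`.  • If `Q = {0}` then `S` and `T` are progressions or
quasi-progressions with the same difference."  Here `Q = {0}` is the hypothesis "every subgroup
`H ≠ {0}` has `|S* + H| ≥ |S*| + 2 = |S| + 1`", and the conclusion is `S ⊆ {a, …, a + |S| r}`,
`T ⊆ {b, …, b + |T| r}` for one generator `r` of `G`.
[cite: HamidouneSerraZemor2008, §8, Theorem 29 (first item)] -/
theorem exists_subset_apFinset_of_card_add_eq_of_aperiodic {S T : Finset G}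
    (hcop : (Fintype.card G).Coprime 6) (h0 : (0 : G) ∈ S)
    (hgen : AddSubgroup.closure (S : Set G) = ⊤) (hS4 : 4 ≤ #S)
    (hord : ∀ s ∈ S, s ≠ 0 → #S + 1 ≤ addOrderOf s)
    (hQ : ∀ (H : AddSubgroup G) (Hf : Finset G), (∀ g, g ∈ Hf ↔ g ∈ H) → H ≠ ⊥ →
      #S + 1 ≤ #(S.erase 0 + Hf))
    (hT3 : 3 ≤ #T) (hST : #(S + T) = #S + #T) (hSTn : #S + #T + 4 ≤ Fintype.card G) :
    ∃ r a b : G, AddSubgroup.zmultiples r = ⊤ ∧ S ⊆ apFinset a r (#S + 1) ∧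
      T ⊆ apFinset b r (#T + 1) :=
  exists_subset_apFinset_of_card_add_le_of_forall_vadd hcop h0 hgen hS4 hord
    (fun _ hq _ hSP hqP => card_succ_le_of_forall_addSubgroup_card_add hQ hq hSP hqP) hT3 hST.le
    hSTn

/-! ### The prime-order theorem of Hamidoune and Rødseth as a corollary -/

omit [Fintype G] in
/-- Translating a progression: `c + {a, a + d, …} = {c + a, c + a + d, …}`. [folklore] -/
private theorem vadd_apFinset_eq_apFinset_add (c a d : G) (n : ℕ) :
    c +ᵥ apFinset a d n = apFinset (c + a) d n := by
  classical
  ext x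
  simp only [mem_vadd_finset, mem_apFinset, vadd_eq_add]
  constructor
  · rintro ⟨y, ⟨i, hi, rfl⟩, rfl⟩
    exact ⟨i, hi, by rw [add_assoc]⟩
  · rintro ⟨i, hi, rfl⟩
    exact ⟨a + i • d, ⟨i, hi, rfl⟩, by rw [add_assoc]⟩

/-- **[HamidouneRodseth2000, Theorem 3] (Hamidoune–Rødseth, "An inverse theorem mod `p`"), from
[HamidouneSerraZemor2008, Theorem 29]:** "Suppose that `|A|, |B| ≥ 3`, and that
`7 ≤ |A + B| = |A| + |B| ≤ p − 4`.  Then `A` and `B` are almost-progressions with the same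
difference": there are `e ≠ 0` and `a, b` with `A ⊆ {a, a + e, …, a + |A| e}` and
`B ⊆ {b, b + e, …, b + |B| e}`.  ("Our result is also a generalization to abelian groups of
Theorem (th:HR)" [HamidouneSerraZemor2008, §8]: in `ℤ/pℤ` every non-zero element has order `p`
and generates, and the only periodic set is the whole group, so Theorem 29 with `Q = {0}` applies to
a translate of the larger of `A`, `B`, which has at least `4` elements.)  The tree's
`HamidouneRodseth.hamidouneRodseth_of_card_three` is the printed induction modulo the layer
`|A| = 3`; this corollary has no such proviso.
[cite: HamidouneRodseth2000, Theorem 3 (p. 252)] [cite: HamidouneSerraZemor2008, §8, Theorem 29] -/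
theorem hamidouneRodseth_inverse_theorem {p : ℕ} [Fact p.Prime] {A B : Finset (ZMod p)}
    (hA3 : 3 ≤ #A) (hB3 : 3 ≤ #B) (h7 : 7 ≤ #(A + B)) (hAB : #(A + B) = #A + #B)
    (hp4 : #(A + B) + 4 ≤ p) :
    ∃ e a b : ZMod p, e ≠ 0 ∧ A ⊆ apFinset a e (#A + 1) ∧ B ⊆ apFinset b e (#B + 1) := by
  classical
  have hp : p.Prime := Fact.out
  have hcard : Fintype.card (ZMod p) = p := ZMod.card p
  have hordp : ∀ x : ZMod p, x ≠ 0 → addOrderOf x = p := by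
    intro x hx
    have h1 : addOrderOf x ∣ p := by
      have := addOrderOf_dvd_card (x := x)
      rwa [hcard] at this
    rcases (Nat.dvd_prime hp).1 h1 with h | h
    · exact absurd (AddMonoid.addOrderOf_eq_one_iff.1 h) hx
    · exact h
  have hzm : ∀ x : ZMod p, x ≠ 0 → AddSubgroup.zmultiples x = ⊤ := by
    intro x hx
    apply AddSubgroup.eq_top_of_card_eq
    rw [Nat.card_zmultiples, hordp x hx, Nat.card_eq_fintype_card, hcard]
  have hcop : (Fintype.card (ZMod p)).Coprime 6 := by
    rw [hcard, Nat.Prime.coprime_iff_not_dvd hp]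
    intro h
    have := Nat.le_of_dvd (by norm_num) h
    omega
  -- the theorem for `|S₀| ≥ 4`, `|T| ≥ 3`
  have key : ∀ S₀ T : Finset (ZMod p), 4 ≤ #S₀ → 3 ≤ #T → #(S₀ + T) ≤ #S₀ + #T →
      #S₀ + #T + 4 ≤ p → ∃ e a b : ZMod p, e ≠ 0 ∧ S₀ ⊆ apFinset a e (#S₀ + 1) ∧
        T ⊆ apFinset b e (#T + 1) := by
    intro S₀ T hS4 hT3 hST hn
    obtain ⟨s0, hs0⟩ : S₀.Nonempty := card_pos.1 (by omega)
    set S := (-s0) +ᵥ S₀ with hSdef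
    have h0 : (0 : ZMod p) ∈ S :=
      mem_vadd_finset.2 ⟨s0, hs0, by rw [vadd_eq_add, neg_add_cancel]⟩
    have hScard : #S = #S₀ := card_vadd_finset _ _
    have hgen : AddSubgroup.closure (S : Set (ZMod p)) = ⊤ := by
      obtain ⟨x, hx, y, hy, hxy⟩ := one_lt_card.1 (show 1 < #S by omega)
      obtain ⟨z, hz, hz0⟩ : ∃ z ∈ S, z ≠ 0 := by
        by_cases hx0 : x = 0
        · exact ⟨y, hy, fun h => hxy (hx0.trans h.symm)⟩
        · exact ⟨x, hx, hx0⟩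
      rw [eq_top_iff, ← hzm z hz0]
      exact AddSubgroup.zmultiples_le_of_mem (AddSubgroup.subset_closure (mem_coe.2 hz))
    have hord : ∀ s ∈ S, s ≠ 0 → #S + 1 ≤ addOrderOf s := fun s _ hs0 => by
      rw [hordp s hs0]; omega
    have hQ : ∀ q : ZMod p, q ≠ 0 → ∀ P : Finset (ZMod p), S.erase 0 ⊆ P → q +ᵥ P = P →
        #S + 1 ≤ #P := by
      intro q hq0 P hSP hqP
      obtain ⟨x, hx⟩ : (S.erase 0).Nonempty := card_pos.1 (by rw [card_erase_of_mem h0]; omega)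
      rw [eq_univ_of_vadd_eq_of_zmultiples_eq_top (hzm q hq0) ⟨x, hSP hx⟩ hqP, card_univ, hcard]
      omega
    have hva : S + T = (-s0) +ᵥ (S₀ + T) := by
      rw [hSdef, ← singleton_add, ← singleton_add, add_assoc]
    have hST' : #(S + T) ≤ #S + #T := by rw [hva, card_vadd_finset, hScard]; exact hST
    obtain ⟨r, a, b, hr, hSsub, hTsub⟩ := exists_subset_apFinset_of_card_add_le_of_forall_vadd hcop
      h0 hgen (by omega) hord hQ hT3 hST' (by rw [hcard]; omega)
    have hr0 : r ≠ 0 := by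
      rintro rfl
      have h1 : (1 : ZMod p) ∈ AddSubgroup.zmultiples (0 : ZMod p) := by rw [hr]; trivial
      rw [AddSubgroup.zmultiples_zero_eq_bot, AddSubgroup.mem_bot] at h1
      exact one_ne_zero h1
    refine ⟨r, s0 + a, b, hr0, ?_, hTsub⟩
    have : S₀ = s0 +ᵥ S := by rw [hSdef, vadd_vadd, add_neg_cancel, zero_vadd]
    rw [this, ← vadd_apFinset_eq_apFinset_add, card_vadd_finset]
    exact vadd_finset_subset_vadd_finset hSsub
  rcases le_or_gt 4 #A with hA4 | hA4
  · exact key A B hA4 hB3 hAB.le (by omega)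
  · have hA : #A = 3 := by omega
    obtain ⟨e, b, a, he, hB, hA'⟩ := key B A (by omega) hA3
      (by rw [add_comm, hAB, Nat.add_comm]) (by omega)
    exact ⟨e, a, b, he, hA', hB⟩

/-! ### Finsets under the canonical projection `σ : G → G ⧸ Q`

Bookkeeping for the second item of [HamidouneSerraZemor2008, Theorem 29]: images `σ(X)`, the
traces ("decomposition modulo `Q`") `X ∩ σ⁻¹(c)`, `Q`-periodic sets, orders in `G ⧸ Q`. -/

section Projection

variable (Q : AddSubgroup G)

omit [Fintype G] [DecidableEq G] in
/-- The finset of a subgroup has `Nat.card Q` elements. [folklore] -/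
private theorem natCard_eq_card_of_mem_iff (Qf : Finset G) (hQf : ∀ g, g ∈ Qf ↔ g ∈ Q) :
    Nat.card Q = #Qf := by
  have hK : (Q : Set G) = Qf := by ext g; rw [SetLike.mem_coe, mem_coe, hQf]
  rw [← SetLike.coe_sort_coe, hK, Finset.coe_sort_coe, Nat.card_eq_fintype_card, Fintype.card_coe]

omit [Fintype G] in
/-- `σ(X + Y) = σ(X) + σ(Y)`. [folklore] -/
private theorem image_mk_add [DecidableEq (G ⧸ Q)] (X Y : Finset G) :
    (X + Y).image (fun x : G => (x : G ⧸ Q)) =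
      X.image (fun x : G => (x : G ⧸ Q)) + Y.image (fun x : G => (x : G ⧸ Q)) :=
  image_add (QuotientAddGroup.mk' Q)

omit [Fintype G] in
/-- `σ(c + X) = σ(c) + σ(X)`. [folklore] -/
private theorem image_mk_vadd [DecidableEq (G ⧸ Q)] (c : G) (X : Finset G) :
    (c +ᵥ X).image (fun x : G => (x : G ⧸ Q)) = (c : G ⧸ Q) +ᵥ X.image (fun x : G => (x : G ⧸ Q)) := by
  rw [← singleton_add, image_mk_add, image_singleton, singleton_add]

omit [Fintype G] in
/-- `x ∈ X + Q` iff `σ(x) ∈ σ(X)`. [folklore] -/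
private theorem mem_add_iff_mk_mem_image [DecidableEq (G ⧸ Q)] (Qf : Finset G) (hQf : ∀ g, g ∈ Qf ↔ g ∈ Q) {X : Finset G}
    {x : G} : x ∈ X + Qf ↔ (x : G ⧸ Q) ∈ X.image (fun x : G => (x : G ⧸ Q)) := by
  constructor
  · intro hx
    obtain ⟨y, hy, k, hk, rfl⟩ := mem_add.1 hx
    refine mem_image.2 ⟨y, hy, ?_⟩
    rw [QuotientAddGroup.mk_add, (QuotientAddGroup.eq_zero_iff k).2 ((hQf k).1 hk), add_zero]
  · intro hx
    obtain ⟨y, hy, hyx⟩ := mem_image.1 hx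
    refine mem_add.2 ⟨y, hy, -y + x, (hQf _).2 (QuotientAddGroup.eq.1 hyx), ?_⟩
    rw [add_neg_cancel_left]

omit [Fintype G] in
/-- `Q + Q = Q`. [folklore] -/
private theorem add_self_eq_of_mem_iff (Qf : Finset G) (hQf : ∀ g, g ∈ Qf ↔ g ∈ Q) : Qf + Qf = Qf := by
  refine Subset.antisymm ?_ (subset_add_left Qf ((hQf 0).2 Q.zero_mem))
  intro x hx
  obtain ⟨a, ha, b, hb, rfl⟩ := mem_add.1 hx
  exact (hQf _).2 (Q.add_mem ((hQf a).1 ha) ((hQf b).1 hb))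

omit [Fintype G] in
/-- `X + Q` is `Q`-periodic. [folklore] -/
private theorem add_add_eq_add_of_mem_iff (Qf : Finset G) (hQf : ∀ g, g ∈ Qf ↔ g ∈ Q) (X : Finset G) :
    X + Qf + Qf = X + Qf := by
  rw [add_assoc, add_self_eq_of_mem_iff Q Qf hQf]

omit [Fintype G] in
/-- A set closed under adding elements of `Q` is `Q`-periodic. [folklore] -/
private theorem add_eq_self_of_forall_add_mem (Qf : Finset G) (hQf : ∀ g, g ∈ Qf ↔ g ∈ Q) {X : Finset G}
    (h : ∀ x ∈ X, ∀ k ∈ Qf, x + k ∈ X) : X + Qf = X := by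
  refine Subset.antisymm ?_ (subset_add_left X ((hQf 0).2 Q.zero_mem))
  intro y hy
  obtain ⟨x, hx, k, hk, rfl⟩ := mem_add.1 hy
  exact h x hx k hk

omit [Fintype G] in
/-- A `Q`-periodic set has `|X| = |σ(X)| · |Q|`. [folklore] -/
private theorem card_eq_card_image_mul_of_add_eq [DecidableEq (G ⧸ Q)] (Qf : Finset G) (hQf : ∀ g, g ∈ Qf ↔ g ∈ Q)
    {X : Finset G} (hX : X + Qf = X) :
    #X = #(X.image fun x : G => (x : G ⧸ Q)) * #Qf := by
  have := card_add_eq_card_image_mul Q Qf hQf X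
  rwa [hX] at this

omit [Fintype G] in
/-- A trace `X ∩ σ⁻¹(c)` lies in the coset `s₀ + Q` (`σ(s₀) = c`). [folklore] -/
private theorem filter_mk_subset_vadd [DecidableEq (G ⧸ Q)] (Qf : Finset G) (hQf : ∀ g, g ∈ Qf ↔ g ∈ Q) (X : Finset G)
    {c : G ⧸ Q} {s₀ : G} (hs₀ : (s₀ : G ⧸ Q) = c) :
    X.filter (fun x : G => (x : G ⧸ Q) = c) ⊆ s₀ +ᵥ Qf := by
  intro x hx
  rw [mem_filter] at hx
  refine mem_vadd_finset.2 ⟨-s₀ + x, (hQf _).2 (QuotientAddGroup.eq.1 (hs₀.trans hx.2.symm)), ?_⟩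
  rw [vadd_eq_add, add_neg_cancel_left]

omit [Fintype G] in
/-- A trace has at most `|Q|` elements. [folklore] -/
private theorem card_filter_mk_le [DecidableEq (G ⧸ Q)] (Qf : Finset G) (hQf : ∀ g, g ∈ Qf ↔ g ∈ Q) (X : Finset G)
    (c : G ⧸ Q) : #(X.filter fun x : G => (x : G ⧸ Q) = c) ≤ #Qf := by
  obtain ⟨s₀, rfl⟩ := QuotientAddGroup.mk_surjective c
  have := card_le_card (filter_mk_subset_vadd Q Qf hQf X (rfl : (s₀ : G ⧸ Q) = s₀))
  rwa [card_vadd_finset] at this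

omit [Fintype G] in
/-- A full trace (`|Q|` elements) is the whole coset. [folklore] -/
private theorem filter_mk_eq_vadd_of_card_eq [DecidableEq (G ⧸ Q)] (Qf : Finset G) (hQf : ∀ g, g ∈ Qf ↔ g ∈ Q) (X : Finset G)
    {c : G ⧸ Q} {s₀ : G} (hs₀ : (s₀ : G ⧸ Q) = c)
    (hc : #(X.filter fun x : G => (x : G ⧸ Q) = c) = #Qf) :
    X.filter (fun x : G => (x : G ⧸ Q) = c) = s₀ +ᵥ Qf :=
  eq_of_subset_of_card_le (filter_mk_subset_vadd Q Qf hQf X hs₀) (by rw [card_vadd_finset, hc])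

omit [Fintype G] [DecidableEq G] in
/-- `|X| = Σ_c |X ∩ σ⁻¹(c)|` over `c ∈ σ(X)`. [folklore] -/
private theorem card_eq_sum_card_filter_mk [DecidableEq (G ⧸ Q)] (X : Finset G) :
    #X = ∑ c ∈ X.image (fun x : G => (x : G ⧸ Q)), #(X.filter fun x : G => (x : G ⧸ Q) = c) :=
  card_eq_sum_card_fiberwise fun _ hx => mem_coe.2 (mem_image_of_mem _ (mem_coe.1 hx))

omit [Fintype G] in
/-- `|X + Q| − |X| = Σ_c (|Q| − |X ∩ σ⁻¹(c)|)`: the total deficiency of the traces.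
[cite: HamidouneSerraZemor2008, §2 (decomposition of a subset modulo a subgroup)] -/
theorem card_add_sub_card_eq_sum [DecidableEq (G ⧸ Q)] (Qf : Finset G) (hQf : ∀ g, g ∈ Qf ↔ g ∈ Q) (X : Finset G) :
    #(X + Qf) - #X =
      ∑ c ∈ X.image (fun x : G => (x : G ⧸ Q)), (#Qf - #(X.filter fun x : G => (x : G ⧸ Q) = c)) := by
  rw [sum_tsub_distrib _ (fun c _ => card_filter_mk_le Q Qf hQf X c), ← card_eq_sum_card_filter_mk,
    sum_const, smul_eq_mul, card_add_eq_card_image_mul Q Qf hQf X]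

omit [Fintype G] in
/-- If `|X + Q| ≤ |X| + 1` every trace of `X` has at least `|Q| − 1` elements.
[cite: HamidouneSerraZemor2008, §8 (proof of Theorem 29: "`|S'| ≥ |Q| − 1`")] -/
theorem card_le_card_filter_mk_succ [DecidableEq (G ⧸ Q)] (Qf : Finset G) (hQf : ∀ g, g ∈ Qf ↔ g ∈ Q) {X : Finset G}
    (hX : #(X + Qf) ≤ #X + 1) {c : G ⧸ Q} (hc : c ∈ X.image (fun x : G => (x : G ⧸ Q))) :
    #Qf ≤ #(X.filter fun x : G => (x : G ⧸ Q) = c) + 1 := by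
  have h1 := card_add_sub_card_eq_sum Q Qf hQf X
  have h2 := single_le_sum (f := fun c => #Qf - #(X.filter fun x : G => (x : G ⧸ Q) = c))
    (fun _ _ => Nat.zero_le _) hc
  rw [← h1] at h2
  have := card_filter_mk_le Q Qf hQf X c
  omega

omit [Fintype G] in
/-- If `|X + Q| ≤ |X| + 1` and one trace of `X` is not a full coset, every other trace is.
[cite: HamidouneSerraZemor2008, §8 (proof of Theorem 29: "the unique subset of `S` of size
`|Q| − 1` in the decomposition of `S` modulo `Q`")] -/
theorem card_filter_mk_eq_of_lt [DecidableEq (G ⧸ Q)] (Qf : Finset G) (hQf : ∀ g, g ∈ Qf ↔ g ∈ Q) {X : Finset G}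
    (hX : #(X + Qf) ≤ #X + 1) {c₀ : G ⧸ Q} (hc₀ : c₀ ∈ X.image (fun x : G => (x : G ⧸ Q)))
    (hlt : #(X.filter fun x : G => (x : G ⧸ Q) = c₀) < #Qf)
    {c : G ⧸ Q} (hc : c ∈ X.image (fun x : G => (x : G ⧸ Q))) (hcc : c ≠ c₀) :
    #(X.filter fun x : G => (x : G ⧸ Q) = c) = #Qf := by
  have h1 := card_add_sub_card_eq_sum Q Qf hQf X
  set f : G ⧸ Q → ℕ := fun c => #Qf - #(X.filter fun x : G => (x : G ⧸ Q) = c) with hf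
  have hsub : ({c₀, c} : Finset (G ⧸ Q)) ⊆ X.image (fun x : G => (x : G ⧸ Q)) := by
    intro y hy
    rw [mem_insert, mem_singleton] at hy
    rcases hy with rfl | rfl
    · exact hc₀
    · exact hc
  have h2 := sum_le_sum_of_subset_of_nonneg hsub (f := f) (fun _ _ _ => Nat.zero_le _)
  rw [sum_pair hcc.symm, ← h1] at h2
  have := card_filter_mk_le Q Qf hQf X c
  simp only [hf] at h2
  omega

omit [Fintype G] in
/-- **Pigeonhole in a coset:** if `F ⊆ a + Q`, `T' ⊆ b + Q` and `|F| + |T'| > |Q|`, then `F + T'`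
is the whole coset `a + b + Q`. [cite: HamidouneSerraZemor2008, §8 (proof of Theorem 29:
"since `|S'| + |B'| > |Q|`, we have `S' + B' = Q`")] -/
theorem vadd_subset_add_of_card_lt (Qf : Finset G) (hQf : ∀ g, g ∈ Qf ↔ g ∈ Q) {F T' : Finset G}
    {a b : G} (hF : F ⊆ a +ᵥ Qf) (hT' : T' ⊆ b +ᵥ Qf) (hcard : #Qf < #F + #T') :
    (a + b) +ᵥ Qf ⊆ F + T' := by
  intro y hy
  obtain ⟨k, hk, rfl⟩ := mem_vadd_finset.1 hy
  -- `y - T'` and `F` both lie in `a + Q`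
  have hsub : T'.image (fun t => (a + b + k) - t) ⊆ a +ᵥ Qf := by
    intro z hz
    obtain ⟨t, ht, rfl⟩ := mem_image.1 hz
    obtain ⟨k', hk', rfl⟩ := mem_vadd_finset.1 (hT' ht)
    refine mem_vadd_finset.2 ⟨k - k', (hQf _).2 (Q.sub_mem ((hQf k).1 hk) ((hQf k').1 hk')), ?_⟩
    simp only [vadd_eq_add]; abel
  have hnd : ¬ Disjoint F (T'.image fun t => (a + b + k) - t) := by
    intro hd
    have h1 := card_le_card (union_subset hF hsub)
    rw [card_union_of_disjoint hd, card_vadd_finset,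
      card_image_of_injective _ sub_right_injective] at h1
    omega
  obtain ⟨f, hfF, hfz⟩ := not_disjoint_iff.1 hnd
  obtain ⟨t, ht, hft⟩ := mem_image.1 hfz
  rw [vadd_eq_add]
  exact mem_add.2 ⟨f, hfF, t, ht, by rw [← hft, sub_add_cancel]⟩

omit [DecidableEq G] in
/-- **Orders in the quotient:** `o(s) ≤ o(σ(s)) · |Q|`. [cite: HamidouneSerraZemor2008, §8 (proof of
Theorem 29: "each element in `σ(S)*` has order at least `(|S| + 1)/q`")] -/
theorem addOrderOf_le_addOrderOf_mk_mul (Qf : Finset G) (hQf : ∀ g, g ∈ Qf ↔ g ∈ Q) (s : G) :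
    addOrderOf s ≤ addOrderOf (s : G ⧸ Q) * #Qf := by
  classical
  have h1 : (addOrderOf (s : G ⧸ Q)) • s ∈ Q := by
    rw [← QuotientAddGroup.eq_zero_iff, QuotientAddGroup.mk_nsmul, addOrderOf_nsmul_eq_zero]
  have h2 : #Qf • ((addOrderOf (s : G ⧸ Q)) • s) = 0 := by
    rw [← addOrderOf_dvd_iff_nsmul_eq_zero, ← natCard_eq_card_of_mem_iff Q Qf hQf]
    exact AddSubgroup.addOrderOf_dvd_natCard Q h1
  have h3 : (addOrderOf (s : G ⧸ Q) * #Qf) • s = 0 := by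
    rw [mul_comm, mul_nsmul', h2]
  have h0 : 0 < #Qf := card_pos.2 ⟨0, (hQf 0).2 Q.zero_mem⟩
  exact Nat.le_of_dvd (Nat.mul_pos (addOrderOf_pos _) h0) (addOrderOf_dvd_iff_nsmul_eq_zero.2 h3)

omit [Fintype G] [DecidableEq G] in
/-- The image of a generating set generates `G ⧸ Q`. [folklore] -/
private theorem closure_image_mk_eq_top [DecidableEq (G ⧸ Q)] {S : Finset G} (hgen : AddSubgroup.closure (S : Set G) = ⊤) :
    AddSubgroup.closure ((S.image fun x : G => (x : G ⧸ Q)) : Set (G ⧸ Q)) = ⊤ := by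
  rw [coe_image]
  change AddSubgroup.closure ((QuotientAddGroup.mk' Q) '' (S : Set G)) = ⊤
  rw [← AddMonoidHom.map_closure, hgen, ← AddMonoidHom.range_eq_map, QuotientAddGroup.range_mk']

end Projection

/-! ### Tools for the second item of Theorem 29 (`Q ≠ {0}`) -/

section TheoremTwentyNine

variable (Q : AddSubgroup G)

omit [DecidableEq G] in
/-- A non-zero subgroup of a group of order prime to `6` has at least `5` elements.
[cite: HamidouneSerraZemor2008, §8 (proof of Theorem 29, Claim 3: "`|Q| − 2 ≥ 5 − 2`")] -/
theorem five_le_card_of_coprime_six (Qf : Finset G) (hQf : ∀ g, g ∈ Qf ↔ g ∈ Q)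
    (hcop : (Fintype.card G).Coprime 6) (hQb : Q ≠ ⊥) : 5 ≤ #Qf := by
  have h1 : 1 < #Qf := by
    rw [← natCard_eq_card_of_mem_iff Q Qf hQf]; exact (AddSubgroup.one_lt_card_iff_ne_bot Q).2 hQb
  have hdvd : #Qf ∣ Fintype.card G := by
    rw [← natCard_eq_card_of_mem_iff Q Qf hQf, ← Nat.card_eq_fintype_card]
    exact AddSubgroup.card_addSubgroup_dvd_card Q
  have hq : (#Qf).Coprime 6 := Nat.Coprime.coprime_dvd_left hdvd hcop
  have h2 : ¬ 2 ∣ #Qf := fun h => by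
    have := Nat.dvd_gcd h (show 2 ∣ 6 by norm_num); rw [hq] at this; omega
  have h3 : ¬ 3 ∣ #Qf := fun h => by
    have := Nat.dvd_gcd h (show 3 ∣ 6 by norm_num); rw [hq] at this; omega
  omega

/-- **`S ∩ Q = {0}`:** "Since `|S| ≥ q = |Q|` and each element in `S` has order at least `|S| + 1`,
we have `S ∩ Q = {0}`" (here `|S* + Q| ≤ |S|` supplies `q ≤ |S|`).
[cite: HamidouneSerraZemor2008, §8 (proof of Theorem 29, Case 2)] -/
theorem eq_zero_of_mem_addSubgroup (Qf : Finset G) (hQf : ∀ g, g ∈ Qf ↔ g ∈ Q) {S : Finset G}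
    (hQ1 : #(S.erase 0 + Qf) ≤ #S) (hord : ∀ s ∈ S, s ≠ 0 → #S + 1 ≤ addOrderOf s) {s : G}
    (hs : s ∈ S) (hsQ : s ∈ Q) : s = 0 := by
  by_contra hs0
  have hs' : s ∈ S.erase 0 := mem_erase.2 ⟨hs0, hs⟩
  have h1 : #Qf ≤ #(S.erase 0 + Qf) := by
    have hsub : s +ᵥ Qf ⊆ S.erase 0 + Qf := by
      rw [← singleton_add]; exact add_subset_add_right (singleton_subset_iff.2 hs')
    have := card_le_card hsub
    rwa [card_vadd_finset] at this
  have h2 : addOrderOf s ≤ #Qf := by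
    rw [← natCard_eq_card_of_mem_iff Q Qf hQf]
    exact Nat.le_of_dvd Nat.card_pos (AddSubgroup.addOrderOf_dvd_natCard Q hsQ)
  have := hord s hs hs0
  omega

omit [Fintype G] in
/-- `σ(S*) = σ(S)*` when `S ∩ Q = {0}`. [cite: HamidouneSerraZemor2008, §8 (proof of Theorem 29,
Case 2: "In particular, `σ(S)* = σ(S*)`")] -/
theorem image_erase_eq_erase_image [DecidableEq (G ⧸ Q)] {S : Finset G}
    (hSQ : ∀ s ∈ S, s ∈ Q → s = 0) :
    (S.erase 0).image (fun x : G => (x : G ⧸ Q)) = (S.image fun x : G => (x : G ⧸ Q)).erase 0 := by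
  ext c
  simp only [mem_image, mem_erase]
  constructor
  · rintro ⟨s, ⟨hs0, hs⟩, rfl⟩
    exact ⟨fun h => hs0 (hSQ s hs ((QuotientAddGroup.eq_zero_iff s).1 h)), s, hs, rfl⟩
  · rintro ⟨hc0, s, hs, rfl⟩
    exact ⟨s, ⟨fun h => hc0 (by rw [h, QuotientAddGroup.mk_zero]), hs⟩, rfl⟩

/-- `|σ(S*)| + 1 = |σ(S)|` when `S ∩ Q = {0}` and `0 ∈ S`. [cite: HamidouneSerraZemor2008, §8 (proof
of Theorem 29, Case 2)] -/
theorem card_image_erase_succ [DecidableEq (G ⧸ Q)] (Qf : Finset G) (hQf : ∀ g, g ∈ Qf ↔ g ∈ Q)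
    {S : Finset G} (h0 : (0 : G) ∈ S) (hQ1 : #(S.erase 0 + Qf) ≤ #S)
    (hord : ∀ s ∈ S, s ≠ 0 → #S + 1 ≤ addOrderOf s) :
    #((S.erase 0).image fun x : G => (x : G ⧸ Q)) + 1 = #(S.image fun x : G => (x : G ⧸ Q)) := by
  rw [image_erase_eq_erase_image Q (fun s hs hsQ => eq_zero_of_mem_addSubgroup Q Qf hQf hQ1 hord hs hsQ),
    card_erase_add_one (mem_image.2 ⟨0, h0, QuotientAddGroup.mk_zero Q⟩)]

/-- **Orders in `σ(S)`:** "each element in `σ(S)*` has order at least `(|S| + 1)/q ≥ |σ(S)| − 1 + 1/q`",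
so at least `|σ(S)|`. [cite: HamidouneSerraZemor2008, §8 (proof of Theorem 29, Case 2)] -/
theorem card_image_le_addOrderOf [DecidableEq (G ⧸ Q)] (Qf : Finset G) (hQf : ∀ g, g ∈ Qf ↔ g ∈ Q)
    {S : Finset G} (h0 : (0 : G) ∈ S) (hQ1 : #(S.erase 0 + Qf) ≤ #S)
    (hord : ∀ s ∈ S, s ≠ 0 → #S + 1 ≤ addOrderOf s) :
    ∀ x ∈ S.image (fun x : G => (x : G ⧸ Q)), x ≠ 0 →
      #(S.image fun x : G => (x : G ⧸ Q)) ≤ addOrderOf x := by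
  intro x hx hx0
  obtain ⟨s, hs, rfl⟩ := mem_image.1 hx
  have hs0 : s ≠ 0 := fun h => hx0 (by rw [h, QuotientAddGroup.mk_zero])
  have h1 : #((S.erase 0).image fun x : G => (x : G ⧸ Q)) * #Qf ≤ #S := by
    rw [← card_add_eq_card_image_mul Q Qf hQf]; exact hQ1
  have h2 := card_image_erase_succ Q Qf hQf h0 hQ1 hord
  have h3 := hord s hs hs0
  have h4 := addOrderOf_le_addOrderOf_mk_mul Q Qf hQf s
  have h5 : (#(S.image fun x : G => (x : G ⧸ Q)) - 1) * #Qf < addOrderOf (s : G ⧸ Q) * #Qf := by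
    rw [← h2, Nat.add_sub_cancel]; omega
  have := Nat.lt_of_mul_lt_mul_right h5
  omega

/-- **"`Q` maximal ⇒ `σ(S*)` is not periodic":** "By our assumptions, `Q` is a maximal subgroup such
that `|S* + Q| − |S*| ≤ 1`. This is easily seen to imply that `σ(S*)` is not periodic" (a period
`σ(g)` of `σ(S*)` gives the larger subgroup `σ⁻¹⟨σ(g)⟩` with the same property).
[cite: HamidouneSerraZemor2008, §8 (proof of Theorem 29, Case 2)] -/
theorem vadd_image_erase_ne [DecidableEq (G ⧸ Q)] (Qf : Finset G) (hQf : ∀ g, g ∈ Qf ↔ g ∈ Q)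
    {S : Finset G} (hQ1 : #(S.erase 0 + Qf) ≤ #S)
    (hQmax : ∀ H : AddSubgroup G, Q ≤ H → ∀ Hf : Finset G, (∀ g, g ∈ Hf ↔ g ∈ H) →
      #(S.erase 0 + Hf) ≤ #S → H = Q)
    {d : G ⧸ Q} (hd : d ≠ 0) :
    d +ᵥ (S.erase 0).image (fun x : G => (x : G ⧸ Q)) ≠ (S.erase 0).image (fun x : G => (x : G ⧸ Q)) := by
  classical
  intro hper
  obtain ⟨g, rfl⟩ := QuotientAddGroup.mk_surjective d
  have hgQ : g ∉ Q := fun h => hd ((QuotientAddGroup.eq_zero_iff g).2 h)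
  set H : AddSubgroup G := (AddSubgroup.zmultiples (g : G ⧸ Q)).comap (QuotientAddGroup.mk' Q)
    with hH
  have hQH : Q ≤ H := by
    intro k hk
    rw [hH, AddSubgroup.mem_comap, QuotientAddGroup.mk'_apply, (QuotientAddGroup.eq_zero_iff k).2 hk]
    exact AddSubgroup.zero_mem _
  have hgH : g ∈ H := by
    rw [hH, AddSubgroup.mem_comap, QuotientAddGroup.mk'_apply]; exact AddSubgroup.mem_zmultiples _
  set Hf : Finset G := univ.filter (· ∈ H) with hHf
  have hHf' : ∀ x, x ∈ Hf ↔ x ∈ H := fun x => by simp [hHf]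
  have hsub : S.erase 0 + Hf ⊆ S.erase 0 + Qf := by
    intro x hx
    obtain ⟨s, hs, h, hh, rfl⟩ := mem_add.1 hx
    rw [mem_add_iff_mk_mem_image Q Qf hQf]
    have hh' : ((h : G) : G ⧸ Q) ∈ AddSubgroup.zmultiples (g : G ⧸ Q) := by
      have := (hHf' h).1 hh
      rw [hH, AddSubgroup.mem_comap, QuotientAddGroup.mk'_apply] at this
      exact this
    rw [(isOfFinAddOrder_of_finite _).mem_zmultiples_iff_mem_range_addOrderOf, mem_image] at hh'
    obtain ⟨n, -, hn⟩ := hh'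
    rw [QuotientAddGroup.mk_add, ← hn]
    exact (mem_iff_add_nsmul_mem_of_vadd_eq hper _ n).1 (mem_image_of_mem _ hs)
  have hHQ : H = Q := hQmax H hQH Hf hHf' ((card_le_card hsub).trans hQ1)
  exact hgQ (hHQ ▸ hgH)

/-- **`Σ = (S* + T) ∖ (T + Q)` is `Q`-periodic** (display (eq:Qperiodic)): "This holds clearly if `S*`
is `Q`-periodic. So we may assume `|S* + Q| − |S*| = 1`. … If `Σ` is not `Q`-periodic then some
`Q`-coset must have a trace `U` of size `|Q| − 1` on the set `Σ`, and we have `U = S₁ + T'` where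
`T' = (a + Q) ∩ T` … we must have `|T'| = 1`.  Note also that `σ(S₁) + σ(T')` cannot be obtained in
any other way as a sum of an element of `σ(S)` and of an element of `σ(T)`, therefore
`(S₁ + T') ∩ (S + (T ∖ T')) = ∅`, hence `|S + (T ∖ T')| < |S| + |T ∖ T'| − 1`, but this contradicts
`κ₁(S) = |S| − 1` (Corollary 8)."  We run the argument on the trace of `S*` through the summand `s`
of a point `s + t ∈ Σ` whose `Q`-translate leaves `S* + T` (pigeonhole in the coset makes this trace
the short one and `T'` a singleton; every other trace of `S*` is a full coset); `|Q| ≥ 4`,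
`|T| ≥ 3`, `|S + T| ≤ |S| + |T| ≤ |G|` and the order hypothesis of Corollary 8 are what is used.
[cite: HamidouneSerraZemor2008, §8 (proof of Theorem 29, Case 2, (eq:Qperiodic))] -/
theorem sdiff_add_eq_sdiff [DecidableEq (G ⧸ Q)] (Qf : Finset G) (hQf : ∀ g, g ∈ Qf ↔ g ∈ Q)
    {S T : Finset G} (h0 : (0 : G) ∈ S) (hgen : AddSubgroup.closure (S : Set G) = ⊤)
    (hord' : ∀ s ∈ S, s ≠ 0 → #S - 1 ≤ addOrderOf s)
    (hQ1 : #(S.erase 0 + Qf) ≤ #S) (hq : 4 ≤ #Qf) (hT3 : 3 ≤ #T)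
    (hST : #(S + T) ≤ #S + #T) (hSTn : #S + #T ≤ Fintype.card G) :
    (S.erase 0 + T) \ (T + Qf) + Qf = (S.erase 0 + T) \ (T + Qf) := by
  classical
  apply add_eq_self_of_forall_add_mem Q Qf hQf
  intro x hx k hk
  rw [mem_sdiff] at hx ⊢
  obtain ⟨hx1, hx2⟩ := hx
  refine ⟨?_, fun h => hx2 ?_⟩
  swap
  · have : x + k + -k ∈ T + Qf + Qf := add_mem_add h ((hQf _).2 (Q.neg_mem ((hQf k).1 hk)))
    rwa [add_neg_cancel_right, add_add_eq_add_of_mem_iff Q Qf hQf] at this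
  by_contra hxk
  obtain ⟨s, hs, t, ht, rfl⟩ := mem_add.1 hx1
  have hs0 : s ≠ 0 := (mem_erase.1 hs).1
  have hsS : s ∈ S := (mem_erase.1 hs).2
  set F := (S.erase 0).filter (fun y : G => (y : G ⧸ Q) = (s : G ⧸ Q)) with hF
  set T' := T.filter (fun y : G => (y : G ⧸ Q) = (t : G ⧸ Q)) with hT'
  have hFsub : F ⊆ s +ᵥ Qf := filter_mk_subset_vadd Q Qf hQf _ rfl
  have hT'sub : T' ⊆ t +ᵥ Qf := filter_mk_subset_vadd Q Qf hQf _ rfl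
  have hFS : F ⊆ S.erase 0 := filter_subset _ _
  have hT'T : T' ⊆ T := filter_subset _ _
  have htT' : t ∈ T' := mem_filter.2 ⟨ht, rfl⟩
  -- (a) `|F| + |T'| ≤ q`, by pigeonhole in the coset of `s + t`
  have ha : #F + #T' ≤ #Qf := by
    by_contra hlt
    have h1 := vadd_subset_add_of_card_lt Q Qf hQf hFsub hT'sub (by omega)
    have h2 : s + t + k ∈ F + T' := h1 (mem_vadd_finset.2 ⟨k, hk, rfl⟩)
    exact hxk (add_subset_add hFS hT'T h2)
  -- (b) `|F| ≥ q − 1`, so `T' = {t}`, `|F| = q − 1` and every other trace of `S*` is full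
  have hsimg : (s : G ⧸ Q) ∈ (S.erase 0).image (fun y : G => (y : G ⧸ Q)) := mem_image_of_mem _ hs
  have hQ1' : #(S.erase 0 + Qf) ≤ #(S.erase 0) + 1 := by rw [card_erase_add_one h0]; exact hQ1
  have hb : #Qf ≤ #F + 1 := card_le_card_filter_mk_succ Q Qf hQf hQ1' hsimg
  have hT'pos : 0 < #T' := card_pos.2 ⟨t, htT'⟩
  have hT'1 : #T' = 1 := by omega
  have hFlt : #F < #Qf := by omega
  have hT'eq : T' = {t} := by
    obtain ⟨y, hy⟩ := card_eq_one.1 hT'1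
    rw [hy] at htT'
    rw [hy, mem_singleton.1 htT']
  -- (c) `S + (T ∖ {t})` misses the `q − 1` points `t + F ⊆ S + T`
  set X := T.erase t with hX
  have hXne : X.Nonempty := by rw [← card_pos, hX, card_erase_of_mem ht]; omega
  have hdisj : Disjoint (t +ᵥ F) (S + X) := by
    rw [disjoint_left]
    rintro y hy hy'
    obtain ⟨f, hf, rfl⟩ := mem_vadd_finset.1 hy
    obtain ⟨s'', hs'', t'', ht'', he⟩ := mem_add.1 hy'
    have hf' := (mem_filter.1 hf).2
    have ht''T : t'' ∈ T := (mem_erase.1 ht'').2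
    have ht''t : t'' ≠ t := (mem_erase.1 ht'').1
    have hmk : ((s'' : G) : G ⧸ Q) + (t'' : G ⧸ Q) = (s : G ⧸ Q) + (t : G ⧸ Q) := by
      rw [← QuotientAddGroup.mk_add, he, vadd_eq_add, QuotientAddGroup.mk_add, hf', add_comm]
    by_cases hs''0 : s'' = 0
    · -- then `y = t'' ∈ T` and `x ∈ T + Q`
      apply hx2
      rw [mem_add_iff_mk_mem_image Q Qf hQf, QuotientAddGroup.mk_add, ← hmk, hs''0,
        QuotientAddGroup.mk_zero, zero_add]
      exact mem_image_of_mem _ ht''T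
    by_cases hcs : ((s'' : G) : G ⧸ Q) = (s : G ⧸ Q)
    · -- then `σ(t'') = σ(t)`, so `t'' ∈ T' = {t}`
      rw [hcs] at hmk
      have : t'' ∈ T' := mem_filter.2 ⟨ht''T, add_left_cancel hmk⟩
      rw [hT'eq, mem_singleton] at this
      exact ht''t this
    · -- the trace of `S*` over `σ(s'')` is a full coset and contains `x + k − t''`
      have hs''img : ((s'' : G) : G ⧸ Q) ∈ (S.erase 0).image (fun y : G => (y : G ⧸ Q)) :=
        mem_image_of_mem _ (mem_erase.2 ⟨hs''0, hs''⟩)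
      have hfull := card_filter_mk_eq_of_lt Q Qf hQf hQ1' hsimg hFlt hs''img hcs
      have hcoset := filter_mk_eq_vadd_of_card_eq Q Qf hQf (S.erase 0) rfl hfull
      have hmem : s + t + k - t'' ∈
          (S.erase 0).filter (fun y : G => (y : G ⧸ Q) = (s'' : G ⧸ Q)) := by
        rw [hcoset]
        refine mem_vadd_finset.2 ⟨-s'' + (s + t + k - t''), (hQf _).2 ?_, by
          rw [vadd_eq_add, add_neg_cancel_left]⟩
        rw [← QuotientAddGroup.eq, QuotientAddGroup.mk_sub, QuotientAddGroup.mk_add,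
          QuotientAddGroup.mk_add, (QuotientAddGroup.eq_zero_iff k).2 ((hQf k).1 hk), add_zero,
          ← hmk, add_sub_cancel_right]
      apply hxk
      have ee : s + t + k = (s + t + k - t'') + t'' := by rw [sub_add_cancel]
      rw [ee]
      exact add_mem_add ((mem_filter.1 hmem).1) ht''T
  have hsub2 : (t +ᵥ F) ∪ (S + X) ⊆ S + T := by
    apply union_subset
    · intro y hy
      obtain ⟨f, hf, rfl⟩ := mem_vadd_finset.1 hy
      rw [vadd_eq_add, add_comm t f]
      exact add_mem_add (mem_of_mem_erase ((mem_filter.1 hf).1)) ht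
    · exact add_subset_add_left (erase_subset _ _)
  have hcount := card_le_card hsub2
  rw [card_union_of_disjoint hdisj, card_vadd_finset] at hcount
  -- (d) Corollary 8: `|X + S| ≥ |X| + |S| − 1`
  have hκ := min_le_card_add_of_forall_le_addOrderOf h0 hgen hord' hXne
  have hXc : #X + 1 = #T := by rw [hX, card_erase_add_one ht]
  have hXS : #(S + X) = #(X + S) := by rw [add_comm]
  rw [hXS] at hcount
  rcases min_le_iff.1 hκ with h | h <;> omega

/-- **Display (eq:noname): `|σ(S) + σ(T)| = |σ(S)| + |σ(T)| − 1`.**  "`≥`" is Corollary 8 in `G ⧸ Q`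
(display (eq:withcor8)); "`≤`": "otherwise (eq:withcor8) implies `|S + T| ≥ |T| + |σ(S)||Q| >
|T| + |S|`, a contradiction" — the cosets of `σ(S + T)` outside `σ(T)` lie in the `Q`-periodic set
`Σ` and are therefore full. [cite: HamidouneSerraZemor2008, §8 (proof of Theorem 29, Case 2,
(eq:withcor8)–(eq:noname))] -/
theorem card_image_add_succ_eq [DecidableEq (G ⧸ Q)] (Qf : Finset G) (hQf : ∀ g, g ∈ Qf ↔ g ∈ Q)
    {S T : Finset G} (h0 : (0 : G) ∈ S) (hgen : AddSubgroup.closure (S : Set G) = ⊤)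
    (hord : ∀ s ∈ S, s ≠ 0 → #S + 1 ≤ addOrderOf s)
    (hQ1 : #(S.erase 0 + Qf) ≤ #S) (hq : 4 ≤ #Qf) (hT3 : 3 ≤ #T)
    (hST : #(S + T) ≤ #S + #T) (hSTn : #S + #T ≤ Fintype.card G)
    (hσn : #((S + T).image fun x : G => (x : G ⧸ Q)) + 2 ≤ Nat.card (G ⧸ Q)) :
    #((S + T).image fun x : G => (x : G ⧸ Q)) + 1 =
      #(S.image fun x : G => (x : G ⧸ Q)) + #(T.image fun x : G => (x : G ⧸ Q)) := by
  classical
  have hord' : ∀ s ∈ S, s ≠ 0 → #S - 1 ≤ addOrderOf s := fun s hs hs0 => by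
    have := hord s hs hs0; omega
  have himg := image_mk_add Q S T
  apply le_antisymm
  · -- `≤`: otherwise too many full cosets in `S + T`
    by_contra hlt
    push Not at hlt
    have hSig := sdiff_add_eq_sdiff Q Qf hQf h0 hgen hord' hQ1 hq hT3 hST hSTn
    have hSigCard := card_eq_card_image_mul_of_add_eq Q Qf hQf hSig
    have hSigImg : (S.image (fun x : G => (x : G ⧸ Q)) + T.image (fun x : G => (x : G ⧸ Q))) \
        T.image (fun x : G => (x : G ⧸ Q)) ⊆
        ((S.erase 0 + T) \ (T + Qf)).image (fun x : G => (x : G ⧸ Q)) := by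
      intro c hc
      rw [mem_sdiff, ← himg] at hc
      obtain ⟨hc1, hc2⟩ := hc
      obtain ⟨y, hy, rfl⟩ := mem_image.1 hc1
      obtain ⟨s, hs, t, ht, rfl⟩ := mem_add.1 hy
      have hs0 : s ≠ 0 := by
        rintro rfl
        rw [zero_add] at hc2
        exact hc2 (mem_image_of_mem _ ht)
      refine mem_image.2 ⟨s + t, mem_sdiff.2 ⟨add_mem_add (mem_erase.2 ⟨hs0, hs⟩) ht,
        fun h => hc2 ?_⟩, rfl⟩
      exact (mem_add_iff_mk_mem_image Q Qf hQf).1 h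
    have hdisj : Disjoint T ((S.erase 0 + T) \ (T + Qf)) := disjoint_left.2 fun y hy hyS =>
      (mem_sdiff.1 hyS).2 (subset_add_left T ((hQf 0).2 Q.zero_mem) hy)
    have hsub : T ∪ (S.erase 0 + T) \ (T + Qf) ⊆ S + T :=
      union_subset (subset_add_right T h0)
        (sdiff_subset.trans (add_subset_add_right (erase_subset _ _)))
    have hc := card_le_card hsub
    rw [card_union_of_disjoint hdisj] at hc
    have hTsub : T.image (fun x : G => (x : G ⧸ Q)) ⊆
        S.image (fun x : G => (x : G ⧸ Q)) + T.image (fun x : G => (x : G ⧸ Q)) :=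
      subset_add_right _ (mem_image.2 ⟨0, h0, QuotientAddGroup.mk_zero Q⟩)
    have h1 : #(S.image fun x : G => (x : G ⧸ Q)) ≤
        #(((S.erase 0 + T) \ (T + Qf)).image fun x : G => (x : G ⧸ Q)) := by
      have h2 := card_le_card hSigImg
      rw [card_sdiff_of_subset hTsub, ← himg] at h2
      omega
    have h3 := card_image_erase_succ Q Qf hQf h0 hQ1 hord
    have h4 : #(S.erase 0 + Qf) = #((S.erase 0).image fun x : G => (x : G ⧸ Q)) * #Qf :=
      card_add_eq_card_image_mul Q Qf hQf _
    have h5 : #(S.erase 0) ≤ #(S.erase 0 + Qf) :=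
      card_le_card (subset_add_left _ ((hQf 0).2 Q.zero_mem))
    have h6 : #(S.erase 0) + 1 = #S := card_erase_add_one h0
    have h7 : #(S.image fun x : G => (x : G ⧸ Q)) * #Qf ≤ #((S.erase 0 + T) \ (T + Qf)) := by
      rw [hSigCard]; exact Nat.mul_le_mul_right _ h1
    have h8 : #(S.erase 0 + Qf) + #Qf ≤ #((S.erase 0 + T) \ (T + Qf)) := by
      rw [h4]
      have := h7
      rw [← h3, add_mul, one_mul] at this
      exact this
    omega
  · -- `≥`: Corollary 8 in `G ⧸ Q`
    have hTne : (T.image fun x : G => (x : G ⧸ Q)).Nonempty :=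
      (card_pos.1 (by omega : 0 < #T)).image _
    have h0S : (0 : G ⧸ Q) ∈ S.image (fun x : G => (x : G ⧸ Q)) :=
      mem_image.2 ⟨0, h0, QuotientAddGroup.mk_zero Q⟩
    have hordσ := card_image_le_addOrderOf Q Qf hQf h0 hQ1 hord
    have hκ := min_le_card_add_of_forall_le_addOrderOf (G := G ⧸ Q) h0S
      (closure_image_mk_eq_top Q hgen) (fun x hx hx0 => by have := hordσ x hx hx0; omega) hTne
    have hn : Fintype.card (G ⧸ Q) = Nat.card (G ⧸ Q) := Nat.card_eq_fintype_card.symm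
    rw [add_comm (T.image fun x : G => (x : G ⧸ Q)), ← himg, hn] at hκ
    rcases le_total (Nat.card (G ⧸ Q)) (#(T.image fun x : G => (x : G ⧸ Q)) +
        #(S.image fun x : G => (x : G ⧸ Q)) - 1) with h | h
    · rw [min_eq_left h] at hκ; omega
    · rw [min_eq_right h] at hκ; omega

/-- **[HamidouneSerraZemor2008, §8, Theorem 29, second item (`Q ≠ {0}`), the progressions].**
"Let `G` be a finite abelian group with `gcd(|G|, 6) = 1`.  Let `0 ∈ S` be a generating subset of
`G` such that `|S| ≥ 4` and every element in `S*` has order at least `|S| + 1`.  Let `Q` be a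
maximal subgroup such that `|S* + Q| − |S*| ≤ 1` and let `σ : G → G/Q` denotes the canonical
projection.  Let `T` be a subset of `G` such that `|T| ≥ 3` and suppose that `|S + T| = |S| + |T| ≤
|G| − 4`.  Then … • If `Q ≠ {0}`, `|σ(T)| ≥ 2`, and `|σ(S + T)| < |G|/|Q| − 1` then `σ(S)` and `σ(T)`
are arithmetic progressions with the same difference."  Maximality of `Q` is maximality under
inclusion among the subgroups `H` with `|S* + H| ≤ |S*| + 1`.  Proof as printed (Case 2):
`S ∩ Q = {0}`; the orders in `σ(S)*` are `≥ |σ(S)|`; (eq:Qperiodic) and (eq:noname)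
(`sdiff_add_eq_sdiff`, `card_image_add_succ_eq`); `σ(S*)` is not periodic by maximality
(`vadd_image_erase_ne`); then Proposition 15 in `G ⧸ Q` — its aperiodic case
`eq_singleton_or_isAP_of_card_add_le_of_forall_card_le_addOrderOf`, applied to `σ(S)` and a
translate of `σ(T)` through `0`. [cite: HamidouneSerraZemor2008, §8, Theorem 29 (second item)] -/
theorem exists_isAP_image_of_card_add_eq [DecidableEq (G ⧸ Q)] (Qf : Finset G)
    (hQf : ∀ g, g ∈ Qf ↔ g ∈ Q) {S T : Finset G}
    (hcop : (Fintype.card G).Coprime 6) (h0 : (0 : G) ∈ S)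
    (hgen : AddSubgroup.closure (S : Set G) = ⊤)
    (hord : ∀ s ∈ S, s ≠ 0 → #S + 1 ≤ addOrderOf s)
    (hQb : Q ≠ ⊥) (hQ1 : #(S.erase 0 + Qf) ≤ #S)
    (hQmax : ∀ H : AddSubgroup G, Q ≤ H → ∀ Hf : Finset G, (∀ g, g ∈ Hf ↔ g ∈ H) →
      #(S.erase 0 + Hf) ≤ #S → H = Q)
    (hT3 : 3 ≤ #T) (hST : #(S + T) = #S + #T) (hSTn : #S + #T + 4 ≤ Fintype.card G)
    (hσT : 2 ≤ #(T.image fun x : G => (x : G ⧸ Q)))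
    (hσST : #((S + T).image fun x : G => (x : G ⧸ Q)) + 2 ≤ Nat.card (G ⧸ Q)) :
    ∃ d : G ⧸ Q, d ≠ 0 ∧ IsAP (S.image fun x : G => (x : G ⧸ Q)) d ∧
      IsAP (T.image fun x : G => (x : G ⧸ Q)) d := by
  classical
  have hq5 := five_le_card_of_coprime_six Q Qf hQf hcop hQb
  -- translate `T` through `0`
  obtain ⟨t₀, ht₀⟩ : T.Nonempty := card_pos.1 (by omega)
  set T₀ := -t₀ +ᵥ T with hT₀
  have h0T₀ : (0 : G) ∈ T₀ := mem_vadd_finset.2 ⟨t₀, ht₀, by rw [vadd_eq_add, neg_add_cancel]⟩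
  have hT₀c : #T₀ = #T := card_vadd_finset _ _
  have hST₀ : S + T₀ = -t₀ +ᵥ (S + T) := by
    rw [hT₀, ← singleton_add, ← singleton_add, add_left_comm]
  have hST₀c : #(S + T₀) = #(S + T) := by rw [hST₀, card_vadd_finset]
  have hσT₀ : T₀.image (fun x : G => (x : G ⧸ Q)) = ((-t₀ : G) : G ⧸ Q) +ᵥ
      T.image (fun x : G => (x : G ⧸ Q)) := image_mk_vadd Q _ _
  have hσST₀ : (S + T₀).image (fun x : G => (x : G ⧸ Q)) = ((-t₀ : G) : G ⧸ Q) +ᵥ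
      (S + T).image (fun x : G => (x : G ⧸ Q)) := by rw [hST₀, image_mk_vadd]
  have hσT₀c : #(T₀.image fun x : G => (x : G ⧸ Q)) = #(T.image fun x : G => (x : G ⧸ Q)) := by
    rw [hσT₀, card_vadd_finset]
  have hσST₀c : #((S + T₀).image fun x : G => (x : G ⧸ Q)) =
      #((S + T).image fun x : G => (x : G ⧸ Q)) := by rw [hσST₀, card_vadd_finset]
  -- (eq:noname) for `T₀`
  have hnon := card_image_add_succ_eq Q Qf hQf (T := T₀) h0 hgen hord hQ1 (by omega) (by omega)
    (by rw [hST₀c, hT₀c]; exact hST.le) (by omega) (by rw [hσST₀c]; exact hσST)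
  rw [hσST₀c, hσT₀c] at hnon
  have himg := image_mk_add Q S T₀
  -- Proposition 15 (aperiodic case) in `G ⧸ Q`
  have h0S : (0 : G ⧸ Q) ∈ S.image (fun x : G => (x : G ⧸ Q)) :=
    mem_image.2 ⟨0, h0, QuotientAddGroup.mk_zero Q⟩
  have h0T : (0 : G ⧸ Q) ∈ T₀.image (fun x : G => (x : G ⧸ Q)) :=
    mem_image.2 ⟨0, h0T₀, QuotientAddGroup.mk_zero Q⟩
  have hSQ : ∀ s ∈ S, s ∈ Q → s = 0 := fun s hs hsQ =>
    eq_zero_of_mem_addSubgroup Q Qf hQf hQ1 hord hs hsQ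
  have hstab : ∀ d : G ⧸ Q, d ≠ 0 → d +ᵥ (S.image fun x : G => (x : G ⧸ Q)).erase 0 ≠
      (S.image fun x : G => (x : G ⧸ Q)).erase 0 := by
    intro d hd
    rw [← image_erase_eq_erase_image Q hSQ]
    exact vadd_image_erase_ne Q Qf hQf hQ1 hQmax hd
  have hn : Fintype.card (G ⧸ Q) = Nat.card (G ⧸ Q) := Nat.card_eq_fintype_card.symm
  rcases eq_singleton_or_isAP_of_card_add_le_of_forall_card_le_addOrderOf (G := G ⧸ Q) h0S
      (closure_image_mk_eq_top Q hgen) h0T hstab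
      (by rw [add_comm (T₀.image fun x : G => (x : G ⧸ Q)), ← himg]; omega)
      (by rw [add_comm (T₀.image fun x : G => (x : G ⧸ Q)), ← himg, hn, hσST₀c]; exact hσST)
      (card_image_le_addOrderOf Q Qf hQf h0 hQ1 hord) with h1 | ⟨d, hd, hS, hT⟩
  · rw [h1, card_singleton] at hσT₀c; omega
  · refine ⟨d, hd, hS, ?_⟩
    rw [hσT₀] at hT
    exact (isAP_vadd_iff _).1 hT

omit [Fintype G] in
/-- Reading a progression backwards: `{a, a + d, …, a + (m−1)d} = {u, u − d, …}` with
`u = a + (m−1)d` ("since `−d` is also a difference of `σ(S)` and `σ(T)`").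
[cite: HamidouneSerraZemor2008, §8 (proof of Theorem 29, Case 2)] -/
theorem apFinset_eq_apFinset_neg (a d : G) {m : ℕ} (hm : 1 ≤ m) :
    apFinset a d m = apFinset (a + (m - 1) • d) (-d) m := by
  ext x
  rw [mem_apFinset, mem_apFinset]
  constructor
  · rintro ⟨i, hi, rfl⟩
    refine ⟨m - 1 - i, by omega, ?_⟩
    have e : (m - 1) • d = i • d + (m - 1 - i) • d := by rw [← add_nsmul]; congr 1; omega
    rw [neg_nsmul, e]; abel
  · rintro ⟨j, hj, rfl⟩
    refine ⟨m - 1 - j, by omega, ?_⟩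
    have e : (m - 1) • d = (m - 1 - j) • d + j • d := by rw [← add_nsmul]; congr 1; omega
    rw [neg_nsmul, e]; abel

/-- **Claim 3** of the proof of [HamidouneSerraZemor2008, Theorem 29]: "Let `B ⊂ G` be such that
`σ(B)` is an arithmetic progression of difference `d` and initial element `0`, and with
`|σ(B)| ≤ |σ(T)|`.  Let `B₁ = σ⁻¹(0) ∩ B` and set `B₂ = B ∖ B₁`.  Suppose that `|S + B| = |S| + |B| − ε`
where `ε` equals `0` or `1`.  Then `|B₂ + Q| ≤ |B₂| + 1 − ε`."  Here with the data the printed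
induction on `t = |σ(B)|` actually uses made explicit: `κ₁(S) = |S| − 1` in the form of Corollary 8
(`|X + S| ≥ min(|G|, |X| + |S| − 1)`), `σ(S) ⊆ {a, …, a + (m−1)d}` with terminal coset
`u = a + (m−1)d` whose trace `S' = σ⁻¹(u) ∩ S` has `|S'| ≥ |Q| − 1`, `|Q| ≥ 4`, and
`m + t − 2 < o(d)` (so that the top coset `u + (t−1)d` of `S + B` is met only by `S' + B'`,
`B' = σ⁻¹((t−1)d) ∩ B` — the rôle of "`|σ(B)| ≤ |σ(T)|`").  Printed step: "since `κ₁(S) = |S| − 1`: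
`|S| + |B| − |B'| − 1 ≤ |S + (B ∖ B')| ≤ |S + B| − |S' + B'| = |S| + |B| − ε − |S' + B'|` … `|B'| ≥
|S' + B'| − 1 ≥ |Q| − 2 ≥ 3`.  Hence, since `|S'| + |B'| > |Q|`, we have `S' + B' = Q` … `|B'| ≥
|Q| − 1 + ε` … either `|B'| − |S' + B'| = 0` and the result holds by the induction hypothesis applied
to `B ∖ B'`: or `|B'| − |S' + B'| = −1`.  But in this case `ε = 0`, and the result again holds by
applying the induction hypothesis to `B ∖ B'` with `|S + (B ∖ B')| ≤ |S| + |B ∖ B'| − 1`."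
[cite: HamidouneSerraZemor2008, §8, Theorem 29 (proof, Claim 3)] -/
theorem card_filter_add_le_of_image_eq_apFinset [DecidableEq (G ⧸ Q)] (Qf : Finset G)
    (hQf : ∀ g, g ∈ Qf ↔ g ∈ Q) {S : Finset G}
    (hκ : ∀ X : Finset G, X.Nonempty → min (Fintype.card G) (#X + #S - 1) ≤ #(X + S))
    (hq : 4 ≤ #Qf) {a d : G ⧸ Q} {m : ℕ} (hm : 1 ≤ m)
    (hSap : S.image (fun x : G => (x : G ⧸ Q)) ⊆ apFinset a d m)
    (hS' : #Qf ≤ #(S.filter fun x : G => (x : G ⧸ Q) = a + (m - 1) • d) + 1) :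
    ∀ (t : ℕ) (B : Finset G) (ε : ℕ), B.image (fun x : G => (x : G ⧸ Q)) = apFinset 0 d t →
      1 ≤ t → m + t - 2 < addOrderOf d → #(S + B) + ε = #S + #B → ε ≤ 1 →
      #(B.filter (fun x : G => (x : G ⧸ Q) ≠ 0) + Qf) + ε ≤
        #(B.filter fun x : G => (x : G ⧸ Q) ≠ 0) + 1 := by
  classical
  intro t
  induction t with
  | zero => intro B ε _ h; omega
  | succ t ih =>
    intro B ε hB ht hod hSB hε
    by_cases ht0 : t = 0
    · -- `σ(B) = {0}`: `B₂ = ∅`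
      subst ht0
      have hB2 : B.filter (fun x : G => (x : G ⧸ Q) ≠ 0) = ∅ := by
        rw [filter_eq_empty_iff]
        intro x hx hne
        apply hne
        have : (x : G ⧸ Q) ∈ apFinset (0 : G ⧸ Q) d (0 + 1) := hB ▸ mem_image_of_mem _ hx
        rwa [Nat.zero_add, apFinset_one, mem_singleton] at this
      rw [hB2, empty_add, card_empty]
      omega
    have ht1 : 1 ≤ t := Nat.one_le_iff_ne_zero.2 ht0
    have htord : t < addOrderOf d := by omega
    -- the terminal element `b = t • d ≠ 0` of `σ(B)`, its trace `B'`, and `Bm = B ∖ B'`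
    set b : G ⧸ Q := t • d with hb
    have hb0 : b ≠ 0 := nsmul_ne_zero_of_lt_addOrderOf ht0 htord
    set B' := B.filter (fun x : G => (x : G ⧸ Q) = b) with hB'
    set Bm := B.filter (fun x : G => ¬ (x : G ⧸ Q) = b) with hBm
    have hBsplit : #B' + #Bm = #B := card_filter_add_card_filter_not _
    have hB'le : #B' ≤ #Qf := card_filter_mk_le Q Qf hQf B b
    -- `σ(Bm) = {0, …, (t−1)d}`
    have hBm_img : Bm.image (fun x : G => (x : G ⧸ Q)) = apFinset 0 d t := by
      ext c
      constructor
      · intro hc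
        obtain ⟨x, hx, rfl⟩ := mem_image.1 hc
        have hxB := (mem_filter.1 hx).1
        have hxb := (mem_filter.1 hx).2
        have h1 : (x : G ⧸ Q) ∈ apFinset (0 : G ⧸ Q) d (t + 1) := hB ▸ mem_image_of_mem _ hxB
        rw [apFinset_add_eq_union, mem_union] at h1
        rcases h1 with h | h
        · exact h
        · rw [apFinset_one, mem_singleton, zero_add] at h
          exact absurd h hxb
      · intro hc
        have hc' : c ∈ apFinset (0 : G ⧸ Q) d (t + 1) := by
          rw [apFinset_add_eq_union]; exact mem_union_left _ hc
        rw [← hB] at hc'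
        obtain ⟨x, hx, rfl⟩ := mem_image.1 hc'
        refine mem_image.2 ⟨x, mem_filter.2 ⟨hx, fun h => ?_⟩, rfl⟩
        obtain ⟨i, hi, hix⟩ := mem_apFinset.1 hc
        rw [zero_add] at hix
        rw [← hix, hb] at h
        have := nsmul_injOn_Iio_addOrderOf (Set.mem_Iio.2 (lt_trans hi htord))
          (Set.mem_Iio.2 htord) h
        omega
    have hB'ne : B'.Nonempty := by
      have : b ∈ B.image (fun x : G => (x : G ⧸ Q)) := by
        rw [hB]; exact mem_apFinset.2 ⟨t, by omega, by rw [zero_add]⟩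
      obtain ⟨x, hx, hxb⟩ := mem_image.1 this
      exact ⟨x, mem_filter.2 ⟨hx, hxb⟩⟩
    have hBmne : Bm.Nonempty := by
      have : (0 : G ⧸ Q) ∈ Bm.image (fun x : G => (x : G ⧸ Q)) := by
        rw [hBm_img]; exact mem_apFinset.2 ⟨0, by omega, by rw [zero_nsmul, add_zero]⟩
      obtain ⟨x, hx, -⟩ := mem_image.1 this
      exact ⟨x, hx⟩
    -- the terminal trace `S'` of `S`
    set u : G ⧸ Q := a + (m - 1) • d with hu
    set S' := S.filter (fun x : G => (x : G ⧸ Q) = u) with hS'def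
    have hS'card : #Qf ≤ #S' + 1 := hS'
    -- `S + Bm` misses the coset `u + b ⊇ S' + B'`
    have hdisj : Disjoint (S' + B') (S + Bm) := by
      rw [disjoint_left]
      rintro y hy hy'
      obtain ⟨s', hs', b', hb', rfl⟩ := mem_add.1 hy
      obtain ⟨s, hs, x, hx, he⟩ := mem_add.1 hy'
      have hs'u := (mem_filter.1 hs').2
      have hb'b := (mem_filter.1 hb').2
      have hxim : (x : G ⧸ Q) ∈ apFinset (0 : G ⧸ Q) d t := hBm_img ▸ mem_image_of_mem _ hx
      obtain ⟨i, hi, his⟩ := mem_apFinset.1 (hSap (mem_image_of_mem _ hs))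
      obtain ⟨j, hj, hjx⟩ := mem_apFinset.1 hxim
      rw [zero_add] at hjx
      have hsum : ((s : G) : G ⧸ Q) + (x : G ⧸ Q) = u + b := by
        rw [← QuotientAddGroup.mk_add, he, QuotientAddGroup.mk_add, hs'u, hb'b]
      rw [← his, ← hjx, hu, hb] at hsum
      have h1 : (i + j) • d = (m - 1 + t) • d := by
        have h2 : a + (i + j) • d = a + (m - 1 + t) • d := by
          rw [add_nsmul, add_nsmul, ← add_assoc, ← add_assoc]; exact hsum
        exact add_left_cancel h2
      have h2 := nsmul_injOn_Iio_addOrderOf (Set.mem_Iio.2 (show i + j < addOrderOf d by omega))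
        (Set.mem_Iio.2 (show m - 1 + t < addOrderOf d by omega)) h1
      omega
    have hsub : (S' + B') ∪ (S + Bm) ⊆ S + B :=
      union_subset (add_subset_add (filter_subset _ _) (filter_subset _ _))
        (add_subset_add_left (filter_subset _ _))
    have hcount := card_le_card hsub
    rw [card_union_of_disjoint hdisj] at hcount
    -- `κ₁`: `|Bm + S| ≥ |Bm| + |S| − 1`
    have hSBle : #(S + B) ≤ Fintype.card G := card_le_univ _
    have hκB' : #Bm + #S - 1 ≤ #(S + Bm) := by
      have h := hκ Bm hBmne
      rw [add_comm Bm S] at h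
      rcases min_le_iff.1 h with h | h <;> omega
    -- `S' + B'` fills its coset
    obtain ⟨s₀, hs₀⟩ : S'.Nonempty := card_pos.1 (by omega)
    obtain ⟨b₀, hb₀⟩ := hB'ne
    have hS'sub : S' ⊆ s₀ +ᵥ Qf := filter_mk_subset_vadd Q Qf hQf S (mem_filter.1 hs₀).2
    have hB'sub : B' ⊆ b₀ +ᵥ Qf := filter_mk_subset_vadd Q Qf hQf B (mem_filter.1 hb₀).2
    have hS'B'le : #(S' + B') ≤ #Qf := by
      have hall : ∀ y ∈ S' + B', (y : G ⧸ Q) = u + b := by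
        intro y hy
        obtain ⟨s', hs', b', hb', rfl⟩ := mem_add.1 hy
        rw [QuotientAddGroup.mk_add, (mem_filter.1 hs').2, (mem_filter.1 hb').2]
      have := card_filter_mk_le Q Qf hQf (S' + B') (u + b)
      rwa [filter_true_of_mem hall] at this
    have hS'le : #S' ≤ #(S' + B') := card_le_card_add_right ⟨b₀, hb₀⟩
    have hfull : #Qf ≤ #(S' + B') := by
      have h := vadd_subset_add_of_card_lt Q Qf hQf hS'sub hB'sub (by omega)
      have := card_le_card h
      rwa [card_vadd_finset] at this
    -- the induction hypothesis for `Bm`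
    obtain ⟨ε', hε'⟩ : ∃ ε', #(S + Bm) + ε' = #S + #Bm := ⟨#S + #Bm - #(S + Bm), by omega⟩
    have hih := ih Bm ε' hBm_img ht1 (by omega) hε' (by omega)
    -- `B₂ = Bm₂ ⊔ B'`
    have hB2 : B.filter (fun x : G => (x : G ⧸ Q) ≠ 0) =
        Bm.filter (fun x : G => (x : G ⧸ Q) ≠ 0) ∪ B' := by
      ext x
      simp only [mem_union, mem_filter, hBm, hB']
      constructor
      · rintro ⟨hx, hx0⟩
        by_cases h : (x : G ⧸ Q) = b
        · exact Or.inr ⟨hx, h⟩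
        · exact Or.inl ⟨⟨hx, h⟩, hx0⟩
      · rintro (⟨⟨hx, -⟩, hx0⟩ | ⟨hx, h⟩)
        · exact ⟨hx, hx0⟩
        · exact ⟨hx, by rw [h]; exact hb0⟩
    have hdisj2 : Disjoint (Bm.filter fun x : G => (x : G ⧸ Q) ≠ 0) B' := by
      rw [disjoint_left]
      intro x hx hx'
      exact (mem_filter.1 (mem_filter.1 hx).1).2 (mem_filter.1 hx').2
    have hB2card : #(B.filter fun x : G => (x : G ⧸ Q) ≠ 0) =
        #(Bm.filter fun x : G => (x : G ⧸ Q) ≠ 0) + #B' := by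
      rw [hB2, card_union_of_disjoint hdisj2]
    have hB'Q : #(B' + Qf) ≤ #Qf := by
      have h1 : B' + Qf ⊆ b₀ +ᵥ Qf := by
        refine (add_subset_add_right hB'sub).trans (subset_of_eq ?_)
        rw [← singleton_add, add_assoc, add_self_eq_of_mem_iff Q Qf hQf]
      have := card_le_card h1
      rwa [card_vadd_finset] at this
    have hB2Q : #(B.filter (fun x : G => (x : G ⧸ Q) ≠ 0) + Qf) ≤
        #(Bm.filter (fun x : G => (x : G ⧸ Q) ≠ 0) + Qf) + #Qf := by
      rw [hB2, union_add]
      exact (card_union_le _ _).trans (by omega)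
    rw [hB2card]
    omega

/-- **[HamidouneSerraZemor2008, §8, Theorem 29, second item: "Moreover"].**  "Moreover we have
`|(T ∖ T₁) + Q| ≤ |T ∖ T₁| + 1` where `T₁` is a subset of `T` such that `σ(T₁)` is a single,
extremal element of the progression `σ(T)`."  Precisely: whenever `σ(S) = {a, …, a + (m−1)d}` with
terminal element `a + (m−1)d ≠ 0` ("we may assume without loss of generality that the terminal
element `u` of `σ(S)` is not `0`") and `σ(T) = {b, …, b + (k−1)d}`, the set `T₁ = σ⁻¹(b) ∩ T` over
the initial element works.  This is Claim 3 (`card_filter_add_le_of_image_eq_apFinset`) with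
`ε = 0` applied to `B = T − t₀` (`σ(t₀) = b`): `κ₁(S) = |S| − 1` by Corollary 8, `|S'| ≥ |Q| − 1`
for the terminal trace `S'` of `S` (from `|S* + Q| ≤ |S*| + 1`), `|Q| ≥ 5`, and `m + k =
|σ(S + T)| + 1 ≤ |G/Q| − 1` by (eq:noname).  Valid for every common difference `d` (the maximality
of `Q` and `|σ(T)| ≥ 2` are not needed here). [cite: HamidouneSerraZemor2008, §8, Theorem 29
(second item, "Moreover")] -/
theorem card_filter_add_le_of_image_eq_apFinset_of_card_add_eq [DecidableEq (G ⧸ Q)]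
    (Qf : Finset G) (hQf : ∀ g, g ∈ Qf ↔ g ∈ Q) {S T : Finset G}
    (hcop : (Fintype.card G).Coprime 6) (h0 : (0 : G) ∈ S)
    (hgen : AddSubgroup.closure (S : Set G) = ⊤)
    (hord : ∀ s ∈ S, s ≠ 0 → #S + 1 ≤ addOrderOf s)
    (hQb : Q ≠ ⊥) (hQ1 : #(S.erase 0 + Qf) ≤ #S)
    (hT3 : 3 ≤ #T) (hST : #(S + T) = #S + #T) (hSTn : #S + #T + 4 ≤ Fintype.card G)
    (hσST : #((S + T).image fun x : G => (x : G ⧸ Q)) + 2 ≤ Nat.card (G ⧸ Q))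
    {a b d : G ⧸ Q}
    (hS : S.image (fun x : G => (x : G ⧸ Q)) = apFinset a d #(S.image fun x : G => (x : G ⧸ Q)))
    (hu : a + (#(S.image fun x : G => (x : G ⧸ Q)) - 1) • d ≠ 0)
    (hT : T.image (fun x : G => (x : G ⧸ Q)) = apFinset b d #(T.image fun x : G => (x : G ⧸ Q))) :
    #(T.filter (fun x : G => (x : G ⧸ Q) ≠ b) + Qf) ≤ #(T.filter fun x : G => (x : G ⧸ Q) ≠ b) + 1 := by
  classical
  have hq5 := five_le_card_of_coprime_six Q Qf hQf hcop hQb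
  have hord' : ∀ s ∈ S, s ≠ 0 → #S - 1 ≤ addOrderOf s := fun s hs hs0 => by
    have := hord s hs hs0; omega
  have hκ : ∀ X : Finset G, X.Nonempty → min (Fintype.card G) (#X + #S - 1) ≤ #(X + S) :=
    fun X hX => min_le_card_add_of_forall_le_addOrderOf h0 hgen hord' hX
  set m := #(S.image fun x : G => (x : G ⧸ Q)) with hm
  set k := #(T.image fun x : G => (x : G ⧸ Q)) with hk
  have h0S : (0 : G ⧸ Q) ∈ S.image (fun x : G => (x : G ⧸ Q)) :=
    mem_image.2 ⟨0, h0, QuotientAddGroup.mk_zero Q⟩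
  have hm1 : 1 ≤ m := card_pos.2 ⟨0, h0S⟩
  obtain ⟨t₁, ht₁⟩ : T.Nonempty := card_pos.1 (by omega)
  have hk1 : 1 ≤ k := card_pos.2 ⟨_, mem_image_of_mem _ ht₁⟩
  -- `d` generates `G ⧸ Q`
  have hzd : AddSubgroup.zmultiples d = ⊤ :=
    zmultiples_eq_top_of_zero_mem_subset_apFinset (G := G ⧸ Q) h0S
      (closure_image_mk_eq_top Q hgen) (subset_of_eq hS)
  have hod : addOrderOf d = Nat.card (G ⧸ Q) := by
    rw [addOrderOf_eq_card_of_zmultiples_eq_top hzd, Nat.card_eq_fintype_card]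
  -- (eq:noname): `m + k = |σ(S + T)| + 1`
  have hnon := card_image_add_succ_eq Q Qf hQf h0 hgen hord hQ1 (by omega) hT3 hST.le (by omega) hσST
  have hmk : m + k - 2 < addOrderOf d := by rw [hod]; omega
  -- the terminal trace of `S` is large
  have hQ1' : #(S.erase 0 + Qf) ≤ #(S.erase 0) + 1 := by rw [card_erase_add_one h0]; exact hQ1
  have hSQ : ∀ s ∈ S, s ∈ Q → s = 0 := fun s hs hsQ =>
    eq_zero_of_mem_addSubgroup Q Qf hQf hQ1 hord hs hsQ
  have huS : a + (m - 1) • d ∈ (S.erase 0).image (fun x : G => (x : G ⧸ Q)) := by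
    rw [image_erase_eq_erase_image Q hSQ, mem_erase]
    refine ⟨hu, ?_⟩
    rw [hS]
    exact mem_apFinset.2 ⟨m - 1, by omega, rfl⟩
  have hS' : #Qf ≤ #(S.filter fun x : G => (x : G ⧸ Q) = a + (m - 1) • d) + 1 := by
    have h1 := card_le_card_filter_mk_succ Q Qf hQf hQ1' huS
    have h2 : #((S.erase 0).filter fun x : G => (x : G ⧸ Q) = a + (m - 1) • d) ≤
        #(S.filter fun x : G => (x : G ⧸ Q) = a + (m - 1) • d) :=
      card_le_card (filter_subset_filter _ (erase_subset _ _))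
    omega
  -- translate `T` through its initial trace
  have hbT : b ∈ T.image (fun x : G => (x : G ⧸ Q)) := by
    rw [hT]; exact mem_apFinset.2 ⟨0, by omega, by rw [zero_nsmul, add_zero]⟩
  obtain ⟨t₀, ht₀, ht₀b⟩ := mem_image.1 hbT
  set B := -t₀ +ᵥ T with hB
  have hBimg : B.image (fun x : G => (x : G ⧸ Q)) = apFinset 0 d k := by
    rw [hB, image_mk_vadd, hT, vadd_apFinset, QuotientAddGroup.mk_neg, ht₀b, neg_add_cancel]
  have hBc : #B = #T := card_vadd_finset _ _
  have hSB : #(S + B) + 0 = #S + #B := by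
    rw [add_zero, hBc]
    have e : S + B = -t₀ +ᵥ (S + T) := by rw [hB, ← singleton_add, ← singleton_add, add_left_comm]
    rw [e, card_vadd_finset]
    exact hST
  have hcl := card_filter_add_le_of_image_eq_apFinset Q Qf hQf hκ (by omega) hm1 (subset_of_eq hS)
    hS' k B 0 hBimg hk1 hmk hSB (Nat.zero_le _)
  -- `B₂ = −t₀ + (T ∖ T₁)`
  have hB2 : B.filter (fun x : G => (x : G ⧸ Q) ≠ 0) =
      -t₀ +ᵥ T.filter (fun x : G => (x : G ⧸ Q) ≠ b) := by
    ext x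
    simp only [mem_filter, mem_vadd_finset, hB, vadd_eq_add]
    constructor
    · rintro ⟨⟨t, ht, rfl⟩, hx0⟩
      refine ⟨t, ⟨ht, fun h => hx0 ?_⟩, rfl⟩
      rw [QuotientAddGroup.mk_add, QuotientAddGroup.mk_neg, ht₀b, h, neg_add_cancel]
    · rintro ⟨t, ⟨ht, htb⟩, rfl⟩
      refine ⟨⟨t, ht, rfl⟩, fun h => htb ?_⟩
      rw [QuotientAddGroup.mk_add, QuotientAddGroup.mk_neg, ht₀b, neg_add_eq_zero] at h
      exact h.symm
  rw [hB2] at hcl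
  have e1 : (-t₀ +ᵥ T.filter (fun x : G => (x : G ⧸ Q) ≠ b)) + Qf =
      -t₀ +ᵥ (T.filter (fun x : G => (x : G ⧸ Q) ≠ b) + Qf) := by
    rw [← singleton_add, ← singleton_add, add_assoc]
  rw [e1, card_vadd_finset, card_vadd_finset, add_zero] at hcl
  exact hcl

/-- **[HamidouneSerraZemor2008, §8, Theorem 29, second item: "Furthermore"].**  "Furthermore if `0`
is not an extremal element of the progression `σ(S)`, then `|T + Q| ≤ |T| + 1`."  With
`σ(S) = {a, …, a + (m−1)d}`, `a ≠ 0`, `a + (m−1)d ≠ 0`, and `σ(T) = {b, …, b + (k−1)d}`, `k ≥ 2`.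
Proof as printed: the "Moreover" part in both directions `d`, `−d` makes every trace of `T` (and of
`S*`) have at least `|Q| − 1` elements, so `S* + T` is `Q`-periodic; since `0` is interior and
`|σ(T)| ≥ 2`, `σ(S*) + σ(T) = σ(S) + σ(T)`, so `S + T = S* + T` is `Q`-periodic, and (eq:noname)
gives `|S| + |T| = |S + T| = |σ(S*)||Q| + |σ(T)||Q| ≥ |S| − 1 + |T + Q|`.
[cite: HamidouneSerraZemor2008, §8, Theorem 29 (second item, "Furthermore")] -/
theorem card_add_le_card_succ_of_image_eq_apFinset [DecidableEq (G ⧸ Q)]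
    (Qf : Finset G) (hQf : ∀ g, g ∈ Qf ↔ g ∈ Q) {S T : Finset G}
    (hcop : (Fintype.card G).Coprime 6) (h0 : (0 : G) ∈ S)
    (hgen : AddSubgroup.closure (S : Set G) = ⊤)
    (hord : ∀ s ∈ S, s ≠ 0 → #S + 1 ≤ addOrderOf s)
    (hQb : Q ≠ ⊥) (hQ1 : #(S.erase 0 + Qf) ≤ #S)
    (hT3 : 3 ≤ #T) (hST : #(S + T) = #S + #T) (hSTn : #S + #T + 4 ≤ Fintype.card G)
    (hσT : 2 ≤ #(T.image fun x : G => (x : G ⧸ Q)))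
    (hσST : #((S + T).image fun x : G => (x : G ⧸ Q)) + 2 ≤ Nat.card (G ⧸ Q))
    {a b d : G ⧸ Q}
    (hS : S.image (fun x : G => (x : G ⧸ Q)) = apFinset a d #(S.image fun x : G => (x : G ⧸ Q)))
    (ha : a ≠ 0) (hu : a + (#(S.image fun x : G => (x : G ⧸ Q)) - 1) • d ≠ 0)
    (hT : T.image (fun x : G => (x : G ⧸ Q)) = apFinset b d #(T.image fun x : G => (x : G ⧸ Q))) :
    #(T + Qf) ≤ #T + 1 := by
  classical
  have hq5 := five_le_card_of_coprime_six Q Qf hQf hcop hQb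
  set m := #(S.image fun x : G => (x : G ⧸ Q)) with hm
  set k := #(T.image fun x : G => (x : G ⧸ Q)) with hk
  have h0S : (0 : G ⧸ Q) ∈ S.image (fun x : G => (x : G ⧸ Q)) :=
    mem_image.2 ⟨0, h0, QuotientAddGroup.mk_zero Q⟩
  have hm1 : 1 ≤ m := card_pos.2 ⟨0, h0S⟩
  have hk1 : 1 ≤ k := by omega
  have hzd : AddSubgroup.zmultiples d = ⊤ :=
    zmultiples_eq_top_of_zero_mem_subset_apFinset (G := G ⧸ Q) h0S
      (closure_image_mk_eq_top Q hgen) (subset_of_eq hS)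
  have hod : addOrderOf d = Nat.card (G ⧸ Q) := by
    rw [addOrderOf_eq_card_of_zmultiples_eq_top hzd, Nat.card_eq_fintype_card]
  have hnon := card_image_add_succ_eq Q Qf hQf h0 hgen hord hQ1 (by omega) hT3 hST.le (by omega) hσST
  have hmk : m + k - 2 < addOrderOf d := by rw [hod]; omega
  have hQ1' : #(S.erase 0 + Qf) ≤ #(S.erase 0) + 1 := by rw [card_erase_add_one h0]; exact hQ1
  have hSQ : ∀ s ∈ S, s ∈ Q → s = 0 := fun s hs hsQ =>
    eq_zero_of_mem_addSubgroup Q Qf hQf hQ1 hord hs hsQ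
  -- every trace of `T` has at least `q − 1` elements ("Moreover" in both directions)
  have hfw := card_filter_add_le_of_image_eq_apFinset_of_card_add_eq Q Qf hQf hcop h0 hgen hord hQb
    hQ1 hT3 hST hSTn hσST hS hu hT
  have hS2 : S.image (fun x : G => (x : G ⧸ Q)) = apFinset (a + (m - 1) • d) (-d) m := by
    rw [hS]; exact apFinset_eq_apFinset_neg a d hm1
  have hT2 : T.image (fun x : G => (x : G ⧸ Q)) = apFinset (b + (k - 1) • d) (-d) k := by
    rw [hT]; exact apFinset_eq_apFinset_neg b d hk1
  have hu2 : a + (m - 1) • d + (m - 1) • (-d) ≠ 0 := by rwa [neg_nsmul, add_neg_cancel_right]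
  have hbw := card_filter_add_le_of_image_eq_apFinset_of_card_add_eq Q Qf hQf hcop h0 hgen hord hQb
    hQ1 hT3 hST hSTn hσST hS2 hu2 hT2
  have hbb' : b ≠ b + (k - 1) • d := by
    intro h
    have h1 : (k - 1) • d = 0 := by rw [eq_comm, add_eq_left] at h; exact h
    exact nsmul_ne_zero_of_lt_addOrderOf (show k - 1 ≠ 0 by omega)
      (show k - 1 < addOrderOf d by omega) h1
  have hbig : ∀ c ∈ T.image (fun x : G => (x : G ⧸ Q)),
      #Qf ≤ #(T.filter fun x : G => (x : G ⧸ Q) = c) + 1 := by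
    intro c hc
    obtain ⟨t, ht, rfl⟩ := mem_image.1 hc
    by_cases hcb : (t : G ⧸ Q) = b
    · have hcX : (t : G ⧸ Q) ∈ (T.filter fun x : G => (x : G ⧸ Q) ≠ b + (k - 1) • d).image
          (fun x : G => (x : G ⧸ Q)) :=
        mem_image.2 ⟨t, mem_filter.2 ⟨ht, by rw [hcb]; exact hbb'⟩, rfl⟩
      have h1 := card_le_card_filter_mk_succ Q Qf hQf hbw hcX
      have h2 : #((T.filter fun x : G => (x : G ⧸ Q) ≠ b + (k - 1) • d).filter
          fun x : G => (x : G ⧸ Q) = (t : G ⧸ Q)) ≤ #(T.filter fun x : G => (x : G ⧸ Q) = t) :=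
        card_le_card (filter_subset_filter _ (filter_subset _ _))
      omega
    · have hcX : (t : G ⧸ Q) ∈ (T.filter fun x : G => (x : G ⧸ Q) ≠ b).image
          (fun x : G => (x : G ⧸ Q)) :=
        mem_image.2 ⟨t, mem_filter.2 ⟨ht, hcb⟩, rfl⟩
      have h1 := card_le_card_filter_mk_succ Q Qf hQf hfw hcX
      have h2 : #((T.filter fun x : G => (x : G ⧸ Q) ≠ b).filter
          fun x : G => (x : G ⧸ Q) = (t : G ⧸ Q)) ≤ #(T.filter fun x : G => (x : G ⧸ Q) = t) :=
        card_le_card (filter_subset_filter _ (filter_subset _ _))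
      omega
  have hbigS : ∀ c ∈ (S.erase 0).image (fun x : G => (x : G ⧸ Q)),
      #Qf ≤ #((S.erase 0).filter fun x : G => (x : G ⧸ Q) = c) + 1 :=
    fun c hc => card_le_card_filter_mk_succ Q Qf hQf hQ1' hc
  -- `S* + T` is `Q`-periodic
  have hper : S.erase 0 + T + Qf = S.erase 0 + T := by
    apply add_eq_self_of_forall_add_mem Q Qf hQf
    intro y hy k hk
    obtain ⟨s, hs, t, ht, rfl⟩ := mem_add.1 hy
    have hF := filter_mk_subset_vadd Q Qf hQf (S.erase 0) (rfl : ((s : G) : G ⧸ Q) = s)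
    have hT' := filter_mk_subset_vadd Q Qf hQf T (rfl : ((t : G) : G ⧸ Q) = t)
    have h1 := hbigS _ (mem_image_of_mem _ hs)
    have h2 := hbig _ (mem_image_of_mem _ ht)
    have h3 := vadd_subset_add_of_card_lt Q Qf hQf hF hT' (by omega)
    exact add_subset_add (filter_subset _ _) (filter_subset _ _)
      (h3 (mem_vadd_finset.2 ⟨k, hk, rfl⟩))
  -- `±d ∈ σ(S*)` since `0` is interior
  obtain ⟨j, hj, hja⟩ : ∃ j, j < m ∧ a + j • d = 0 := by
    have h := h0S
    rw [hS, mem_apFinset] at h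
    exact h
  have hj0 : j ≠ 0 := by
    rintro rfl
    rw [zero_nsmul, add_zero] at hja
    exact ha hja
  have hjm : j ≠ m - 1 := by
    rintro rfl
    exact hu hja
  have hd0 : d ≠ 0 := by
    intro hd0
    rw [hd0, addOrderOf_zero] at hmk
    omega
  have hdS : d ∈ (S.erase 0).image (fun x : G => (x : G ⧸ Q)) := by
    rw [image_erase_eq_erase_image Q hSQ, mem_erase, hS]
    exact ⟨hd0, mem_apFinset.2 ⟨j + 1, by omega, by rw [succ_nsmul, ← add_assoc, hja, zero_add]⟩⟩
  have hnegdS : -d ∈ (S.erase 0).image (fun x : G => (x : G ⧸ Q)) := by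
    rw [image_erase_eq_erase_image Q hSQ, mem_erase, hS]
    refine ⟨neg_ne_zero.2 hd0, mem_apFinset.2 ⟨j - 1, by omega, ?_⟩⟩
    have e : j = (j - 1) + 1 := by omega
    rw [e, add_nsmul, one_nsmul, ← add_assoc] at hja
    exact eq_neg_of_add_eq_zero_left hja
  -- `T ⊆ S* + T`, hence `S + T = S* + T` is `Q`-periodic
  have hTsub : T ⊆ S.erase 0 + T := by
    intro t ht
    rw [← hper, mem_add_iff_mk_mem_image Q Qf hQf, image_mk_add]
    have htim : (t : G ⧸ Q) ∈ T.image (fun x : G => (x : G ⧸ Q)) := mem_image_of_mem _ ht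
    rw [hT] at htim
    obtain ⟨i, hi, hit⟩ := mem_apFinset.1 htim
    by_cases hi0 : i = 0
    · subst hi0
      rw [zero_nsmul, add_zero] at hit
      refine mem_add.2 ⟨-d, hnegdS, b + d, ?_, by rw [← hit]; abel⟩
      rw [hT]; exact mem_apFinset.2 ⟨1, by omega, by rw [one_nsmul]⟩
    · refine mem_add.2 ⟨d, hdS, b + (i - 1) • d, ?_, ?_⟩
      · rw [hT]; exact mem_apFinset.2 ⟨i - 1, by omega, rfl⟩
      · have e : i • d = (i - 1) • d + d := by
          rw [← succ_nsmul]; congr 1; omega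
        rw [← hit, e]; abel
  have hSTeq : S + T = S.erase 0 + T := by
    apply Subset.antisymm
    · intro y hy
      obtain ⟨s, hs, t, ht, rfl⟩ := mem_add.1 hy
      by_cases hs0 : s = 0
      · subst hs0; rw [zero_add]; exact hTsub ht
      · exact add_mem_add (mem_erase.2 ⟨hs0, hs⟩) ht
    · exact add_subset_add_right (erase_subset _ _)
  have hSTper : S + T + Qf = S + T := by rw [hSTeq, hper]
  -- counting
  have h1 := card_eq_card_image_mul_of_add_eq Q Qf hQf hSTper
  have h2 := card_image_erase_succ Q Qf hQf h0 hQ1 hord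
  have h3 : #(S.erase 0 + Qf) = #((S.erase 0).image fun x : G => (x : G ⧸ Q)) * #Qf :=
    card_add_eq_card_image_mul Q Qf hQf _
  have h4 : #(T + Qf) = k * #Qf := card_add_eq_card_image_mul Q Qf hQf _
  have h5 : #(S.erase 0) ≤ #(S.erase 0 + Qf) :=
    card_le_card (subset_add_left _ ((hQf 0).2 Q.zero_mem))
  have h6 : #(S.erase 0) + 1 = #S := card_erase_add_one h0
  have h7 : #(S + T) = #(S.erase 0 + Qf) + #(T + Qf) := by
    rw [h1, h3, h4, ← add_mul]
    congr 1
    omega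
  omega

/-- **[HamidouneSerraZemor2008, §8, Theorem 29, second item (`Q ≠ {0}`)] — the printed statement
in full.**  "Let `G` be a finite abelian group with `gcd(|G|, 6) = 1`.  Let `0 ∈ S` be a generating
subset of `G` such that `|S| ≥ 4` and every element in `S*` has order at least `|S| + 1`.  Let `Q` be
a maximal subgroup such that `|S* + Q| − |S*| ≤ 1` and let `σ : G → G/Q` denotes the canonical
projection.  Let `T` be a subset of `G` such that `|T| ≥ 3` and suppose that `|S + T| = |S| + |T| ≤
|G| − 4`.  Then the following holds: … • If `Q ≠ {0}`, `|σ(T)| ≥ 2`, and `|σ(S + T)| < |G|/|Q| − 1`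
then `σ(S)` and `σ(T)` are arithmetic progressions with the same difference.  Moreover we have
`|(T ∖ T₁) + Q| ≤ |T ∖ T₁| + 1` where `T₁` is a subset of `T` such that `σ(T₁)` is a single, extremal
element of the progression `σ(T)`.  Furthermore if `0` is not an extremal element of the progression
`σ(S)`, then `|T + Q| ≤ |T| + 1`."  Rendering: `Q` is given with its finset `Qf`; "maximal" =
maximal under inclusion among subgroups `H` with `|S* + H| ≤ |S*| + 1 = |S|`; the conclusion
produces the common difference `d ≠ 0` and the first terms `a`, `b` with `σ(S) = {a, …, a + (m−1)d}`,
`σ(T) = {b, …, b + (k−1)d}` (`m = |σ(S)|`, `k = |σ(T)|`), `T₁ = σ⁻¹(b) ∩ T`, and the last clause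
under "`a ≠ 0` and `a + (m−1)d ≠ 0`".  The hypothesis `|S| ≥ 4` of the theorem is not used by this
item (it serves the first item, `exists_subset_apFinset_of_card_add_eq_of_aperiodic`).
[cite: HamidouneSerraZemor2008, §8, Theorem 29 (second item)] -/
theorem exists_apFinset_image_of_card_add_eq [DecidableEq (G ⧸ Q)] (Qf : Finset G)
    (hQf : ∀ g, g ∈ Qf ↔ g ∈ Q) {S T : Finset G}
    (hcop : (Fintype.card G).Coprime 6) (h0 : (0 : G) ∈ S)
    (hgen : AddSubgroup.closure (S : Set G) = ⊤)
    (hord : ∀ s ∈ S, s ≠ 0 → #S + 1 ≤ addOrderOf s)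
    (hQb : Q ≠ ⊥) (hQ1 : #(S.erase 0 + Qf) ≤ #S)
    (hQmax : ∀ H : AddSubgroup G, Q ≤ H → ∀ Hf : Finset G, (∀ g, g ∈ Hf ↔ g ∈ H) →
      #(S.erase 0 + Hf) ≤ #S → H = Q)
    (hT3 : 3 ≤ #T) (hST : #(S + T) = #S + #T) (hSTn : #S + #T + 4 ≤ Fintype.card G)
    (hσT : 2 ≤ #(T.image fun x : G => (x : G ⧸ Q)))
    (hσST : #((S + T).image fun x : G => (x : G ⧸ Q)) + 2 ≤ Nat.card (G ⧸ Q)) :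
    ∃ d a b : G ⧸ Q, d ≠ 0 ∧
      S.image (fun x : G => (x : G ⧸ Q)) = apFinset a d #(S.image fun x : G => (x : G ⧸ Q)) ∧
      T.image (fun x : G => (x : G ⧸ Q)) = apFinset b d #(T.image fun x : G => (x : G ⧸ Q)) ∧
      #(T.filter (fun x : G => (x : G ⧸ Q) ≠ b) + Qf) ≤ #(T.filter fun x : G => (x : G ⧸ Q) ≠ b) + 1 ∧
      (a ≠ 0 → a + (#(S.image fun x : G => (x : G ⧸ Q)) - 1) • d ≠ 0 → #(T + Qf) ≤ #T + 1) := by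
  classical
  obtain ⟨d, hd, ⟨a, hS⟩, ⟨b, hT⟩⟩ := exists_isAP_image_of_card_add_eq Q Qf hQf hcop h0 hgen hord hQb
    hQ1 hQmax hT3 hST hSTn hσT hσST
  set m := #(S.image fun x : G => (x : G ⧸ Q)) with hm
  set k := #(T.image fun x : G => (x : G ⧸ Q)) with hk
  have h0S : (0 : G ⧸ Q) ∈ S.image (fun x : G => (x : G ⧸ Q)) :=
    mem_image.2 ⟨0, h0, QuotientAddGroup.mk_zero Q⟩
  have hm1 : 1 ≤ m := card_pos.2 ⟨0, h0S⟩
  have hk1 : 1 ≤ k := by omega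
  by_cases hu : a + (m - 1) • d ≠ 0
  · exact ⟨d, a, b, hd, hS, hT,
      card_filter_add_le_of_image_eq_apFinset_of_card_add_eq Q Qf hQf hcop h0 hgen hord hQb hQ1 hT3
        hST hSTn hσST hS hu hT,
      fun ha hu' => card_add_le_card_succ_of_image_eq_apFinset Q Qf hQf hcop h0 hgen hord hQb hQ1
        hT3 hST hSTn hσT hσST hS ha hu' hT⟩
  · -- the terminal element of `σ(S)` is `0`: read the progressions backwards
    push Not at hu
    have hS2 : S.image (fun x : G => (x : G ⧸ Q)) = apFinset (a + (m - 1) • d) (-d) m := by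
      rw [hS]; exact apFinset_eq_apFinset_neg a d hm1
    have hT2 : T.image (fun x : G => (x : G ⧸ Q)) = apFinset (b + (k - 1) • d) (-d) k := by
      rw [hT]; exact apFinset_eq_apFinset_neg b d hk1
    -- the new terminal element `a` is not `0` (else `m = 1`, `σ(S) = {0}`, `G = Q`)
    have hzd : AddSubgroup.zmultiples d = ⊤ :=
      zmultiples_eq_top_of_zero_mem_subset_apFinset (G := G ⧸ Q) h0S
        (closure_image_mk_eq_top Q hgen) (subset_of_eq hS)
    have hod : addOrderOf d = Nat.card (G ⧸ Q) := by
      rw [addOrderOf_eq_card_of_zmultiples_eq_top hzd, Nat.card_eq_fintype_card]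
    have ha : a + (m - 1) • d + (m - 1) • (-d) ≠ 0 := by
      rw [neg_nsmul, add_neg_cancel_right]
      intro ha0
      rw [ha0, zero_add] at hu
      have hm2 : 2 ≤ m := by
        -- `σ(T) ⊆ σ(S + T)` has at least two elements, and `|σ(S + T)| + 1 = m + k`… simpler:
        -- `m = 1` forces `(m − 1) • d = 0 • d = 0`-consistent; use (eq:noname) with `k ≥ 2`.
        by_contra hlt
        have hm0 : m - 1 = 0 := by omega
        have hnon := card_image_add_succ_eq Q Qf hQf h0 hgen hord hQ1
          (by have := five_le_card_of_coprime_six Q Qf hQf hcop hQb; omega) hT3 hST.le (by omega)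
          hσST
        -- `σ(S) = {0}` gives `σ(S + T) = σ(T)`, so `|σ(T)| + 1 = 1 + |σ(T)|`: no contradiction yet;
        -- but `σ(S) = {0}` means `S ⊆ Q`, so `Q = G` and `|G ⧸ Q| = 1 < 2 ≤ |σ(T)|`.
        have hS0 : S.image (fun x : G => (x : G ⧸ Q)) = {0} := by
          rw [hS, ha0, show m = 1 by omega, apFinset_one]
        have hQtop : (⊤ : AddSubgroup (G ⧸ Q)) = ⊥ := by
          rw [← closure_image_mk_eq_top Q hgen, hS0, coe_singleton, AddSubgroup.closure_singleton_zero]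
        have h1 : Nat.card (G ⧸ Q) = 1 := by
          rw [← AddSubgroup.card_top (G := G ⧸ Q), hQtop, AddSubgroup.card_bot]
        omega
      have h1 := nsmul_ne_zero_of_lt_addOrderOf (show m - 1 ≠ 0 by omega)
        (show m - 1 < addOrderOf d by
          rw [hod]
          have hnon := card_image_add_succ_eq Q Qf hQf h0 hgen hord hQ1
            (by have := five_le_card_of_coprime_six Q Qf hQf hcop hQb; omega) hT3 hST.le (by omega)
            hσST
          omega)
      exact h1 hu
    refine ⟨-d, a + (m - 1) • d, b + (k - 1) • d, neg_ne_zero.2 hd, hS2, hT2,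
      card_filter_add_le_of_image_eq_apFinset_of_card_add_eq Q Qf hQf hcop h0 hgen hord hQb hQ1 hT3
        hST hSTn hσST hS2 ha hT2,
      fun ha' hu' => card_add_le_card_succ_of_image_eq_apFinset Q Qf hQf hcop h0 hgen hord hQb hQ1
        hT3 hST hSTn hσT hσST hS2 ha' hu' hT2⟩

end TheoremTwentyNine

/-! ### Proposition 15 with a non-trivial stabilizer `Q = Stab(S ∖ {0})` -/

section PropositionFifteen

variable (Q : AddSubgroup G)

omit [Fintype G] in
/-- If `S* = S ∖ {0}` is `Q`-periodic then `S ∩ Q = {0}`. [cite: HamidouneSerraZemor2008, §3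
(proof of Proposition 15: "`σ(S)* = σ(S*)`")] -/
theorem eq_zero_of_mem_of_erase_add_eq (Qf : Finset G) (hQf : ∀ g, g ∈ Qf ↔ g ∈ Q) {S : Finset G}
    (hper : S.erase 0 + Qf = S.erase 0) {s : G} (hs : s ∈ S) (hsQ : s ∈ Q) : s = 0 := by
  by_contra hs0
  have h1 : s + -s ∈ S.erase 0 + Qf :=
    add_mem_add (mem_erase.2 ⟨hs0, hs⟩) ((hQf _).2 (Q.neg_mem hsQ))
  rw [hper, add_neg_cancel, mem_erase] at h1
  exact h1.1 rfl

/-- **Orders in `σ(S)` when `S*` is `Q`-periodic:** "the order of every element `x ∈ σ(S) ∖ {0}` is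
at least `⌈|S|/|Q|⌉ = |σ(S)|`." [cite: HamidouneSerraZemor2008, §3 (proof of Proposition 15)] -/
theorem card_image_le_addOrderOf_of_erase_add_eq [DecidableEq (G ⧸ Q)] (Qf : Finset G)
    (hQf : ∀ g, g ∈ Qf ↔ g ∈ Q) {S : Finset G} (h0 : (0 : G) ∈ S)
    (hper : S.erase 0 + Qf = S.erase 0) (hord : ∀ s ∈ S, s ≠ 0 → #S ≤ addOrderOf s) :
    ∀ x ∈ S.image (fun x : G => (x : G ⧸ Q)), x ≠ 0 →
      #(S.image fun x : G => (x : G ⧸ Q)) ≤ addOrderOf x := by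
  intro x hx hx0
  obtain ⟨s, hs, rfl⟩ := mem_image.1 hx
  have hs0 : s ≠ 0 := fun h => hx0 (by rw [h, QuotientAddGroup.mk_zero])
  have hSQ : ∀ s ∈ S, s ∈ Q → s = 0 := fun s hs hsQ =>
    eq_zero_of_mem_of_erase_add_eq Q Qf hQf hper hs hsQ
  have h1 : #(S.erase 0) = #((S.erase 0).image fun x : G => (x : G ⧸ Q)) * #Qf :=
    card_eq_card_image_mul_of_add_eq Q Qf hQf hper
  have h2 : #((S.erase 0).image fun x : G => (x : G ⧸ Q)) + 1 = #(S.image fun x : G => (x : G ⧸ Q)) := by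
    rw [image_erase_eq_erase_image Q hSQ,
      card_erase_add_one (mem_image.2 ⟨0, h0, QuotientAddGroup.mk_zero Q⟩)]
  have h3 := hord s hs hs0
  have h4 := addOrderOf_le_addOrderOf_mk_mul Q Qf hQf s
  have h6 : #(S.erase 0) + 1 = #S := card_erase_add_one h0
  have h5 : (#(S.image fun x : G => (x : G ⧸ Q)) - 1) * #Qf < addOrderOf (s : G ⧸ Q) * #Qf := by
    rw [← h2, Nat.add_sub_cancel, ← h1]; omega
  have := Nat.lt_of_mul_lt_mul_right h5
  omega

omit [Fintype G] in
/-- The difference of two `Q`-periodic sets is `Q`-periodic. [cite: HamidouneSerraZemor2008, §3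
(periodic sets, before Theorem 14)] -/
private theorem sdiff_add_eq_of_add_eq (Qf : Finset G) (hQf : ∀ g, g ∈ Qf ↔ g ∈ Q) {X Y : Finset G}
    (hX : X + Qf = X) (hY : Y + Qf = Y) : X \ Y + Qf = X \ Y := by
  apply add_eq_self_of_forall_add_mem Q Qf hQf
  intro x hx k hk
  rw [mem_sdiff] at hx ⊢
  refine ⟨?_, fun h => hx.2 ?_⟩
  · rw [← hX]; exact add_mem_add hx.1 hk
  · have : x + k + -k ∈ Y + Qf := add_mem_add h ((hQf _).2 (Q.neg_mem ((hQf k).1 hk)))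
    rwa [add_neg_cancel_right, hY] at this

omit [Fintype G] in
/-- **`|σ(T) + σ(S)| ≤ |σ(T)| + |σ(S)| − 1`** (first step of the printed proof, `Q ≠ {0}`):
"Otherwise there are `|σ(S)|` cosets in `σ(T) + σ(S)` not present in `σ(T)`.  But all these cosets
are saturated in `T + S` (notice that `S*` is `Q`-periodic).  It follows that `|T + S| ≥ |T| +
|σ(S)||Q| = |T| + |S| + |Q| − 1`, a contradiction." [cite: HamidouneSerraZemor2008, §3 (proof of
Proposition 15)] -/
theorem card_image_add_succ_le_of_erase_add_eq [DecidableEq (G ⧸ Q)] (Qf : Finset G)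
    (hQf : ∀ g, g ∈ Qf ↔ g ∈ Q) {S T : Finset G} (h0 : (0 : G) ∈ S)
    (hper : S.erase 0 + Qf = S.erase 0) (hTS : #(T + S) + 1 ≤ #T + #S) :
    #(T.image (fun x : G => (x : G ⧸ Q)) + S.image (fun x : G => (x : G ⧸ Q))) + 1 ≤
      #(T.image fun x : G => (x : G ⧸ Q)) + #(S.image fun x : G => (x : G ⧸ Q)) := by
  classical
  by_contra hlt
  push Not at hlt
  have hSQ : ∀ s ∈ S, s ∈ Q → s = 0 := fun s hs hsQ =>
    eq_zero_of_mem_of_erase_add_eq Q Qf hQf hper hs hsQ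
  have himg := image_mk_add Q T S
  -- `Σ = (T + S*) ∖ (T + Q)` is `Q`-periodic
  have hper' : T + S.erase 0 + Qf = T + S.erase 0 := by rw [add_assoc, hper]
  have hSig := sdiff_add_eq_of_add_eq Q Qf hQf hper' (add_add_eq_add_of_mem_iff Q Qf hQf T)
  have hSigCard := card_eq_card_image_mul_of_add_eq Q Qf hQf hSig
  have hSigImg : (T.image (fun x : G => (x : G ⧸ Q)) + S.image (fun x : G => (x : G ⧸ Q))) \
      T.image (fun x : G => (x : G ⧸ Q)) ⊆
      ((T + S.erase 0) \ (T + Qf)).image (fun x : G => (x : G ⧸ Q)) := by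
    intro c hc
    rw [mem_sdiff, ← himg] at hc
    obtain ⟨hc1, hc2⟩ := hc
    obtain ⟨y, hy, rfl⟩ := mem_image.1 hc1
    obtain ⟨t, ht, s, hs, rfl⟩ := mem_add.1 hy
    have hs0 : s ≠ 0 := by
      rintro rfl
      rw [add_zero] at hc2
      exact hc2 (mem_image_of_mem _ ht)
    refine mem_image.2 ⟨t + s, mem_sdiff.2 ⟨add_mem_add ht (mem_erase.2 ⟨hs0, hs⟩),
      fun h => hc2 ?_⟩, rfl⟩
    exact (mem_add_iff_mk_mem_image Q Qf hQf).1 h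
  have hdisj : Disjoint T ((T + S.erase 0) \ (T + Qf)) := disjoint_left.2 fun y hy hyS =>
    (mem_sdiff.1 hyS).2 (subset_add_left T ((hQf 0).2 Q.zero_mem) hy)
  have hsub : T ∪ (T + S.erase 0) \ (T + Qf) ⊆ T + S :=
    union_subset (subset_add_left T h0)
      (sdiff_subset.trans (add_subset_add_left (erase_subset _ _)))
  have hc := card_le_card hsub
  rw [card_union_of_disjoint hdisj] at hc
  have hTsub : T.image (fun x : G => (x : G ⧸ Q)) ⊆
      T.image (fun x : G => (x : G ⧸ Q)) + S.image (fun x : G => (x : G ⧸ Q)) :=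
    subset_add_left _ (mem_image.2 ⟨0, h0, QuotientAddGroup.mk_zero Q⟩)
  have h1 : #(S.image fun x : G => (x : G ⧸ Q)) ≤
      #(((T + S.erase 0) \ (T + Qf)).image fun x : G => (x : G ⧸ Q)) := by
    have h2 := card_le_card hSigImg
    rw [card_sdiff_of_subset hTsub] at h2
    omega
  have h3 : #((S.erase 0).image fun x : G => (x : G ⧸ Q)) + 1 = #(S.image fun x : G => (x : G ⧸ Q)) := by
    rw [image_erase_eq_erase_image Q hSQ,
      card_erase_add_one (mem_image.2 ⟨0, h0, QuotientAddGroup.mk_zero Q⟩)]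
  have h4 : #(S.erase 0) = #((S.erase 0).image fun x : G => (x : G ⧸ Q)) * #Qf :=
    card_eq_card_image_mul_of_add_eq Q Qf hQf hper
  have h6 : #(S.erase 0) + 1 = #S := card_erase_add_one h0
  have h7 : #(S.image fun x : G => (x : G ⧸ Q)) * #Qf ≤ #((T + S.erase 0) \ (T + Qf)) := by
    rw [hSigCard]; exact Nat.mul_le_mul_right _ h1
  have h8 : #(S.erase 0) + #Qf ≤ #((T + S.erase 0) \ (T + Qf)) := by
    rw [h4]
    have := h7
    rw [← h3, add_mul, one_mul] at this
    exact this
  have hq : 1 ≤ #Qf := card_pos.2 ⟨0, (hQf 0).2 Q.zero_mem⟩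
  omega

omit [Fintype G] in
/-- **"The stabilizer of `σ(S)* = σ(S*)` must be `{0}`"** when `Q` is the full stabilizer of `S*`.
[cite: HamidouneSerraZemor2008, §3 (proof of Proposition 15)] -/
theorem vadd_image_erase_ne_of_stabilizer [DecidableEq (G ⧸ Q)] (Qf : Finset G)
    (hQf : ∀ g, g ∈ Qf ↔ g ∈ Q) {S : Finset G} (hper : S.erase 0 + Qf = S.erase 0)
    (hQstab : ∀ g : G, g +ᵥ S.erase 0 = S.erase 0 → g ∈ Q) {d : G ⧸ Q} (hd : d ≠ 0) :
    d +ᵥ (S.erase 0).image (fun x : G => (x : G ⧸ Q)) ≠ (S.erase 0).image (fun x : G => (x : G ⧸ Q)) := by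
  intro hD
  obtain ⟨g, rfl⟩ := QuotientAddGroup.mk_surjective d
  apply hd
  rw [QuotientAddGroup.eq_zero_iff]
  apply hQstab
  apply eq_of_subset_of_card_le _ (by rw [card_vadd_finset])
  intro x hx
  obtain ⟨s, hs, rfl⟩ := mem_vadd_finset.1 hx
  rw [← hper, mem_add_iff_mk_mem_image Q Qf hQf, vadd_eq_add, QuotientAddGroup.mk_add, ← vadd_eq_add,
    ← hD]
  exact mem_vadd_finset.2 ⟨_, mem_image_of_mem _ hs, rfl⟩

omit [Fintype G] in
/-- **A weak-Chowla set absorbing a translate of its non-zero part is a progression:** if `0 ∈ P`,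
`y ≠ 0`, `y + (P ∖ {0}) ⊆ P`, `P ∖ {0}` has no non-zero period and every non-zero element of `P`
has order `≥ |P|`, then `P = {0, −y, −2y, …, −(|P|−1)y}`.  (Our route for the boundary case of
Proposition 15, see `exists_isAP_image_of_card_add_le`; the chain `−y, −2y, …` cannot leave `P`
before exhausting it, since the remaining part of `P ∖ {0}` would be `y`-invariant and contain a
coset of `⟨y⟩` of size `o(y) ≥ |P|`.) [cite: HamidouneSerraZemor2008, §3 (Proposition 15;
supplement to the printed proof)] -/
theorem eq_apFinset_of_vadd_erase_subset {P : Finset G} (h0 : (0 : G) ∈ P) {y : G} (hy : y ≠ 0)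
    (hsub : y +ᵥ P.erase 0 ⊆ P) (haper : ∀ z : G, z ≠ 0 → z +ᵥ P.erase 0 ≠ P.erase 0)
    (hord : ∀ p ∈ P, p ≠ 0 → #P ≤ addOrderOf p) : P = apFinset 0 (-y) #P := by
  classical
  set P' := P.erase 0 with hP'
  have hP'c : #P' + 1 = #P := card_erase_add_one h0
  -- every `p ∈ P` off one point `w` has `p − y ∈ P'`; `−y ∈ P'`
  have hstep : ∀ p ∈ P, p - y ∉ P' → ∀ p' ∈ P, p' - y ∉ P' → p = p' := by
    intro p hp hpy p' hp' hp'y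
    by_contra hne
    -- `y + P'` misses both `p` and `p'`, so `|y + P'| ≤ |P| − 2`
    have h1 : y +ᵥ P' ⊆ (P.erase p).erase p' := by
      intro x hx
      obtain ⟨z, hz, rfl⟩ := mem_vadd_finset.1 hx
      rw [mem_erase, mem_erase]
      refine ⟨fun h => hp'y ?_, fun h => hpy ?_, hsub (mem_vadd_finset.2 ⟨z, hz, rfl⟩)⟩
      · rw [← h, vadd_eq_add, add_sub_cancel_left]; exact hz
      · rw [← h, vadd_eq_add, add_sub_cancel_left]; exact hz
    have h2 := card_le_card h1
    rw [card_vadd_finset, card_erase_of_mem (mem_erase.2 ⟨fun h => hne h.symm, hp'⟩),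
      card_erase_of_mem hp] at h2
    have h3 : 1 < #P := one_lt_card.2 ⟨p, hp, p', hp', hne⟩
    omega
  have hnegy : -y ∈ P' := by
    by_contra hny
    -- then `0 − y ∉ P'`, so every `p ∈ P'` has `p − y ∈ P'`: `P'` is `(−y)`-invariant
    have hinv : -y +ᵥ P' = P' := by
      apply eq_of_subset_of_card_le _ (by rw [card_vadd_finset])
      intro x hx
      obtain ⟨p, hp, rfl⟩ := mem_vadd_finset.1 hx
      rw [vadd_eq_add, neg_add_eq_sub]
      by_contra hpy
      have := hstep p (mem_of_mem_erase hp) hpy 0 h0 (by rwa [zero_sub])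
      exact (mem_erase.1 hp).1 this
    exact haper (-y) (neg_ne_zero.2 hy) hinv
  have hoy : #P ≤ addOrderOf y := by
    rw [← addOrderOf_neg]; exact hord _ (mem_of_mem_erase hnegy) (mem_erase.1 hnegy).1
  -- the chain `−y, −2y, …, −L y` inside `P'`, `L` maximal with `L ≤ |P| − 1`
  have hchain : ∀ L : ℕ, L + 1 ≤ #P → (∀ l, 1 ≤ l → l ≤ L → -(l • y) ∈ P') ∨
      (∃ L' : ℕ, 1 ≤ L' ∧ L' < L ∧ (∀ l, 1 ≤ l → l ≤ L' → -(l • y) ∈ P') ∧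
        -((L' + 1) • y) ∉ P') := by
    intro L
    induction L with
    | zero => intro _; left; intro l h1 h2; omega
    | succ L ih =>
      intro hL
      rcases ih (by omega) with h | ⟨L', hL'1, hL'L, hL'c, hL'n⟩
      · by_cases hnext : -((L + 1) • y) ∈ P'
        · left
          intro l h1 h2
          rcases Nat.lt_or_ge l (L + 1) with h3 | h3
          · exact h l h1 (by omega)
          · rw [show l = L + 1 by omega]; exact hnext
        · rcases Nat.eq_zero_or_pos L with hL0 | hL0
          · subst hL0; rw [one_nsmul] at hnext; exact absurd hnegy hnext
          · right; exact ⟨L, hL0, by omega, h, hnext⟩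
      · right; exact ⟨L', hL'1, by omega, hL'c, hL'n⟩
  rcases hchain (#P - 1) (by omega) with hall | ⟨L, hL1, hLlt, hLc, hLn⟩
  · -- the whole chain lies in `P'`: `P = {0, −y, …, −(|P|−1)y}`
    symm
    apply eq_of_subset_of_card_le
    · intro x hx
      obtain ⟨l, hl, rfl⟩ := mem_apFinset.1 hx
      rw [zero_add, neg_nsmul]
      rcases Nat.eq_zero_or_pos l with rfl | hl0
      · rw [zero_nsmul, neg_zero]; exact h0
      · exact mem_of_mem_erase (hall l hl0 (by omega))
    · rw [card_apFinset_of_le_addOrderOf _ _ (by rw [addOrderOf_neg]; exact hoy)]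
  · -- the chain stops at `w = −L y`; the rest `D` of `P'` is `(−y)`-invariant and too big
    exfalso
    set C := (Finset.range L).image (fun i : ℕ => -((i + 1) • y)) with hC
    have hCsub : C ⊆ P' := by
      intro x hx
      obtain ⟨i, hi, rfl⟩ := mem_image.1 hx
      exact hLc (i + 1) (by omega) (by rw [mem_range] at hi; omega)
    have hCcard : #C = L := by
      rw [hC, card_image_of_injOn, card_range]
      intro i hi j hj hij
      have hi' : i + 1 < addOrderOf y := by rw [mem_coe, mem_range] at hi; omega
      have hj' : j + 1 < addOrderOf y := by rw [mem_coe, mem_range] at hj; omega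
      have hij' : (i + 1) • y = (j + 1) • y := neg_inj.1 hij
      have := nsmul_injOn_Iio_addOrderOf (Set.mem_Iio.2 hi') (Set.mem_Iio.2 hj') hij'
      omega
    set D := P' \ C with hD
    have hDne : D.Nonempty := by
      rw [← card_pos, hD, card_sdiff_of_subset hCsub, hCcard]; omega
    have hw : ∀ p ∈ P, p - y ∉ P' → p = -(L • y) := fun p hp hpy =>
      hstep p hp hpy _ (mem_of_mem_erase (hLc L hL1 le_rfl))
        (by rw [← neg_add', ← succ_nsmul]; exact hLn)
    have hDinv : -y +ᵥ D = D := by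
      apply eq_of_subset_of_card_le _ (by rw [card_vadd_finset])
      intro x hx
      obtain ⟨p, hp, rfl⟩ := mem_vadd_finset.1 hx
      rw [hD, mem_sdiff] at hp ⊢
      obtain ⟨hpP', hpC⟩ := hp
      rw [vadd_eq_add, neg_add_eq_sub]
      have hpy : p - y ∈ P' := by
        by_contra hpy
        have := hw p (mem_of_mem_erase hpP') hpy
        apply hpC
        rw [this, hC]
        exact mem_image.2 ⟨L - 1, by rw [mem_range]; omega, by rw [Nat.sub_add_cancel hL1]⟩
      refine ⟨hpy, fun hC' => ?_⟩
      obtain ⟨i, hi, hiy⟩ := mem_image.1 hC'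
      rw [mem_range] at hi
      rcases Nat.eq_zero_or_pos i with rfl | hi0
      · rw [zero_add, one_nsmul] at hiy
        have : p = 0 := by
          have := congrArg (· + y) hiy; simp only [neg_add_cancel, sub_add_cancel] at this
          exact this.symm
        exact (mem_erase.1 hpP').1 this
      · apply hpC
        rw [hC]
        refine mem_image.2 ⟨i - 1, by rw [mem_range]; omega, ?_⟩
        have e : -((i - 1 + 1) • y) = -((i + 1) • y) + y := by
          rw [show i - 1 + 1 = i by omega, succ_nsmul, neg_add', sub_add_cancel]  -- fix below
        rw [e, hiy, sub_add_cancel]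
    -- `D ⊇ d₀ + ⟨y⟩`
    obtain ⟨d₀, hd₀⟩ := hDne
    have hcoset : apFinset d₀ (-y) (addOrderOf (-y)) ⊆ D := by
      intro x hx
      obtain ⟨i, -, rfl⟩ := mem_apFinset.1 hx
      exact (mem_iff_add_nsmul_mem_of_vadd_eq hDinv d₀ i).1 hd₀
    have h1 := card_le_card hcoset
    rw [card_apFinset_of_le_addOrderOf _ _ le_rfl, addOrderOf_neg] at h1
    have h2 : #D ≤ #P' := card_le_card sdiff_subset
    omega

omit [DecidableEq G] in
/-- Lagrange: `|Q| · |G ⧸ Q| = |G|`. [folklore] -/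
private theorem card_mul_natCard_quotient (Qf : Finset G) (hQf : ∀ g, g ∈ Qf ↔ g ∈ Q) :
    #Qf * Nat.card (G ⧸ Q) = Fintype.card G := by
  rw [← natCard_eq_card_of_mem_iff Q Qf hQf, mul_comm,
    ← AddSubgroup.card_eq_card_quotient_mul_card_addSubgroup, Nat.card_eq_fintype_card]

omit [Fintype G] in
/-- `σ(T) + σ(S) = σ(T) ∪ (σ(T) + σ(S*))` for `0 ∈ S`. [folklore] -/
private theorem image_add_image_eq_union [DecidableEq (G ⧸ Q)] {S T : Finset G} (h0 : (0 : G) ∈ S) :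
    T.image (fun x : G => (x : G ⧸ Q)) + S.image (fun x : G => (x : G ⧸ Q)) =
      T.image (fun x : G => (x : G ⧸ Q)) ∪
        (T.image (fun x : G => (x : G ⧸ Q)) + (S.erase 0).image (fun x : G => (x : G ⧸ Q))) := by
  ext x
  simp only [mem_union, mem_add, mem_image]
  constructor
  · rintro ⟨t, ht, s, ⟨s₀, hs₀, rfl⟩, rfl⟩
    by_cases hs0 : s₀ = 0
    · left
      obtain ⟨t₀, ht₀, rfl⟩ := ht
      exact ⟨t₀, ht₀, by rw [hs0, QuotientAddGroup.mk_zero, add_zero]⟩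
    · right
      exact ⟨t, ht, s₀, ⟨s₀, mem_erase.2 ⟨hs0, hs₀⟩, rfl⟩, rfl⟩
  · rintro (⟨t₀, ht₀, rfl⟩ | ⟨t, ht, s, ⟨s₀, hs₀, rfl⟩, rfl⟩)
    · exact ⟨t₀, ⟨t₀, ht₀, rfl⟩, 0, ⟨0, h0, QuotientAddGroup.mk_zero Q⟩, add_zero _⟩
    · exact ⟨t, ht, s₀, ⟨s₀, mem_of_mem_erase hs₀, rfl⟩, rfl⟩

/-- **[HamidouneSerraZemor2008, §3, Proposition 15] with its stabilizer `Q` (general case).**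
"Let `0 ∈ S` be a generating subset of a finite abelian group `G` and let `0 ∈ T` be a subset of
`G`.  Let `Q` denote the stabilizer of `S ∖ {0}`.  Suppose that `|T + S| ≤ |T| + |S| − 1 <
|G| − |Q|`.  Also assume that every element of `S* = S ∖ {0}` has order `≥ |S|`.  Let
`σ : G → G/Q` denote the canonical projection.  One of the following holds: (i) either `T ⊂ Q`,
(ii) or `σ(S)` and `σ(T)` are arithmetic progressions with the same difference."  (The "Moreover"
clause of (ii) is `exists_forall_card_filter_eq_of_image_eq_apFinset`.)  `Q` is given with its
finset `Qf`, as the stabilizer: `S* + Q = S*` and every `g` with `g + S* = S*` lies in `Q`; the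
case `Q = {0}` is the tree's `eq_singleton_or_isAP_of_card_add_le_of_forall_card_le_addOrderOf`.
Proof: as printed, `|σ(T) + σ(S)| ≤ |σ(T)| + |σ(S)| − 1`
(`card_image_add_succ_le_of_erase_add_eq`), the orders in `σ(S)*` are `≥ |σ(S)|`, the stabilizer
of `σ(S*)` is trivial, and "Theorem 14 in `G/Q` implies that `σ(S)` is an arithmetic progression.
It follows now that `σ(T)` is an arithmetic progression with the same difference" — through
Proposition 15's own case `Q = {0}` in `G ⧸ Q` whenever `|σ(T) + σ(S)| ≤ |G/Q| − 2`.
SUPPLEMENT (not in print): the printed reduction needs a `2`-separability witness for `σ(S)` in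
`G/Q`, which `σ(T)` is not when `|σ(T) + σ(S)| = |G/Q| − 1` (e.g. `G/Q = ℤ/7`, `σ(S) =
{0, 1, 2}`, `σ(T) = {0, 1, 2, 3}` does occur); in that boundary case `σ(T)` is the complement of
`c − σ(S)` for the missing class `c`, the hypothesis `|T + S| < |G| − |Q|` produces `t̄ ∈ σ(T)`
with `t̄ − σ(S*)` disjoint from `σ(T)`, hence `(c − t̄) + σ(S*) ⊆ σ(S)`, and
`eq_apFinset_of_vadd_erase_subset` makes `σ(S)` a progression (the transfer to `σ(T)` is
`isAP_of_isAP_of_card_add_le`); the case `σ(T) + σ(S) = G/Q` is excluded by counting the full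
cosets of `T + S`. [cite: HamidouneSerraZemor2008, §3, Proposition 15] -/
theorem subset_or_exists_isAP_image_of_card_add_le [DecidableEq (G ⧸ Q)] (Qf : Finset G)
    (hQf : ∀ g, g ∈ Qf ↔ g ∈ Q) {S T : Finset G} (h0S : (0 : G) ∈ S)
    (hgen : AddSubgroup.closure (S : Set G) = ⊤) (h0T : (0 : G) ∈ T)
    (hper : S.erase 0 + Qf = S.erase 0) (hQstab : ∀ g : G, g +ᵥ S.erase 0 = S.erase 0 → g ∈ Q)
    (hTS : #(T + S) + 1 ≤ #T + #S) (hTSn : #T + #S + #Qf ≤ Fintype.card G)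
    (hord : ∀ s ∈ S, s ≠ 0 → #S ≤ addOrderOf s) :
    T ⊆ Qf ∨ ∃ d : G ⧸ Q, d ≠ 0 ∧ IsAP (S.image fun x : G => (x : G ⧸ Q)) d ∧
      IsAP (T.image fun x : G => (x : G ⧸ Q)) d := by
  classical
  have hSQ : ∀ s ∈ S, s ∈ Q → s = 0 := fun s hs hsQ =>
    eq_zero_of_mem_of_erase_add_eq Q Qf hQf hper hs hsQ
  have h0S' : (0 : G ⧸ Q) ∈ S.image (fun x : G => (x : G ⧸ Q)) :=
    mem_image.2 ⟨0, h0S, QuotientAddGroup.mk_zero Q⟩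
  have h0T' : (0 : G ⧸ Q) ∈ T.image (fun x : G => (x : G ⧸ Q)) :=
    mem_image.2 ⟨0, h0T, QuotientAddGroup.mk_zero Q⟩
  have hq1 : 1 ≤ #Qf := card_pos.2 ⟨0, (hQf 0).2 Q.zero_mem⟩
  have hGQ := card_mul_natCard_quotient Q Qf hQf
  have hn : Fintype.card (G ⧸ Q) = Nat.card (G ⧸ Q) := Nat.card_eq_fintype_card.symm
  have hTpos : 0 < #T := card_pos.2 ⟨0, h0T⟩
  -- `σ(T) = {0}`: alternative (i)
  by_cases hT1 : #(T.image fun x : G => (x : G ⧸ Q)) = 1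
  · left
    intro t ht
    obtain ⟨x, hx⟩ := card_eq_one.1 hT1
    have h1 : ((t : G) : G ⧸ Q) = x := by
      have := mem_image_of_mem (fun x : G => (x : G ⧸ Q)) ht
      rw [hx, mem_singleton] at this
      exact this
    have h2 : (0 : G ⧸ Q) = x := by rw [hx, mem_singleton] at h0T'; exact h0T'
    exact (hQf t).2 ((QuotientAddGroup.eq_zero_iff t).1 (h1.trans h2.symm))
  right
  have hT2 : 2 ≤ #(T.image fun x : G => (x : G ⧸ Q)) := by
    have := card_pos.2 ⟨0, h0T'⟩; omega
  -- (1) `|σT + σS| ≤ |σT| + |σS| − 1`, orders, aperiodicity of `σ(S*)`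
  have h1 := card_image_add_succ_le_of_erase_add_eq Q Qf hQf h0S hper hTS
  have hordσ := card_image_le_addOrderOf_of_erase_add_eq Q Qf hQf h0S hper hord
  have hstab : ∀ d : G ⧸ Q, d ≠ 0 → d +ᵥ (S.image fun x : G => (x : G ⧸ Q)).erase 0 ≠
      (S.image fun x : G => (x : G ⧸ Q)).erase 0 := by
    intro d hd
    rw [← image_erase_eq_erase_image Q hSQ]
    exact vadd_image_erase_ne_of_stabilizer Q Qf hQf hper hQstab hd
  have hgen' := closure_image_mk_eq_top Q hgen
  have hS'c : #((S.erase 0).image fun x : G => (x : G ⧸ Q)) + 1 = #(S.image fun x : G => (x : G ⧸ Q)) := by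
    rw [image_erase_eq_erase_image Q hSQ, card_erase_add_one h0S']
  -- `|σS| ≥ 2`
  have hm2 : 2 ≤ #(S.image fun x : G => (x : G ⧸ Q)) := by
    by_contra hlt
    have hm1 : #(S.image fun x : G => (x : G ⧸ Q)) = 1 := by
      have := card_pos.2 ⟨0, h0S'⟩; omega
    obtain ⟨x, hx⟩ := card_eq_one.1 hm1
    have hx0 : x = 0 := by rw [hx, mem_singleton] at h0S'; exact h0S'.symm
    have htop : (⊤ : AddSubgroup (G ⧸ Q)) = ⊥ := by
      rw [← hgen', hx, hx0, coe_singleton, AddSubgroup.closure_singleton_zero]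
    have hn1 : Nat.card (G ⧸ Q) = 1 := by
      rw [← AddSubgroup.card_top (G := G ⧸ Q), htop, AddSubgroup.card_bot]
    rw [hn1, mul_one] at hGQ
    omega
  -- `|σT + σ(S*)| ≤ |G/Q| − 2`
  have hTS' : T + S.erase 0 + Qf = T + S.erase 0 := by rw [add_assoc, hper]
  have h2 : #(T.image (fun x : G => (x : G ⧸ Q)) + (S.erase 0).image (fun x : G => (x : G ⧸ Q))) + 2 ≤
      Nat.card (G ⧸ Q) := by
    have e1 : #(T + S.erase 0) = #(T.image (fun x : G => (x : G ⧸ Q)) +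
        (S.erase 0).image (fun x : G => (x : G ⧸ Q))) * #Qf := by
      rw [card_eq_card_image_mul_of_add_eq Q Qf hQf hTS', image_mk_add]
    have e2 : #(T + S.erase 0) ≤ #(T + S) := card_le_card (add_subset_add_left (erase_subset _ _))
    by_contra hlt
    push Not at hlt
    have h3 : Nat.card (G ⧸ Q) * #Qf ≤ (#(T.image (fun x : G => (x : G ⧸ Q)) +
        (S.erase 0).image (fun x : G => (x : G ⧸ Q))) + 1) * #Qf := Nat.mul_le_mul_right _ (by omega)
    rw [add_mul, one_mul, ← e1, mul_comm, hGQ] at h3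
    omega
  have hU := image_add_image_eq_union Q (T := T) h0S
  by_cases hint : #(T.image (fun x : G => (x : G ⧸ Q)) + S.image (fun x : G => (x : G ⧸ Q))) + 2 ≤
      Nat.card (G ⧸ Q)
  · -- interior case: Proposition 15 with trivial stabilizer, in `G ⧸ Q`
    rcases eq_singleton_or_isAP_of_card_add_le_of_forall_card_le_addOrderOf (G := G ⧸ Q) h0S' hgen'
        h0T' hstab h1 (by rw [hn]; exact hint) hordσ with h | ⟨d, hd, hS, hT⟩
    · rw [h, card_singleton] at hT2; omega
    · exact ⟨d, hd, hS, hT⟩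
  -- boundary case (supplement): `|σT + σS| ≥ |G/Q| − 1`
  push Not at hint
  -- some `t̄ ∈ σT` lies outside `σT + σ(S*)`
  obtain ⟨tb, htbT, htbV⟩ : ∃ tb ∈ T.image (fun x : G => (x : G ⧸ Q)),
      tb ∉ T.image (fun x : G => (x : G ⧸ Q)) + (S.erase 0).image (fun x : G => (x : G ⧸ Q)) := by
    by_contra hall
    push Not at hall
    have : T.image (fun x : G => (x : G ⧸ Q)) + S.image (fun x : G => (x : G ⧸ Q)) =
        T.image (fun x : G => (x : G ⧸ Q)) + (S.erase 0).image (fun x : G => (x : G ⧸ Q)) := by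
      rw [hU]; exact union_eq_right.2 fun x hx => hall x hx
    rw [this] at hint
    omega
  -- for such `t̄`, `t̄ − σ(S*)` is disjoint from `σT`
  have hdisjW : ∀ r ∈ T.image (fun x : G => (x : G ⧸ Q)),
      r ∉ T.image (fun x : G => (x : G ⧸ Q)) + (S.erase 0).image (fun x : G => (x : G ⧸ Q)) →
      Disjoint (((S.erase 0).image fun x : G => (x : G ⧸ Q)).image (fun s => r - s))
        (T.image fun x : G => (x : G ⧸ Q)) := by
    intro r _ hrV
    rw [disjoint_left]
    intro x hx hxT
    obtain ⟨s, hs, rfl⟩ := mem_image.1 hx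
    exact hrV (mem_add.2 ⟨r - s, hxT, s, hs, sub_add_cancel r s⟩)
  have hWc : ∀ r : G ⧸ Q, #(((S.erase 0).image fun x : G => (x : G ⧸ Q)).image (fun s => r - s)) + 1 =
      #(S.image fun x : G => (x : G ⧸ Q)) := by
    intro r
    rw [card_image_of_injective _ sub_right_injective, hS'c]
  have hcardU : #(T.image (fun x : G => (x : G ⧸ Q)) + S.image (fun x : G => (x : G ⧸ Q))) ≤
      Nat.card (G ⧸ Q) := by rw [← hn]; exact card_le_univ _
  by_cases hUfull : #(T.image (fun x : G => (x : G ⧸ Q)) + S.image (fun x : G => (x : G ⧸ Q))) =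
      Nat.card (G ⧸ Q)
  · -- `σT + σS = G/Q`: impossible (too many full cosets in `T + S`)
    exfalso
    set V := T.image (fun x : G => (x : G ⧸ Q)) + (S.erase 0).image (fun x : G => (x : G ⧸ Q)) with hV
    set R := T.image (fun x : G => (x : G ⧸ Q)) \ V with hR
    set TR := T.filter (fun t : G => (t : G ⧸ Q) ∉ V) with hTR
    -- `T + S = (T + S*) ⊔ TR`
    have hsplit : T + S = (T + S.erase 0) ∪ TR := by
      apply Subset.antisymm
      · intro x hx
        obtain ⟨t, ht, s, hs, rfl⟩ := mem_add.1 hx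
        by_cases hs0 : s = 0
        · subst hs0
          rw [add_zero]
          by_cases htV : ((t : G) : G ⧸ Q) ∈ V
          · apply mem_union_left
            rw [← hTS', mem_add_iff_mk_mem_image Q Qf hQf, image_mk_add]
            exact htV
          · exact mem_union_right _ (mem_filter.2 ⟨ht, htV⟩)
        · exact mem_union_left _ (add_mem_add ht (mem_erase.2 ⟨hs0, hs⟩))
      · apply union_subset (add_subset_add_left (erase_subset _ _))
        intro t ht
        have := (mem_filter.1 ht).1
        simpa using add_mem_add this h0S
    have hdisj : Disjoint (T + S.erase 0) TR := by
      rw [disjoint_left]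
      intro x hx hxR
      have h := (mem_filter.1 hxR).2
      apply h
      rw [hV, ← image_mk_add, ← mem_add_iff_mk_mem_image Q Qf hQf, hTS']
      exact hx
    have hcTS : #(T + S) = #V * #Qf + #TR := by
      rw [hsplit, card_union_of_disjoint hdisj, card_eq_card_image_mul_of_add_eq Q Qf hQf hTS',
        image_mk_add]
    -- `|V| + |R| = |σT + σS| = |G/Q|`
    have hVR : #V + #R = Nat.card (G ⧸ Q) := by
      rw [add_comm, hR, card_sdiff_add_card, ← hU, hUfull]
    -- `|TR| ≥ |R|`
    have hRTR : #R ≤ #TR := by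
      have hsub : R ⊆ TR.image (fun x : G => (x : G ⧸ Q)) := by
        intro r hr
        rw [hR, mem_sdiff] at hr
        obtain ⟨t, ht, rfl⟩ := mem_image.1 hr.1
        exact mem_image.2 ⟨t, mem_filter.2 ⟨ht, hr.2⟩, rfl⟩
      exact (card_le_card hsub).trans card_image_le
    -- hence `|R| ≥ 2`
    have hR2 : 2 ≤ #R := by
      by_contra hlt
      have h3 : #Qf * #R ≤ #Qf * 1 := Nat.mul_le_mul_left _ (by omega)
      have h4 : #V * #Qf + #R * #Qf = Fintype.card G := by rw [← add_mul, hVR, mul_comm, hGQ]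
      have h5 : #(T + S) ≤ Fintype.card G - #Qf - 1 := by omega
      rw [mul_comm #R] at h4
      omega
    -- two classes `r₁ ≠ r₂` in `R`, each with `rᵢ − σ(S*) = (σT)ᶜ`
    obtain ⟨r₁, hr₁, r₂, hr₂, hne⟩ := one_lt_card.1 (by omega : 1 < #R)
    rw [hR, mem_sdiff] at hr₁ hr₂
    have hTc : Nat.card (G ⧸ Q) + 1 ≤ #(T.image fun x : G => (x : G ⧸ Q)) +
        #(S.image fun x : G => (x : G ⧸ Q)) := by rw [← hUfull]; exact h1
    have hcompl : ∀ r ∈ T.image (fun x : G => (x : G ⧸ Q)), r ∉ V →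
        ((S.erase 0).image fun x : G => (x : G ⧸ Q)).image (fun s => r - s) =
          (T.image fun x : G => (x : G ⧸ Q))ᶜ := by
      intro r hr hrV
      apply eq_of_subset_of_card_le
      · intro x hx
        rw [mem_compl]
        exact disjoint_left.1 (hdisjW r hr hrV) hx
      · rw [card_compl, hn]
        have := hWc r
        omega
    have heq : ((S.erase 0).image fun x : G => (x : G ⧸ Q)).image (fun s => r₁ - s) =
        ((S.erase 0).image fun x : G => (x : G ⧸ Q)).image (fun s => r₂ - s) := by
      rw [hcompl r₁ hr₁.1 hr₁.2, hcompl r₂ hr₂.1 hr₂.2]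
    -- so `(r₂ − r₁) + σ(S*) = σ(S*)`
    apply hstab (r₂ - r₁) (sub_ne_zero.2 hne.symm)
    rw [← image_erase_eq_erase_image Q hSQ]
    apply eq_of_subset_of_card_le _ (by rw [card_vadd_finset])
    intro x hx
    obtain ⟨s, hs, rfl⟩ := mem_vadd_finset.1 hx
    have : r₁ - s ∈ ((S.erase 0).image fun x : G => (x : G ⧸ Q)).image (fun s => r₂ - s) := by
      rw [← heq]; exact mem_image_of_mem _ hs
    obtain ⟨s', hs', he⟩ := mem_image.1 this
    have e : (r₂ - r₁) +ᵥ s = s' := by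
      rw [vadd_eq_add]
      calc r₂ - r₁ + s = r₂ - (r₁ - s) := by abel
        _ = r₂ - (r₂ - s') := by rw [he]
        _ = s' := by abel
    rw [e]; exact hs'
  · -- `|σT + σS| = |G/Q| − 1`: the missing class `c`
    have hUc : #(T.image (fun x : G => (x : G ⧸ Q)) + S.image (fun x : G => (x : G ⧸ Q))) + 1 =
        Nat.card (G ⧸ Q) := by omega
    obtain ⟨c, hc⟩ : ∃ c, c ∉ T.image (fun x : G => (x : G ⧸ Q)) + S.image (fun x : G => (x : G ⧸ Q)) := by
      by_contra hall
      push Not at hall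
      have : T.image (fun x : G => (x : G ⧸ Q)) + S.image (fun x : G => (x : G ⧸ Q)) = univ :=
        eq_univ_of_forall hall
      rw [this, card_univ, hn] at hUc
      omega
    -- `σT ⊔ (c − σS) = G/Q`
    have hdisjc : Disjoint ((S.image fun x : G => (x : G ⧸ Q)).image (fun s => c - s))
        (T.image fun x : G => (x : G ⧸ Q)) := by
      rw [disjoint_left]
      intro x hx hxT
      obtain ⟨s, hs, rfl⟩ := mem_image.1 hx
      exact hc (mem_add.2 ⟨c - s, hxT, s, hs, sub_add_cancel c s⟩)
    have hunion : (S.image fun x : G => (x : G ⧸ Q)).image (fun s => c - s) ∪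
        T.image (fun x : G => (x : G ⧸ Q)) = univ := by
      apply eq_univ_of_card
      apply le_antisymm (card_le_univ _)
      rw [card_union_of_disjoint hdisjc, card_image_of_injective _ sub_right_injective, hn]
      omega
    -- `y + σ(S*) ⊆ σS` with `y = c − t̄`
    set y : G ⧸ Q := c - tb with hy
    have hy0 : y ≠ 0 := by
      intro h
      rw [hy, sub_eq_zero] at h
      apply hc
      rw [h]
      exact mem_add.2 ⟨tb, htbT, 0, h0S', add_zero _⟩
    have hyS : y +ᵥ (S.image fun x : G => (x : G ⧸ Q)).erase 0 ⊆ S.image (fun x : G => (x : G ⧸ Q)) := by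
      intro x hx
      obtain ⟨s, hs, rfl⟩ := mem_vadd_finset.1 hx
      rw [← image_erase_eq_erase_image Q hSQ] at hs
      have h3 : tb - s ∈ (S.image fun x : G => (x : G ⧸ Q)).image (fun s => c - s) := by
        have hu : tb - s ∈ (S.image fun x : G => (x : G ⧸ Q)).image (fun s => c - s) ∪
            T.image (fun x : G => (x : G ⧸ Q)) := by rw [hunion]; exact mem_univ _
        rcases mem_union.1 hu with h | h
        · exact h
        · exact absurd h (disjoint_left.1 (hdisjW tb htbT htbV) (mem_image_of_mem _ hs))
      obtain ⟨s', hs', he⟩ := mem_image.1 h3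
      have e : y +ᵥ s = s' := by
        rw [vadd_eq_add, hy]
        calc c - tb + s = c - (tb - s) := by abel
          _ = c - (c - s') := by rw [he]
          _ = s' := by abel
      rw [e]; exact hs'
    have hAP := eq_apFinset_of_vadd_erase_subset (G := G ⧸ Q) h0S' hy0 hyS hstab hordσ
    have hSap : IsAP (S.image fun x : G => (x : G ⧸ Q)) (-y) := ⟨0, hAP⟩
    have hzm : AddSubgroup.zmultiples (-y) = ⊤ :=
      zmultiples_eq_top_of_zero_mem_subset_apFinset (G := G ⧸ Q) h0S' hgen' (subset_of_eq hAP)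
    have hTap := isAP_of_isAP_of_card_add_le (G := G ⧸ Q) hzm hSap hm2 ⟨0, h0T'⟩ h1
      (by rw [hn]; omega)
    exact ⟨-y, neg_ne_zero.2 hy0, hSap, hTap⟩

omit [Fintype G] in
/-- The sum of two progressions with the same difference is the progression of their first terms
with `m + k − 1` terms. [cite: Nathanson1996, §2.5 (proof of Thm 2.7, case (iii))] -/
theorem apFinset_add_apFinset (a b d : G) {m k : ℕ} (hm : 1 ≤ m) (hk : 1 ≤ k) :
    apFinset a d m + apFinset b d k = apFinset (a + b) d (m + k - 1) := by
  refine Subset.antisymm (apFinset_add_apFinset_subset a b d m k) ?_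
  intro x hx
  obtain ⟨l, hl, rfl⟩ := mem_apFinset.1 hx
  obtain ⟨i, j, hi, hj, hij⟩ : ∃ i j, i < m ∧ j < k ∧ i + j = l :=
    ⟨min l (m - 1), l - min l (m - 1), by omega, by omega, by omega⟩
  refine mem_add.2 ⟨a + i • d, mem_apFinset.2 ⟨i, hi, rfl⟩, b + j • d, mem_apFinset.2 ⟨j, hj, rfl⟩, ?_⟩
  rw [← hij, add_nsmul]; abel

/-- **[HamidouneSerraZemor2008, §3, Proposition 15 (ii), "Moreover"].**  "Moreover, at most one
member of the decomposition of `T` modulo `Q` is not a complete coset modulo `Q`."  Printed proof: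
"Since `σ(T)` contains at most a single element that is not expressible in `G/Q` in two different
ways as a sum of one element of `σ(S)` and one element of `σ(T)`, we deduce that at most one coset
modulo `Q` that intersects `T` is not included in `T`."  Here for any presentation
`σ(S) = {a, …, a + (m−1)d}`, `σ(T) = {b, …, b + (k−1)d}` of the two progressions (as delivered by
`subset_or_exists_isAP_image_of_card_add_le`): with `V = σ(T) + σ(S*)`, the classes of `σ(T)`
outside `V` form at most a singleton (`±d ∈ σ(S*)`), `T + S = (T + S*) ⊔ {t ∈ T : σ(t) ∉ V}` with
`T + S*` `Q`-periodic, `|σ(T) + σ(S)| = k + m − 1`, and `|T + S| ≤ |T| + |S| − 1` forces every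
trace of `T` over `σ(T) ∩ V` to be a full coset. [cite: HamidouneSerraZemor2008, §3, Proposition 15
(ii)] -/
theorem exists_forall_card_filter_eq_of_image_eq_apFinset [DecidableEq (G ⧸ Q)] (Qf : Finset G)
    (hQf : ∀ g, g ∈ Qf ↔ g ∈ Q) {S T : Finset G} (h0S : (0 : G) ∈ S)
    (hgen : AddSubgroup.closure (S : Set G) = ⊤)
    (hper : S.erase 0 + Qf = S.erase 0)
    (hTS : #(T + S) + 1 ≤ #T + #S) (hTSn : #T + #S + #Qf ≤ Fintype.card G)
    {a b d : G ⧸ Q} (hd : d ≠ 0)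
    (hS : S.image (fun x : G => (x : G ⧸ Q)) = apFinset a d #(S.image fun x : G => (x : G ⧸ Q)))
    (hT : T.image (fun x : G => (x : G ⧸ Q)) = apFinset b d #(T.image fun x : G => (x : G ⧸ Q))) :
    ∃ c : G ⧸ Q, ∀ c' ∈ T.image (fun x : G => (x : G ⧸ Q)), c' ≠ c →
      #(T.filter fun x : G => (x : G ⧸ Q) = c') = #Qf := by
  classical
  rcases T.eq_empty_or_nonempty with rfl | hTne
  · exact ⟨0, fun c' hc' => by simp at hc'⟩
  have hSQ : ∀ s ∈ S, s ∈ Q → s = 0 := fun s hs hsQ =>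
    eq_zero_of_mem_of_erase_add_eq Q Qf hQf hper hs hsQ
  have h0S' : (0 : G ⧸ Q) ∈ S.image (fun x : G => (x : G ⧸ Q)) :=
    mem_image.2 ⟨0, h0S, QuotientAddGroup.mk_zero Q⟩
  have hq1 : 1 ≤ #Qf := card_pos.2 ⟨0, (hQf 0).2 Q.zero_mem⟩
  have hGQ := card_mul_natCard_quotient Q Qf hQf
  have hn : Fintype.card (G ⧸ Q) = Nat.card (G ⧸ Q) := Nat.card_eq_fintype_card.symm
  have hgen' := closure_image_mk_eq_top Q hgen
  have hS'c : #((S.erase 0).image fun x : G => (x : G ⧸ Q)) + 1 = #(S.image fun x : G => (x : G ⧸ Q)) := by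
    rw [image_erase_eq_erase_image Q hSQ, card_erase_add_one h0S']
  set m := #(S.image fun x : G => (x : G ⧸ Q)) with hm
  set k := #(T.image fun x : G => (x : G ⧸ Q)) with hk
  have hm1 : 1 ≤ m := card_pos.2 ⟨0, h0S'⟩
  have hk1 : 1 ≤ k := card_pos.2 (hTne.image _)
  have hTpos : 0 < #T := card_pos.2 hTne
  -- `|σS| ≥ 2`
  have hm2 : 2 ≤ m := by
    by_contra hlt
    have hm1' : m = 1 := by omega
    have hS0 : S.image (fun x : G => (x : G ⧸ Q)) = {0} := by
      rw [hS, hm1', apFinset_one]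
      obtain ⟨i, hi, hia⟩ := mem_apFinset.1 (hS ▸ h0S' : (0 : G ⧸ Q) ∈ apFinset a d m)
      have : i = 0 := by omega
      subst this
      rw [zero_nsmul, add_zero] at hia
      rw [hia]
    have htop : (⊤ : AddSubgroup (G ⧸ Q)) = ⊥ := by
      rw [← hgen', hS0, coe_singleton, AddSubgroup.closure_singleton_zero]
    have hn1 : Nat.card (G ⧸ Q) = 1 := by
      rw [← AddSubgroup.card_top (G := G ⧸ Q), htop, AddSubgroup.card_bot]
    rw [hn1, mul_one] at hGQ
    omega
  -- `o(d) = |G/Q|`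
  have hzd : AddSubgroup.zmultiples d = ⊤ :=
    zmultiples_eq_top_of_zero_mem_subset_apFinset (G := G ⧸ Q) h0S' hgen' (subset_of_eq hS)
  have hod : addOrderOf d = Nat.card (G ⧸ Q) := by
    rw [addOrderOf_eq_card_of_zmultiples_eq_top hzd, Nat.card_eq_fintype_card]
  set V := T.image (fun x : G => (x : G ⧸ Q)) + (S.erase 0).image (fun x : G => (x : G ⧸ Q)) with hV
  set R := T.image (fun x : G => (x : G ⧸ Q)) \ V with hR
  have hU := image_add_image_eq_union Q (T := T) h0S
  have hUcard : #(T.image (fun x : G => (x : G ⧸ Q)) + S.image (fun x : G => (x : G ⧸ Q))) = #R + #V := by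
    rw [hU, hR, card_sdiff_add_card]
  -- `|V| + 2 ≤ |G/Q|`
  have hTS' : T + S.erase 0 + Qf = T + S.erase 0 := by rw [add_assoc, hper]
  have h2 : #V + 2 ≤ Nat.card (G ⧸ Q) := by
    have e1 : #(T + S.erase 0) = #V * #Qf := by
      rw [card_eq_card_image_mul_of_add_eq Q Qf hQf hTS', image_mk_add]
    have e2 : #(T + S.erase 0) ≤ #(T + S) := card_le_card (add_subset_add_left (erase_subset _ _))
    by_contra hlt
    push Not at hlt
    have h3 : Nat.card (G ⧸ Q) * #Qf ≤ (#V + 1) * #Qf := Nat.mul_le_mul_right _ (by omega)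
    rw [add_mul, one_mul, ← e1, mul_comm, hGQ] at h3
    omega
  -- `|R| ≤ 1`: only an end of `σ(T)` can fail to lie in `V`, as `d` or `−d` lies in `σ(S*)`
  obtain ⟨j₀, hj₀, hja⟩ : ∃ j, j < m ∧ a + j • d = 0 := by
    have h := h0S'
    rw [hS, mem_apFinset] at h
    exact h
  have hR1 : #R ≤ 1 := by
    rw [card_le_one]
    intro x hx y hy
    rw [hR, mem_sdiff] at hx hy
    have hxT := hx.1
    have hyT := hy.1
    rw [hT] at hxT hyT
    obtain ⟨i, hi, rfl⟩ := mem_apFinset.1 hxT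
    obtain ⟨i', hi', rfl⟩ := mem_apFinset.1 hyT
    by_cases hjm : j₀ + 1 < m
    · have hdS : d ∈ (S.erase 0).image (fun x : G => (x : G ⧸ Q)) := by
        rw [image_erase_eq_erase_image Q hSQ, mem_erase, hS]
        exact ⟨hd, mem_apFinset.2 ⟨j₀ + 1, hjm, by rw [succ_nsmul, ← add_assoc, hja, zero_add]⟩⟩
      have hfirst : ∀ i, i < k → b + i • d ∉ V → i = 0 := by
        intro i hi hiV
        by_contra hi0
        apply hiV
        refine mem_add.2 ⟨b + (i - 1) • d, ?_, d, hdS, ?_⟩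
        · rw [hT]; exact mem_apFinset.2 ⟨i - 1, by omega, rfl⟩
        · have e : i • d = (i - 1) • d + d := by rw [← succ_nsmul]; congr 1; omega
          rw [e, add_assoc]
      rw [hfirst i hi hx.2, hfirst i' hi' hy.2]
    · have hndS : -d ∈ (S.erase 0).image (fun x : G => (x : G ⧸ Q)) := by
        rw [image_erase_eq_erase_image Q hSQ, mem_erase, hS]
        refine ⟨neg_ne_zero.2 hd, mem_apFinset.2 ⟨j₀ - 1, by omega, ?_⟩⟩
        have e : j₀ = (j₀ - 1) + 1 := by omega
        rw [e, add_nsmul, one_nsmul, ← add_assoc] at hja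
        exact eq_neg_of_add_eq_zero_left hja
      have hlast : ∀ i, i < k → b + i • d ∉ V → i = k - 1 := by
        intro i hi hiV
        by_contra hik
        apply hiV
        refine mem_add.2 ⟨b + (i + 1) • d, ?_, -d, hndS, ?_⟩
        · rw [hT]; exact mem_apFinset.2 ⟨i + 1, by omega, rfl⟩
        · rw [succ_nsmul, ← add_assoc, add_neg_cancel_right]
      rw [hlast i hi hx.2, hlast i' hi' hy.2]
  -- `|σT + σS| = k + m − 1`
  have hsum := apFinset_add_apFinset b a d hk1 hm1
  have hUcard2 : #(T.image (fun x : G => (x : G ⧸ Q)) + S.image (fun x : G => (x : G ⧸ Q))) = k + m - 1 := by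
    rw [hT, hS, hsum]
    by_contra hne
    have hlt : Nat.card (G ⧸ Q) < k + m - 1 := by
      by_contra hge
      push Not at hge
      exact hne (card_apFinset_of_le_addOrderOf _ _ (by rw [hod]; exact hge))
    have h3 := card_le_card (apFinset_mono (b + a) d hlt.le)
    rw [card_apFinset_of_le_addOrderOf _ _ (by rw [hod]), ← hsum, ← hT, ← hS, hUcard] at h3
    omega
  -- decomposition `T + S = (T + S*) ⊔ TR`
  set TR := T.filter (fun t : G => (t : G ⧸ Q) ∉ V) with hTR
  set Tin := T.filter (fun t : G => (t : G ⧸ Q) ∈ V) with hTin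
  have hsplit : T + S = (T + S.erase 0) ∪ TR := by
    apply Subset.antisymm
    · intro x hx
      obtain ⟨t, ht, s, hs, rfl⟩ := mem_add.1 hx
      by_cases hs0 : s = 0
      · subst hs0
        rw [add_zero]
        by_cases htV : ((t : G) : G ⧸ Q) ∈ V
        · apply mem_union_left
          rw [← hTS', mem_add_iff_mk_mem_image Q Qf hQf, image_mk_add]
          exact htV
        · exact mem_union_right _ (mem_filter.2 ⟨ht, htV⟩)
      · exact mem_union_left _ (add_mem_add ht (mem_erase.2 ⟨hs0, hs⟩))
    · apply union_subset (add_subset_add_left (erase_subset _ _))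
      intro t ht
      have := (mem_filter.1 ht).1
      simpa using add_mem_add this h0S
  have hdisj : Disjoint (T + S.erase 0) TR := by
    rw [disjoint_left]
    intro x hx hxR
    have h := (mem_filter.1 hxR).2
    apply h
    rw [hV, ← image_mk_add, ← mem_add_iff_mk_mem_image Q Qf hQf, hTS']
    exact hx
  have hcTS : #(T + S) = #V * #Qf + #TR := by
    rw [hsplit, card_union_of_disjoint hdisj, card_eq_card_image_mul_of_add_eq Q Qf hQf hTS',
      image_mk_add]
  have hTsplit : #Tin + #TR = #T := card_filter_add_card_filter_not _
  have hS1 : #S = #((S.erase 0).image fun x : G => (x : G ⧸ Q)) * #Qf + 1 := by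
    rw [← card_erase_add_one h0S, card_eq_card_image_mul_of_add_eq Q Qf hQf hper]
  -- traces of `Tin`
  have hTin_img : Tin.image (fun x : G => (x : G ⧸ Q)) = T.image (fun x : G => (x : G ⧸ Q)) ∩ V := by
    ext c
    simp only [mem_image, mem_inter, hTin, mem_filter]
    constructor
    · rintro ⟨t, ⟨ht, htV⟩, rfl⟩; exact ⟨⟨t, ht, rfl⟩, htV⟩
    · rintro ⟨⟨t, ht, rfl⟩, hcV⟩; exact ⟨t, ⟨ht, hcV⟩, rfl⟩
  have hTin_sum := card_eq_sum_card_filter_mk Q Tin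
  have hfib : ∀ c ∈ V, Tin.filter (fun x : G => (x : G ⧸ Q) = c) = T.filter (fun x : G => (x : G ⧸ Q) = c) := by
    intro c hc
    ext t
    simp only [hTin, mem_filter]
    constructor
    · rintro ⟨⟨ht, -⟩, htc⟩; exact ⟨ht, htc⟩
    · rintro ⟨ht, htc⟩; exact ⟨⟨ht, by rw [htc]; exact hc⟩, htc⟩
  have hkRV : #(T.image (fun x : G => (x : G ⧸ Q)) ∩ V) + #R = k := by
    rw [hR, card_inter_add_card_sdiff]
  -- the exceptional class
  obtain ⟨c₀, hc₀⟩ := card_le_one_iff_subset_singleton.1 hR1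
  refine ⟨c₀, fun c' hc' hne => ?_⟩
  have hc'V : c' ∈ V := by
    by_contra h
    exact hne (mem_singleton.1 (hc₀ (by rw [hR, mem_sdiff]; exact ⟨hc', h⟩)))
  by_contra hlt'
  have hlt : #(T.filter fun x : G => (x : G ⧸ Q) = c') < #Qf :=
    lt_of_le_of_ne (card_filter_mk_le Q Qf hQf T c') hlt'
  have hsumlt : #Tin < #(T.image (fun x : G => (x : G ⧸ Q)) ∩ V) * #Qf := by
    rw [hTin_sum, hTin_img]
    calc ∑ c ∈ T.image (fun x : G => (x : G ⧸ Q)) ∩ V, #(Tin.filter fun x : G => (x : G ⧸ Q) = c)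
        < ∑ c ∈ T.image (fun x : G => (x : G ⧸ Q)) ∩ V, #Qf :=
          sum_lt_sum (fun c _ => card_filter_mk_le Q Qf hQf Tin c)
            ⟨c', mem_inter.2 ⟨hc', hc'V⟩, by rw [hfib c' hc'V]; exact hlt⟩
      _ = #(T.image (fun x : G => (x : G ⧸ Q)) ∩ V) * #Qf := by rw [sum_const, smul_eq_mul]
  have hVeq : #V = #(T.image (fun x : G => (x : G ⧸ Q)) ∩ V) + #((S.erase 0).image fun x : G => (x : G ⧸ Q)) := by
    omega
  have hVmul : #V * #Qf = #(T.image (fun x : G => (x : G ⧸ Q)) ∩ V) * #Qf +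
      #((S.erase 0).image fun x : G => (x : G ⧸ Q)) * #Qf := by rw [hVeq, add_mul]
  omega

end PropositionFifteen

/-! ### Corollary 16: `S` generating a proper subgroup `H` -/

section Restrict

variable (K : AddSubgroup G) [DecidablePred (· ∈ K)]

omit [Fintype G] [DecidableEq G] in
/-- Membership in the restriction `X ∩ K` seen inside `↥K`. [folklore] -/
private theorem mem_subtype_iff' {X : Finset G} {x : ↥K} : x ∈ X.subtype (· ∈ K) ↔ (x : G) ∈ X :=
  mem_subtype

omit [Fintype G] [DecidableEq G] in
/-- For `X ⊆ K` the restriction has `|X|` elements. [folklore] -/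
private theorem card_subtype_of_forall_mem {X : Finset G} (hX : ∀ x ∈ X, x ∈ K) :
    #(X.subtype (· ∈ K)) = #X := by
  rw [card_subtype, filter_true_of_mem hX]

omit [Fintype G] in
/-- Restriction commutes with sums (for subsets of `K`). [folklore] -/
private theorem subtype_add {X Y : Finset G} (hX : ∀ x ∈ X, x ∈ K) (hY : ∀ y ∈ Y, y ∈ K) :
    (X + Y).subtype (· ∈ K) = X.subtype (· ∈ K) + Y.subtype (· ∈ K) := by
  ext z
  rw [mem_subtype, mem_add, mem_add]
  constructor
  · rintro ⟨x, hx, y, hy, hxy⟩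
    refine ⟨⟨x, hX x hx⟩, mem_subtype.2 hx, ⟨y, hY y hy⟩, mem_subtype.2 hy, ?_⟩
    apply Subtype.ext
    rw [AddMemClass.coe_add]
    exact hxy
  · rintro ⟨x, hx, y, hy, rfl⟩
    exact ⟨x, mem_subtype.1 hx, y, mem_subtype.1 hy, by rw [AddMemClass.coe_add]⟩

omit [Fintype G] in
/-- Restriction commutes with translation by an element of `K`. [folklore] -/
private theorem subtype_vadd {X : Finset G} (g : ↥K) :
    (((g : G) +ᵥ X).subtype (· ∈ K)) = g +ᵥ X.subtype (· ∈ K) := by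
  ext z
  rw [mem_subtype, mem_vadd_finset, mem_vadd_finset]
  constructor
  · rintro ⟨x, hx, hxz⟩
    rw [vadd_eq_add] at hxz
    have hxK : x ∈ K := by
      have : x = -(g : G) + z := by rw [← hxz, neg_add_cancel_left]
      rw [this]; exact K.add_mem (K.neg_mem g.2) z.2
    refine ⟨⟨x, hxK⟩, mem_subtype.2 hx, Subtype.ext ?_⟩
    rw [vadd_eq_add, AddMemClass.coe_add]
    exact hxz
  · rintro ⟨x, hx, rfl⟩
    exact ⟨x, mem_subtype.1 hx, by rw [vadd_eq_add, vadd_eq_add, AddMemClass.coe_add]⟩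

omit [Fintype G] in
/-- Restriction commutes with removing `0`. [folklore] -/
private theorem subtype_erase_zero (X : Finset G) :
    (X.erase 0).subtype (· ∈ K) = (X.subtype (· ∈ K)).erase 0 := by
  ext z
  simp only [mem_subtype, mem_erase, ne_eq, ZeroMemClass.coe_eq_zero]

omit [Fintype G] [DecidableEq G] in
/-- Restriction is injective on subsets of `K`. [folklore] -/
private theorem subset_of_subtype_subset {X Y : Finset G} (hX : ∀ x ∈ X, x ∈ K)
    (h : X.subtype (· ∈ K) ⊆ Y.subtype (· ∈ K)) : X ⊆ Y := by
  intro x hx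
  have hx' : (⟨x, hX x hx⟩ : ↥K) ∈ X.subtype (· ∈ K) := mem_subtype.2 hx
  exact mem_subtype.1 (h hx')

omit [Fintype G] [DecidableEq G] in
/-- `S` generates `⊤` inside `K = ⟨S⟩`. [folklore] -/
private theorem closure_subtype_eq_top {S : Finset G} (hSK : AddSubgroup.closure (S : Set G) = K) :
    AddSubgroup.closure ((S.subtype (· ∈ K) : Finset ↥K) : Set ↥K) = ⊤ := by
  subst hSK
  have : ((S.subtype (· ∈ AddSubgroup.closure (S : Set G)) : Finset _) : Set _) =
      ((↑) : ↥(AddSubgroup.closure (S : Set G)) → G) ⁻¹' (S : Set G) := by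
    ext x; simp [mem_subtype]
  rw [this]
  exact AddSubgroup.closure_closure_coe_preimage

end Restrict

/-- **Corollary 8 inside the subgroup generated by `S`:** if `0 ∈ S`, `⟨S⟩ = H`, every element
of `S ∖ {0}` has order `≥ |S| − 1`, and `X ≠ ∅` lies in one coset of `H`, then
`|X + S| ≥ min(|H|, |X| + |S| − 1)` (Corollary 8 for the group `H` and a translate of `X`).
[cite: HamidouneSerraZemor2008, §2, Corollary 8] -/
theorem min_le_card_add_of_subset_vadd (H : AddSubgroup G) (Hf : Finset G)
    (hHf : ∀ g, g ∈ Hf ↔ g ∈ H) {S : Finset G} (h0 : (0 : G) ∈ S)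
    (hSH : AddSubgroup.closure (S : Set G) = H)
    (hord : ∀ s ∈ S, s ≠ 0 → #S - 1 ≤ addOrderOf s) {X : Finset G} (hX : X.Nonempty) {x₀ : G}
    (hXx : X ⊆ x₀ +ᵥ Hf) : min #Hf (#X + #S - 1) ≤ #(X + S) := by
  classical
  have hSK : ∀ s ∈ S, s ∈ H := fun s hs => by
    rw [← hSH]; exact AddSubgroup.subset_closure (mem_coe.2 hs)
  set X₀ := -x₀ +ᵥ X with hX₀
  have hX₀K : ∀ x ∈ X₀, x ∈ H := by
    intro x hx
    obtain ⟨y, hy, rfl⟩ := mem_vadd_finset.1 hx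
    obtain ⟨h, hh, rfl⟩ := mem_vadd_finset.1 (hXx hy)
    rw [vadd_eq_add, vadd_eq_add, neg_add_cancel_left]
    exact (hHf h).1 hh
  have hcardK : Fintype.card ↥H = #Hf := by
    rw [← Nat.card_eq_fintype_card]; exact natCard_eq_card_of_mem_iff H Hf hHf
  -- Corollary 8 in `↥H`
  have h0' : (0 : ↥H) ∈ S.subtype (· ∈ H) := mem_subtype.2 h0
  have hord' : ∀ s ∈ S.subtype (· ∈ H), s ≠ 0 → #(S.subtype (· ∈ H)) - 1 ≤ addOrderOf s := by
    intro s hs hs0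
    rw [card_subtype_of_forall_mem H hSK, ← AddSubgroup.addOrderOf_coe s]
    exact hord _ (mem_subtype.1 hs) (fun h => hs0 (ZeroMemClass.coe_eq_zero.1 h))
  have hXne' : (X₀.subtype (· ∈ H)).Nonempty := by
    obtain ⟨x, hx⟩ := hX
    have hx' : -x₀ + x ∈ X₀ := mem_vadd_finset.2 ⟨x, hx, rfl⟩
    exact ⟨⟨-x₀ + x, hX₀K _ hx'⟩, mem_subtype.2 hx'⟩
  have hκ := min_le_card_add_of_forall_le_addOrderOf (G := ↥H) h0' (closure_subtype_eq_top H hSH)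
    hord' hXne'
  rw [hcardK, card_subtype_of_forall_mem H hX₀K, card_subtype_of_forall_mem H hSK,
    ← subtype_add H hX₀K hSK,
    card_subtype_of_forall_mem H (fun z hz => by
      obtain ⟨x, hx, s, hs, rfl⟩ := mem_add.1 hz; exact H.add_mem (hX₀K x hx) (hSK s hs)),
    hX₀, card_vadd_finset, ← singleton_add, add_assoc, singleton_add, card_vadd_finset] at hκ
  exact hκ

/-- **[HamidouneSerraZemor2008, §3, Corollary 16].**  "Let `0 ∈ S` and `T` be non-empty subsets of
a finite abelian group `G`.  Suppose that `|S + T| ≤ |S| + |T| − 1 < |H + T| − |Q|`, where `Q`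
denotes the stabilizer of `S ∖ {0}` and `H` is the subgroup of `G` generated by `S`.  Also assume
that every element of `S ∖ {0}` has order at least `|S|`.  Let `T₁ ∪ T₂ ∪ ⋯ ∪ T_j` be a decomposition
of `T` modulo `H` such that `|T₁ + S| ≤ |T₂ + S| ≤ ⋯ ≤ |T_j + S|`.  Then `|T_i| = |H|` for all
`i ≥ 2`.  Moreover one of the following conditions holds: (i) `T₁ − T₁ ⊂ Q`.  (ii) `σ(S)` and
`σ(T₁)` are arithmetic progressions with the same difference, where `σ : G → G/Q` denotes the
canonical projection."  Rendering: `H`, `Q` with their finsets `Hf`, `Qf`; `Q` as the stabilizer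
(`S* + Q = S*`, `g + S* = S* ⇒ g ∈ Q`); "`|S| + |T| − 1 < |H + T| − |Q|`" is
`|S| + |T| + |Q| ≤ |H + T|`; the conclusion names the exceptional `H`-coset `c₁` of `T` (every other
trace of `T` modulo `H` is a full coset — it is the trace with the least `|T_i + S|`, the others
having `|T_i + S| = |H|`) and gives (i) or (ii) for `T₁ = T ∩ σ_H⁻¹(c₁)`.  Proof as printed:
`κ₁(S) = |S| − 1` inside `H` (`min_le_card_add_of_subset_vadd`) and the displayed count make all
traces but one full; then "`|S + T₁| ≤ |S| + |T₁| − 1 < |H| − |Q|`" and Proposition 15 — applied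
inside the group `H` (`subset_or_exists_isAP_image_of_card_add_le` for `↥H`, transported back
along `H/Q ↪ G/Q`) to `S` and the translate of `T₁` through `0` ("if `0 ∉ T₁` then the same argument
gives `T₁ − T₁ ⊂ Q`"). [cite: HamidouneSerraZemor2008, §3, Corollary 16] -/
theorem exists_traces_eq_and_isAP_of_card_add_le (H : AddSubgroup G) [DecidableEq (G ⧸ H)]
    (Hf : Finset G) (hHf : ∀ g, g ∈ Hf ↔ g ∈ H) (Q : AddSubgroup G) [DecidableEq (G ⧸ Q)]
    (Qf : Finset G) (hQf : ∀ g, g ∈ Qf ↔ g ∈ Q) {S T : Finset G} (h0S : (0 : G) ∈ S)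
    (hSH : AddSubgroup.closure (S : Set G) = H)
    (hper : S.erase 0 + Qf = S.erase 0) (hQstab : ∀ g : G, g +ᵥ S.erase 0 = S.erase 0 → g ∈ Q)
    (hST : #(S + T) + 1 ≤ #S + #T) (hSTn : #S + #T + #Qf ≤ #(Hf + T))
    (hord : ∀ s ∈ S, s ≠ 0 → #S ≤ addOrderOf s) :
    ∃ c₁ ∈ T.image (fun x : G => (x : G ⧸ H)),
      (∀ c ∈ T.image (fun x : G => (x : G ⧸ H)), c ≠ c₁ →
        #(T.filter fun x : G => (x : G ⧸ H) = c) = #Hf) ∧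
      ((T.filter (fun x : G => (x : G ⧸ H) = c₁) - T.filter (fun x : G => (x : G ⧸ H) = c₁) ⊆ Qf) ∨
        ∃ d : G ⧸ Q, d ≠ 0 ∧ IsAP (S.image fun x : G => (x : G ⧸ Q)) d ∧
          IsAP ((T.filter fun x : G => (x : G ⧸ H) = c₁).image fun x : G => (x : G ⧸ Q)) d) := by
  classical
  -- preliminaries
  have hSK : ∀ s ∈ S, s ∈ H := fun s hs => by
    rw [← hSH]; exact AddSubgroup.subset_closure (mem_coe.2 hs)
  have hSK' : (S : Set G) ⊆ H := fun s hs => hSK s (mem_coe.1 hs)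
  have hq1 : 1 ≤ #Qf := card_pos.2 ⟨0, (hQf 0).2 Q.zero_mem⟩
  have hh1 : 1 ≤ #Hf := card_pos.2 ⟨0, (hHf 0).2 H.zero_mem⟩
  have hord' : ∀ s ∈ S, s ≠ 0 → #S - 1 ≤ addOrderOf s := fun s hs hs0 => by
    have := hord s hs hs0; omega
  -- `|S| ≥ 2` (else `Q = G` and the hypothesis fails) and `T ≠ ∅`
  have hHT : #(Hf + T) = #(T.image fun x : G => (x : G ⧸ H)) * #Hf := by
    rw [add_comm]; exact card_add_eq_card_image_mul H Hf hHf T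
  have hTne : T.Nonempty := by
    rw [← card_pos]
    by_contra h
    have hT0 : T = ∅ := card_eq_zero.1 (by omega)
    rw [hT0, add_empty, card_empty] at hSTn
    omega
  have hS2 : 2 ≤ #S := by
    by_contra hlt
    have hS1 : S = {0} := by
      apply eq_singleton_iff_unique_mem.2 ⟨h0S, fun x hx => ?_⟩
      by_contra hx0
      have : 1 < #S := one_lt_card.2 ⟨x, hx, 0, h0S, hx0⟩
      omega
    have hQtop : ∀ g : G, g ∈ Q := fun g => hQstab g (by rw [hS1]; simp)
    have hQf' : Qf = univ := eq_univ_of_forall fun g => (hQf g).2 (hQtop g)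
    have := card_le_univ (Hf + T)
    rw [hQf', card_univ] at hSTn
    omega
  -- traces modulo `H` and the printed count
  have hTS : #(T + S) + 1 ≤ #T + #S := by rw [add_comm T S, add_comm #T]; exact hST
  set C := T.image (fun x : G => (x : G ⧸ H)) with hC
  have hsumTS : #(T + S) = ∑ c ∈ C, #(T.filter (fun x : G => (x : G ⧸ H) = c) + S) :=
    card_add_eq_sum_card_filter_add H T S hSK'
  have hsumT : #T = ∑ c ∈ C, #(T.filter fun x : G => (x : G ⧸ H) = c) :=
    card_eq_sum_card_fiberwise fun x hx => mem_coe.2 (mem_image_of_mem _ (mem_coe.1 hx))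
  have hκ : ∀ c ∈ C, min #Hf (#(T.filter fun x : G => (x : G ⧸ H) = c) + #S - 1) ≤
      #(T.filter (fun x : G => (x : G ⧸ H) = c) + S) := by
    intro c hc
    obtain ⟨t, ht, rfl⟩ := mem_image.1 hc
    exact min_le_card_add_of_subset_vadd H Hf hHf h0S hSH hord'
      ⟨t, mem_filter.2 ⟨ht, rfl⟩⟩ (filter_mk_subset_vadd H Hf hHf T rfl)
  have hle : ∀ c ∈ C, #(T.filter (fun x : G => (x : G ⧸ H) = c) + S) ≤ #Hf := by
    intro c hc
    obtain ⟨t, ht, rfl⟩ := mem_image.1 hc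
    have hsub : T.filter (fun x : G => (x : G ⧸ H) = (t : G ⧸ H)) + S ⊆ t +ᵥ Hf := by
      intro z hz
      obtain ⟨x, hx, s, hs, rfl⟩ := mem_add.1 hz
      obtain ⟨h, hh, rfl⟩ := mem_vadd_finset.1 (filter_mk_subset_vadd H Hf hHf T rfl hx)
      refine mem_vadd_finset.2 ⟨h + s, (hHf _).2 (H.add_mem ((hHf h).1 hh) (hSK s hs)), ?_⟩
      rw [vadd_eq_add, vadd_eq_add, add_assoc]
    have := card_le_card hsub
    rwa [card_vadd_finset] at this
  have hge : ∀ c ∈ C, #(T.filter fun x : G => (x : G ⧸ H) = c) ≤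
      #(T.filter (fun x : G => (x : G ⧸ H) = c) + S) :=
    fun c _ => card_le_card_add_right ⟨0, h0S⟩
  have hfle : ∀ c ∈ C, #(T.filter fun x : G => (x : G ⧸ H) = c) ≤ #Hf :=
    fun c hc => card_filter_mk_le H Hf hHf T c
  -- some trace has `|T_c + S| < |H|`
  obtain ⟨c₁, hc₁, hc₁lt⟩ : ∃ c₁ ∈ C, #(T.filter (fun x : G => (x : G ⧸ H) = c₁) + S) < #Hf := by
    by_contra hall
    push Not at hall
    have : #(T + S) = #C * #Hf := by
      rw [hsumTS, ← smul_eq_mul, ← sum_const]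
      exact sum_congr rfl fun c hc => le_antisymm (hle c hc) (hall c hc)
    omega
  have hκ₁ : #(T.filter fun x : G => (x : G ⧸ H) = c₁) + #S - 1 ≤
      #(T.filter (fun x : G => (x : G ⧸ H) = c₁) + S) := by
    rcases min_le_iff.1 (hκ c₁ hc₁) with h | h
    · omega
    · exact h
  have hsplitTS := sum_erase_add C (fun c => #(T.filter (fun x : G => (x : G ⧸ H) = c) + S)) hc₁
  have hsplitT := sum_erase_add C (fun c => #(T.filter fun x : G => (x : G ⧸ H) = c)) hc₁
  have hsum_ge : ∑ c ∈ C.erase c₁, #(T.filter fun x : G => (x : G ⧸ H) = c) ≤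
      ∑ c ∈ C.erase c₁, #(T.filter (fun x : G => (x : G ⧸ H) = c) + S) :=
    sum_le_sum fun c hc => hge c (mem_of_mem_erase hc)
  -- all traces but the one over `c₁` are full
  have hfull : ∀ c ∈ C, c ≠ c₁ → #(T.filter fun x : G => (x : G ⧸ H) = c) = #Hf := by
    intro c hc hcc
    have heq : ∑ c ∈ C.erase c₁, #(T.filter (fun x : G => (x : G ⧸ H) = c) + S) =
        ∑ c ∈ C.erase c₁, #(T.filter fun x : G => (x : G ⧸ H) = c) := by omega
    have hterm : ∀ c ∈ C.erase c₁, #(T.filter (fun x : G => (x : G ⧸ H) = c) + S) =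
        #(T.filter fun x : G => (x : G ⧸ H) = c) := by
      by_contra hne
      push Not at hne
      obtain ⟨c', hc', hne'⟩ := hne
      have hlt : ∑ c ∈ C.erase c₁, #(T.filter fun x : G => (x : G ⧸ H) = c) <
          ∑ c ∈ C.erase c₁, #(T.filter (fun x : G => (x : G ⧸ H) = c) + S) :=
        sum_lt_sum (fun c hc => hge c (mem_of_mem_erase hc))
          ⟨c', hc', lt_of_le_of_ne (hge c' (mem_of_mem_erase hc')) (Ne.symm hne')⟩
      omega
    have hcC : c ∈ C.erase c₁ := mem_erase.2 ⟨hcc, hc⟩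
    have h1 := hterm c hcC
    have h2 := hκ c hc
    rw [h1] at h2
    rcases min_le_iff.1 h2 with h | h
    · exact le_antisymm (hfle c hc) h
    · omega
  refine ⟨c₁, hc₁, hfull, ?_⟩
  · -- Proposition 15 inside `H`, for `S` and the translate of `T₁` through `0`
    have hsum_eq : ∑ c ∈ C.erase c₁, #(T.filter fun x : G => (x : G ⧸ H) = c) = (#C - 1) * #Hf := by
      rw [sum_congr rfl (fun c hc => hfull c (mem_of_mem_erase hc) (ne_of_mem_erase hc)), sum_const,
        smul_eq_mul, card_erase_of_mem hc₁]
    have hT₁S : #(T.filter (fun x : G => (x : G ⧸ H) = c₁) + S) + 1 ≤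
        #S + #(T.filter fun x : G => (x : G ⧸ H) = c₁) := by omega
    have hT₁n : #S + #(T.filter fun x : G => (x : G ⧸ H) = c₁) + #Qf ≤ #Hf := by
      have hC1 : 1 ≤ #C := card_pos.2 ⟨c₁, hc₁⟩
      have e : #C * #Hf = (#C - 1) * #Hf + #Hf := by
        rw [← Nat.sub_add_cancel hC1, add_mul, one_mul, Nat.add_sub_cancel]
      rw [hHT, e] at hSTn
      omega
    set T₁ := T.filter (fun x : G => (x : G ⧸ H) = c₁) with hT₁
    -- translate `T₁` through `0`
    obtain ⟨t₁, ht₁⟩ : T₁.Nonempty := by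
      obtain ⟨t, ht, htc⟩ := mem_image.1 hc₁
      exact ⟨t, mem_filter.2 ⟨ht, htc⟩⟩
    set T₀ := -t₁ +ᵥ T₁ with hT₀
    have hT₀K : ∀ x ∈ T₀, x ∈ H := by
      intro x hx
      obtain ⟨t, ht, rfl⟩ := mem_vadd_finset.1 hx
      have h1 := (mem_filter.1 ht).2
      have h2 := (mem_filter.1 ht₁).2
      rw [vadd_eq_add]
      exact QuotientAddGroup.eq.1 (h2.trans h1.symm)
    have h0T₀ : (0 : G) ∈ T₀ := mem_vadd_finset.2 ⟨t₁, ht₁, by rw [vadd_eq_add, neg_add_cancel]⟩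
    have hT₀c : #T₀ = #T₁ := card_vadd_finset _ _
    have hT₀S : #(T₀ + S) = #(T₁ + S) := by
      rw [hT₀, ← singleton_add, add_assoc, singleton_add, card_vadd_finset]
    -- `Q ≤ H`
    obtain ⟨s₁, hs₁, hs₁0⟩ : ∃ s ∈ S, s ≠ 0 := by
      obtain ⟨x, hx, y, hy, hxy⟩ := one_lt_card.1 (by omega : 1 < #S)
      by_cases hx0 : x = 0
      · exact ⟨y, hy, fun h => hxy (hx0.trans h.symm)⟩
      · exact ⟨x, hx, hx0⟩
    have hQK : ∀ g ∈ Qf, g ∈ H := by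
      intro g hg
      have h1 : s₁ + g ∈ S.erase 0 := by
        rw [← hper]; exact add_mem_add (mem_erase.2 ⟨hs₁0, hs₁⟩) hg
      have h2 := hSK _ (mem_of_mem_erase h1)
      have := H.sub_mem h2 (hSK s₁ hs₁)
      rwa [add_sub_cancel_left] at this
    -- the data inside `↥H`
    set Q' : AddSubgroup ↥H := Q.addSubgroupOf H with hQ'
    set Sr := S.subtype (· ∈ H) with hSr
    set Tr := T₀.subtype (· ∈ H) with hTr
    set Qr := Qf.subtype (· ∈ H) with hQr
    have hQr : ∀ g : ↥H, g ∈ Qr ↔ g ∈ Q' := fun g => by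
      rw [hQr, mem_subtype, hQf, hQ', AddSubgroup.mem_addSubgroupOf]
    have h0Sr : (0 : ↥H) ∈ Sr := mem_subtype.2 h0S
    have h0Tr : (0 : ↥H) ∈ Tr := mem_subtype.2 h0T₀
    have hSE : ∀ x ∈ S.erase 0, x ∈ H := fun x hx => hSK x (mem_of_mem_erase hx)
    have hperr : Sr.erase 0 + Qr = Sr.erase 0 := by
      rw [hSr, ← subtype_erase_zero H S, ← subtype_add H hSE hQK, hper]
    have hQstabr : ∀ g : ↥H, g +ᵥ Sr.erase 0 = Sr.erase 0 → g ∈ Q' := by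
      intro g hg
      rw [hQ', AddSubgroup.mem_addSubgroupOf]
      apply hQstab
      rw [hSr, ← subtype_erase_zero H S, ← subtype_vadd H g] at hg
      apply Subset.antisymm
      · exact subset_of_subtype_subset H (fun x hx => by
          obtain ⟨y, hy, rfl⟩ := mem_vadd_finset.1 hx
          exact H.add_mem g.2 (hSE y hy)) (subset_of_eq hg)
      · exact subset_of_subtype_subset H hSE (subset_of_eq hg.symm)
    have hcardSr : #Sr = #S := card_subtype_of_forall_mem H hSK
    have hcardTr : #Tr = #T₀ := card_subtype_of_forall_mem H hT₀K
    have hcardQr : #Qr = #Qf := card_subtype_of_forall_mem H hQK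
    have hcardK : Fintype.card ↥H = #Hf := by
      rw [← Nat.card_eq_fintype_card]; exact natCard_eq_card_of_mem_iff H Hf hHf
    have hTSr : #(Tr + Sr) + 1 ≤ #Tr + #Sr := by
      rw [hTr, hSr, ← subtype_add H hT₀K hSK, card_subtype_of_forall_mem H (fun z hz => by
        obtain ⟨x, hx, s, hs, rfl⟩ := mem_add.1 hz; exact H.add_mem (hT₀K x hx) (hSK s hs)),
        hcardTr, hcardSr, hT₀S, hT₀c]
      omega
    have hTSnr : #Tr + #Sr + #Qr ≤ Fintype.card ↥H := by
      rw [hcardTr, hcardSr, hcardQr, hcardK, hT₀c]; omega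
    have hordr : ∀ s ∈ Sr, s ≠ 0 → #Sr ≤ addOrderOf s := by
      intro s hs hs0
      rw [hcardSr, ← AddSubgroup.addOrderOf_coe s]
      exact hord _ (mem_subtype.1 hs) (fun h => hs0 (ZeroMemClass.coe_eq_zero.1 h))
    -- Proposition 15 in `↥H`
    rcases subset_or_exists_isAP_image_of_card_add_le (G := ↥H) Q' Qr hQr h0Sr
        (closure_subtype_eq_top H hSH) h0Tr hperr hQstabr hTSr hTSnr hordr with hsub | ⟨d, hd, hSap, hTap⟩
    · -- (i) `T₁ − T₁ ⊆ Q`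
      left
      have hT₀Q : T₀ ⊆ Qf := subset_of_subtype_subset H hT₀K hsub
      intro z hz
      obtain ⟨t, ht, t', ht', rfl⟩ := mem_sub.1 hz
      have h1 : -t₁ + t ∈ Qf := hT₀Q (mem_vadd_finset.2 ⟨t, ht, rfl⟩)
      have h2 : -t₁ + t' ∈ Qf := hT₀Q (mem_vadd_finset.2 ⟨t', ht', rfl⟩)
      have := Q.sub_mem ((hQf _).1 h1) ((hQf _).1 h2)
      rw [show -t₁ + t - (-t₁ + t') = t - t' by abel] at this
      exact (hQf _).2 this
    · -- (ii) progressions with the same difference, pushed forward along `H/Q ↪ G/Q`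
      right
      set φ : ↥H ⧸ Q' →+ G ⧸ Q := QuotientAddGroup.map Q' Q H.subtype (fun x hx => by
        rw [hQ'] at hx
        exact hx) with hφ
      have hφmk : ∀ x : ↥H, φ (x : ↥H ⧸ Q') = ((x : G) : G ⧸ Q) := fun x =>
        QuotientAddGroup.map_mk _ _ _ _ x
      have hφinj : Function.Injective φ := by
        refine (injective_iff_map_eq_zero φ).2 fun x hx => ?_
        obtain ⟨y, rfl⟩ := QuotientAddGroup.mk_surjective x
        rw [hφmk, QuotientAddGroup.eq_zero_iff] at hx
        rw [QuotientAddGroup.eq_zero_iff, hQ', AddSubgroup.mem_addSubgroupOf]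
        exact hx
      have himS : (Sr.image (fun x : ↥H => (x : ↥H ⧸ Q'))).image φ =
          S.image (fun x : G => (x : G ⧸ Q)) := by
        ext c
        simp only [mem_image, hSr, mem_subtype]
        constructor
        · rintro ⟨y, ⟨s, hs, rfl⟩, rfl⟩; exact ⟨s, hs, (hφmk s).symm⟩
        · rintro ⟨s, hs, rfl⟩; exact ⟨(⟨s, hSK s hs⟩ : ↥H), ⟨⟨s, hSK s hs⟩, hs, rfl⟩, hφmk _⟩
      have himT : (Tr.image (fun x : ↥H => (x : ↥H ⧸ Q'))).image φ =
          T₀.image (fun x : G => (x : G ⧸ Q)) := by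
        ext c
        simp only [mem_image, hTr, mem_subtype]
        constructor
        · rintro ⟨y, ⟨s, hs, rfl⟩, rfl⟩; exact ⟨s, hs, (hφmk s).symm⟩
        · rintro ⟨s, hs, rfl⟩; exact ⟨(⟨s, hT₀K s hs⟩ : ↥H), ⟨⟨s, hT₀K s hs⟩, hs, rfl⟩, hφmk _⟩
      have hpush : ∀ {Y : Finset (↥H ⧸ Q')}, IsAP Y d → IsAP (Y.image φ) (φ d) := by
        intro Y hY
        obtain ⟨a, hYa⟩ := hY
        refine ⟨φ a, ?_⟩
        rw [card_image_of_injective _ hφinj]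
        conv_lhs => rw [hYa]
        ext c
        simp only [mem_image, mem_apFinset]
        constructor
        · rintro ⟨y, ⟨i, hi, rfl⟩, rfl⟩; exact ⟨i, hi, by rw [map_add, map_nsmul]⟩
        · rintro ⟨i, hi, rfl⟩; exact ⟨a + i • d, ⟨i, hi, rfl⟩, by rw [map_add, map_nsmul]⟩
      refine ⟨φ d, fun h => hd (hφinj (by rw [h, map_zero])), ?_, ?_⟩
      · rw [← himS]; exact hpush hSap
      · have h1 := hpush hTap
        rw [himT, hT₀, image_mk_vadd] at h1
        exact (isAP_vadd_iff _).1 h1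

/-! ### Groups whose prime factors are large: `Q = {0}` and the order condition are automatic -/

omit [DecidableEq G] in
/-- In a finite abelian group every non-zero element has order at least the least prime factor of
`|G|`; so if every prime factor of `|G|` is `≥ |S| + 2`, "every element in `S*` has order at least
`|S| + 1`". [cite: HamidouneSerraZemor2008, §8, Theorem 29 (the order hypothesis)] -/
theorem card_succ_le_addOrderOf_of_prime_factors {S : Finset G}
    (hbig : ∀ p : ℕ, p.Prime → p ∣ Fintype.card G → #S + 2 ≤ p) {s : G} (hs0 : s ≠ 0) :
    #S + 1 ≤ addOrderOf s := by
  have ho1 : addOrderOf s ≠ 1 := fun h => hs0 (AddMonoid.addOrderOf_eq_one_iff.1 h)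
  have hdvd : addOrderOf s ∣ Fintype.card G := addOrderOf_dvd_card
  have hp := Nat.minFac_prime ho1
  have h1 := hbig _ hp ((Nat.minFac_dvd _).trans hdvd)
  have h2 := Nat.minFac_le (addOrderOf_pos s)
  omega

/-- If every prime factor of `|G|` is `≥ |S| + 2`, then no non-zero subgroup `Q` has
`|S* + Q| − |S*| ≤ 1` ("`Q = {0}`" in Theorem 29): every set `P ⊇ S*` invariant under a non-zero
translation `q` contains a coset of `⟨q⟩` and so has `|P| ≥ o(q) ≥ |S| + 2`.
[cite: HamidouneSerraZemor2008, §8, Theorem 29 (the subgroup `Q`)] -/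
theorem card_succ_le_card_of_vadd_eq_of_prime_factors {S : Finset G} (hS2 : 2 ≤ #S)
    (hbig : ∀ p : ℕ, p.Prime → p ∣ Fintype.card G → #S + 2 ≤ p) {q : G} (hq : q ≠ 0)
    {P : Finset G} (hSP : S.erase 0 ⊆ P) (hqP : q +ᵥ P = P) : #S + 1 ≤ #P := by
  classical
  obtain ⟨x, hx⟩ : P.Nonempty := by
    have : (S.erase 0).Nonempty := by
      rw [← card_pos]
      have := card_erase_le (s := S) (a := 0)
      have h2 : #S - 1 ≤ #(S.erase 0) := pred_card_le_card_erase
      omega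
    exact this.mono hSP
  have hsub : apFinset x q (addOrderOf q) ⊆ P := by
    intro y hy
    obtain ⟨i, -, rfl⟩ := mem_apFinset.1 hy
    exact (mem_iff_add_nsmul_mem_of_vadd_eq hqP x i).1 hx
  have h1 := card_le_card hsub
  rw [card_apFinset_of_le_addOrderOf _ _ le_rfl] at h1
  have h2 := card_succ_le_addOrderOf_of_prime_factors hbig hq
  omega

/-- **[HamidouneSerraZemor2008, Theorem 29] in a group whose prime factors are large.**  Let `G` be
a finite abelian group with `gcd(|G|, 6) = 1` all of whose prime factors are `≥ |S| + 2`, `0 ∈ S`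
generating `G`, `|S| ≥ 4`, `|T| ≥ 3` and `|S + T| = |S| + |T| ≤ |G| − 4`.  Then `S` and `T` are
progressions or quasi-progressions with the same difference: `S ⊆ {a, …, a + |S| r}`,
`T ⊆ {b, …, b + |T| r}` for a generator `r`.  (The order hypothesis and "`Q = {0}`" of Theorem 29
hold automatically: `card_succ_le_addOrderOf_of_prime_factors`,
`card_succ_le_card_of_vadd_eq_of_prime_factors`; then the first item
`exists_subset_apFinset_of_card_add_le_of_forall_vadd`.)  E.g. `G = ℤ/n` with `n = 31 · 103` and
`|S| ≤ 29`. [cite: HamidouneSerraZemor2008, §8, Theorem 29 (first item)] -/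
theorem exists_subset_apFinset_of_card_add_eq_of_prime_factors {S T : Finset G}
    (hcop : (Fintype.card G).Coprime 6) (h0 : (0 : G) ∈ S)
    (hgen : AddSubgroup.closure (S : Set G) = ⊤) (hS4 : 4 ≤ #S)
    (hbig : ∀ p : ℕ, p.Prime → p ∣ Fintype.card G → #S + 2 ≤ p)
    (hT3 : 3 ≤ #T) (hST : #(S + T) ≤ #S + #T) (hSTn : #S + #T + 4 ≤ Fintype.card G) :
    ∃ r a b : G, AddSubgroup.zmultiples r = ⊤ ∧ S ⊆ apFinset a r (#S + 1) ∧
      T ⊆ apFinset b r (#T + 1) :=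
  exists_subset_apFinset_of_card_add_le_of_forall_vadd hcop h0 hgen hS4
    (fun _ _ hs0 => card_succ_le_addOrderOf_of_prime_factors hbig hs0)
    (fun _ hq _ hSP hqP => card_succ_le_card_of_vadd_eq_of_prime_factors (by omega) hbig hq hSP hqP)
    hT3 hST hSTn

/-- **Pair form without the normalisation `0 ∈ S`:** in a finite abelian group `G` with
`gcd(|G|, 6) = 1` all of whose prime factors are `≥ |A| + 2`, if `|A| ≥ 4`, `|B| ≥ 3`, the
differences `A − a₀` generate `G` for some `a₀ ∈ A`, and `|A + B| ≤ |A| + |B| ≤ |G| − 4`, then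
`A ⊆ {a, …, a + |A| r}` and `B ⊆ {b, …, b + |B| r}` for one generator `r` of `G`.  (Translate `A`
by `−a₀` and apply `exists_subset_apFinset_of_card_add_eq_of_prime_factors`; the generalization to
abelian groups of [HamidouneRodseth2000, Theorem 3] = `hamidouneRodseth_inverse_theorem`.)
[cite: HamidouneSerraZemor2008, §8, Theorem 29 (first item)] -/
theorem exists_subset_apFinset_pair_of_prime_factors {A B : Finset G}
    (hcop : (Fintype.card G).Coprime 6) (hA4 : 4 ≤ #A) (hB3 : 3 ≤ #B)
    (hbig : ∀ p : ℕ, p.Prime → p ∣ Fintype.card G → #A + 2 ≤ p)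
    {a₀ : G} (ha₀ : a₀ ∈ A) (hgen : AddSubgroup.closure ((-a₀ +ᵥ A : Finset G) : Set G) = ⊤)
    (hAB : #(A + B) ≤ #A + #B) (hABn : #A + #B + 4 ≤ Fintype.card G) :
    ∃ r a b : G, AddSubgroup.zmultiples r = ⊤ ∧ A ⊆ apFinset a r (#A + 1) ∧
      B ⊆ apFinset b r (#B + 1) := by
  classical
  set S := -a₀ +ᵥ A with hS
  have h0 : (0 : G) ∈ S := mem_vadd_finset.2 ⟨a₀, ha₀, by rw [vadd_eq_add, neg_add_cancel]⟩
  have hSc : #S = #A := card_vadd_finset _ _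
  have hSB : #(S + B) = #(A + B) := by
    rw [hS, ← singleton_add, add_assoc, singleton_add, card_vadd_finset]
  obtain ⟨r, a, b, hr, hSsub, hBsub⟩ := exists_subset_apFinset_of_card_add_eq_of_prime_factors
    (S := S) (T := B) hcop h0 hgen (by omega) (by rw [hSc]; exact hbig) hB3 (by rw [hSB, hSc]; exact hAB)
    (by rw [hSc]; exact hABn)
  refine ⟨r, a₀ + a, b, hr, ?_, hBsub⟩
  have h1 : a₀ +ᵥ S ⊆ apFinset (a₀ + a) r (#A + 1) := by
    rw [← hSc, ← vadd_apFinset]; exact vadd_finset_subset_vadd_finset hSsub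
  intro x hx
  exact h1 (mem_vadd_finset.2 ⟨-a₀ + x, by rw [hS]; exact mem_vadd_finset.2 ⟨x, hx, rfl⟩,
    by rw [vadd_eq_add, add_neg_cancel_left]⟩)

/-- **Vosper's alternative in an abelian group whose prime factors are `≥ |A|`** (Proposition 15
with `Q = {0}`, where the stabilizer and order hypotheses hold automatically): if every prime factor
of `|G|` is `≥ |A|`, `|A|, |B| ≥ 2`, the differences `A − a₀` generate `G` for some `a₀ ∈ A`, and
`|A + B| ≤ |A| + |B| − 1 ≤ |G| − 3` (precisely `|A + B| + 2 ≤ |G|`), then `A` and `B` are arithmetic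
progressions with a common difference `d ≠ 0`.  (Translate `A`, `B` through `0`; a non-zero period
`d` of `S* = (A − a₀) ∖ {0}` would give `o(d) ≤ |A| − 1 < p_min ≤ o(d)`; every non-zero element has
order `≥ p_min ≥ |A|`; then `eq_singleton_or_isAP_of_card_add_le_of_forall_card_le_addOrderOf`.)
In `ℤ/pℤ` this is Vosper's theorem (`Literature.Combinatorics.Additive.vosper`); e.g. it applies in
`ℤ/n`, `n = 31 · 103`, to blocks with `|A| ≤ 31` whose differences generate.
[cite: HamidouneSerraZemor2008, §3, Proposition 15 (case `Q = {0}`)] -/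
theorem exists_isAP_pair_of_card_add_le_of_prime_factors {A B : Finset G}
    (hbig : ∀ p : ℕ, p.Prime → p ∣ Fintype.card G → #A ≤ p) (hA2 : 2 ≤ #A) (hB2 : 2 ≤ #B)
    {a₀ : G} (ha₀ : a₀ ∈ A) (hgen : AddSubgroup.closure ((-a₀ +ᵥ A : Finset G) : Set G) = ⊤)
    (hAB : #(A + B) + 1 ≤ #A + #B) (hABn : #(A + B) + 2 ≤ Fintype.card G) :
    ∃ d : G, d ≠ 0 ∧ IsAP A d ∧ IsAP B d := by
  classical
  -- orders of non-zero elements are `≥ |A|`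
  have hordG : ∀ x : G, x ≠ 0 → #A ≤ addOrderOf x := by
    intro x hx0
    have ho1 : addOrderOf x ≠ 1 := fun h => hx0 (AddMonoid.addOrderOf_eq_one_iff.1 h)
    have hp := Nat.minFac_prime ho1
    have h1 := hbig _ hp ((Nat.minFac_dvd _).trans addOrderOf_dvd_card)
    have h2 := Nat.minFac_le (addOrderOf_pos x)
    omega
  obtain ⟨b₀, hb₀⟩ : B.Nonempty := card_pos.1 (by omega)
  set S := -a₀ +ᵥ A with hS
  set T := -b₀ +ᵥ B with hT
  have h0S : (0 : G) ∈ S := mem_vadd_finset.2 ⟨a₀, ha₀, by rw [vadd_eq_add, neg_add_cancel]⟩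
  have h0T : (0 : G) ∈ T := mem_vadd_finset.2 ⟨b₀, hb₀, by rw [vadd_eq_add, neg_add_cancel]⟩
  have hSc : #S = #A := card_vadd_finset _ _
  have hTc : #T = #B := card_vadd_finset _ _
  have hTS : #(T + S) = #(A + B) := by
    rw [hT, hS, ← singleton_add, ← singleton_add, add_add_add_comm, singleton_add_singleton,
      singleton_add, card_vadd_finset, add_comm B A]
  -- `S*` has no non-zero period
  have hstab : ∀ d : G, d ≠ 0 → d +ᵥ S.erase 0 ≠ S.erase 0 := by
    intro d hd hP
    obtain ⟨x, hx⟩ : (S.erase 0).Nonempty := by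
      rw [← card_pos]
      have := pred_card_le_card_erase (s := S) (a := 0)
      omega
    have hsub : apFinset x d (addOrderOf d) ⊆ S.erase 0 := by
      intro y hy
      obtain ⟨i, -, rfl⟩ := mem_apFinset.1 hy
      exact (mem_iff_add_nsmul_mem_of_vadd_eq hP x i).1 hx
    have h1 := card_le_card hsub
    rw [card_apFinset_of_le_addOrderOf _ _ le_rfl, card_erase_of_mem h0S] at h1
    have h2 := hordG d hd
    omega
  rcases eq_singleton_or_isAP_of_card_add_le_of_forall_card_le_addOrderOf h0S hgen h0T hstab
      (by rw [hTS, hTc, hSc, add_comm #B]; exact hAB) (by rw [hTS]; exact hABn)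
      (fun s _ hs0 => by rw [hSc]; exact hordG s hs0) with h1 | ⟨d, hd, hSd, hTd⟩
  · rw [h1, card_singleton] at hTc; omega
  · exact ⟨d, hd, (isAP_vadd_iff (-a₀)).1 (hS ▸ hSd), (isAP_vadd_iff (-b₀)).1 (hT ▸ hTd)⟩

end Isoperimetric

end Literature.Combinatorics.Additive
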